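import Literature.NumberTheory.Sieve.BombieriFriedlanderIwaniecLemma1OffdiagFromDI11
import Mathlib.Analysis.Distribution.SchwartzSpace.Fourier
import Mathlib.Analysis.Fourier.Inversion
import Mathlib.Analysis.Calculus.ContDiff.WithLp
import Mathlib.Analysis.SpecialFunctions.Pow.Deriv
import HarnessLib

/-!
# Deshouillers–Iwaniec's Theorem 11 at `s = 1` from the Kuznetsov-shaped bound of their §9.1

This file carries out, sorry-free, the step of §9.1 of Deshouillers–Iwaniec [DeshouillersIwaniec1982]
that they leave to the reader (p. 278: the proof of Theorems 10–11 is printed only for weights of the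
special type (9.1), "proofs of the general forms … can be quickly supplied by any reader who went
through section 7"), at `s = 1` for the dilation weights `g(c, m) = g₀(c/C, m/M)` used by
Bombieri–Friedlander–Iwaniec (the predicate `BFI.L1.DI11For g₀` of
`BombieriFriedlanderIwaniecLemma1OffdiagFromDI11`), taking as its ONLY hypothesis the
Kuznetsov-shaped estimate of §9.1 (their (9.4) together with the refinement (9.7) for the
characteristic sequence of an interval; in modern form Drappeau [Drappeau2017, Prop. 4.12] with
`q = 1`), here the parametrised predicate `BFI.L1.H91At ε`.

Main results:

* `BFI.L1.di11For_of_H91 : (∀ ε > 0, H91At ε) → DI11For g₀` for every smooth `g₀` with compact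
  support in `[1, 2] × (0, ∞)` (Theorem 11 at `s = 1`, [DeshouillersIwaniec1982, p. 237, §9.1 p. 278]);
* `BombieriFriedlanderIwaniecTheorem5_of_H91`, `…Theorem1_of_H91`, `…Theorem10_of_H91`,
  `bfi_wellFactorable_level_of_H91`, `twinSieve_bfi_of_H91`: BFI 1986 Theorems 5, 1, 10, the
  level-`4/7` fact and the twin-prime sieve bound, all from `∀ ε > 0, H91At ε`.

## The argument (Deshouillers–Iwaniec §9.1 p. 278 / Drappeau §4.3.2, made explicit)

1. *Separation of variables.*  With `h(v, y) = g₀(e^v, y)` (a Schwartz function on `ℝ²`),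
   Fourier inversion gives `g₀(x, y) = ∫ ĥ(w) e(w₀ log x + w₁ y) dw` (`BFI.L1.dilation_eq_integral`),
   and `ĥ` decays faster than any polynomial (`BFI.L1.FT_decay`).
2. *The phase.*  Since `x = 4π√(mn)/(c√r)` we have
   `e(w₀ log(c/C)) = e(w₀ log(4π/C)) m^{πiw₀} n^{πiw₀} r^{-πiw₀} x^{-2πiw₀}`
   (`BFI.L1.e_log_div_eq`), so after inserting a smooth partition `∑_ℓ P_ℓ(x) = 1` of the range of
   `x` into pieces of ratio `< 2` (`BFI.L1.sum_pieceT_eq_one`) each term becomes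
   `(4π m^κ e(w₁m/M)) (n^κ e(−(w₀/2) log r)) (c√r)⁻¹ φ_{ℓ,w}(x)` with `κ = 1/2 + πiw₀` and the test
   function `φ_{ℓ,w}(x) = P_ℓ(x) x^{−1−2πiw₀}` (`BFI.L1.separated_summand`, `BFI.L1.testFn`), whose
   derivatives obey `|φ^{(j)}| ≤ 2·20⁴K₄(|s|+4)⁴ X^{−1−j}` (`BFI.L1.norm_iteratedDeriv_testFn_le`).
3. *Abel summation in `m`* against `m^κ`, `re κ = 1/2` (`BFI.L1.abel_cpow_bound`), reduces to the
   Kuznetsov-shaped partial sums `BFI.L1.kuzSum` over `m ∈ (a, k]` with the additive twist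
   `e(w₁ m/M)`: exactly the sums bounded by §9.1 / Prop. 4.12 (`BFI.L1.norm_Sl_le`).
4. *The frequency integral* converges thanks to `∫ |ĥ(w)| (1 + ‖w‖)⁵ dw < ∞`
   (`BFI.L1.norm_pieceSum_le`).
5. *Conversion* `√(MN) X⁻¹ (L_reg + L_exc) ≪ (K_reg + K_exc) √M ≪ L √M`
   (`BFI.L1.reg_conversion`, `BFI.L1.exc_conversion`, `BFI.L1.Ksum_le_diL`; cf. the end of the proof
   of [Drappeau2017, Prop. 4.13]).
6. *Dyadic bookkeeping*: `n` in dyadic blocks, `m` in `O(1)` pieces, `5` pieces in `x`; the number of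
   blocks costs `N^δ` (`BFI.L1.di11For_of_H91`).

## On the hypothesis `H91At`

`H91At ε` is the statement, for smooth test functions `φ` supported in `[X, 2X]` with
`|φ^{(j)}| ≤ X^{-j}`, `M, N, R ≥ 1/2`, `θ ∈ ℝ` and coefficients `β_{n,r}`, of the bound
`|∑_{r∼R} ∑_{n∼N} β_{nr} ∑_{a<m≤u} e(θm) ∑_{(c,r)=1} (c√r)⁻¹ φ(4π√(mn)/(c√r)) S(m r̄, ±n; c)|
   ≤ K ((X+X⁻¹)RMN)^ε (L_reg + L_exc) ‖β‖₂`
with `L_reg`, `L_exc` as in [DeshouillersIwaniec1982, (9.4), (9.7)] at `S = 1/2`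
(`BFI.L1.Lreg`, `BFI.L1.Lexc`).  Deshouillers–Iwaniec obtain it in §9.1 from Kuznetsov's formula
for `Γ₀(rs)` at the cusps `∞` and `1/s` (their Lemma 2.2 identifies `S(m s̄, n; c)`-type sums with
the Kloosterman sums `S_{∞,1/s}`), the large-sieve inequalities of their Theorem 2 (regular
spectrum) and Theorems 5–7 (exceptional spectrum); Drappeau [Drappeau2017, Prop. 4.12] states it
with an additional nebentypus.  It is a cited, as yet unproved statement — the explicit hypothesis
of every `_of_H91` result of this file (so these results are honest conditionals and discharge
nothing by themselves) — pending the automorphic side in `Literature/NumberTheory/Automorphic`.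

## References

* [DeshouillersIwaniec1982] J.-M. Deshouillers, H. Iwaniec, *Kloosterman sums and Fourier
  coefficients of cusp forms*, Invent. Math. 70 (1982), 219–288: Theorem 11 p. 237, §9.1–9.2
  pp. 278–282.
* [Drappeau2017] S. Drappeau, *Sums of Kloosterman sums in arithmetic progressions, and the error
  term in the dispersion method*, Proc. LMS 114 (2017), 684–732: Prop. 4.12, Prop. 4.13, §4.3.3.
* [BombieriFriedlanderIwaniecActa1986] E. Bombieri, J. Friedlander, H. Iwaniec, *Primes in
  arithmetic progressions to large moduli*, Acta Math. 156 (1986), 203–251: Lemma 1, Theorems 1, 5, 10.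
-/

noncomputable section

open Finset Real MeasureTheory
open scoped ContDiff FourierTransform Topology

namespace Literature.NumberTheory.Sieve

namespace BFI

namespace L1


/-! ### Separation of variables for a dilation weight (Deshouillers–Iwaniec §7): the plane `ℝ²` -/

/-- The plane `ℝ²` with its Euclidean structure (for the two-dimensional Fourier transform). [folklore] -/
abbrev E2 : Type := EuclideanSpace ℝ (Fin 2)

/-- The point `(v, y)` of `ℝ²`. [folklore] -/
def pt (v y : ℝ) : E2 := WithLp.toLp 2 ![v, y]

/-- First coordinate of `pt v y`. [folklore] -/
@[simp] theorem pt_zero (v y : ℝ) : (pt v y).ofLp 0 = v := rfl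

/-- Second coordinate of `pt v y`. [folklore] -/
@[simp] theorem pt_one (v y : ℝ) : (pt v y).ofLp 1 = y := rfl

/-- The coordinates of `ℝ²` are smooth. [folklore] -/
theorem contDiff_coord (i : Fin 2) : ContDiff ℝ ∞ fun p : E2 => p.ofLp i :=
  (contDiff_apply ℝ ℝ i).comp PiLp.contDiff_ofLp

/-- The coordinates of `ℝ²` are continuous. [folklore] -/
theorem continuous_coord (i : Fin 2) : Continuous fun p : E2 => p.ofLp i :=
  (contDiff_coord i).continuous

/-- `|p_i| ≤ ‖p‖`. [folklore] -/
theorem abs_coord_le_norm (p : E2) (i : Fin 2) : |p.ofLp i| ≤ ‖p‖ := by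
  have h := EuclideanSpace.norm_sq_eq p
  rw [Fin.sum_univ_two, Real.norm_eq_abs, Real.norm_eq_abs] at h
  have hi : (p.ofLp i) ^ 2 ≤ ‖p‖ ^ 2 := by
    fin_cases i
    · show (p.ofLp 0) ^ 2 ≤ ‖p‖ ^ 2
      rw [← sq_abs (p.ofLp 0)]; nlinarith [sq_nonneg |p.ofLp 1|]
    · show (p.ofLp 1) ^ 2 ≤ ‖p‖ ^ 2
      rw [← sq_abs (p.ofLp 1)]; nlinarith [sq_nonneg |p.ofLp 0|]
  exact abs_le_of_sq_le_sq hi (norm_nonneg p)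

/-- `‖p‖ ≤ |p₀| + |p₁|`. [folklore] -/
theorem norm_le_abs_add_abs (p : E2) : ‖p‖ ≤ |p.ofLp 0| + |p.ofLp 1| := by
  have h := EuclideanSpace.norm_sq_eq p
  rw [Fin.sum_univ_two, Real.norm_eq_abs, Real.norm_eq_abs] at h
  have h2 : ‖p‖ ^ 2 ≤ (|p.ofLp 0| + |p.ofLp 1|) ^ 2 := by
    rw [h]; nlinarith [abs_nonneg (p.ofLp 0), abs_nonneg (p.ofLp 1)]
  have := abs_le_of_sq_le_sq h2 (by positivity)
  rwa [abs_of_nonneg (norm_nonneg p)] at this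

/-- `⟪w, pt v y⟫ = w₀ v + w₁ y`. [folklore] -/
theorem inner_pt (w : E2) (v y : ℝ) : inner ℝ w (pt v y) = w.ofLp 0 * v + w.ofLp 1 * y := by
  rw [PiLp.inner_apply, Fin.sum_univ_two, pt_zero, pt_one, RCLike.inner_apply, RCLike.inner_apply]
  simp only [conj_trivial]
  ring

/-! ### The logarithmic pull-back `h(v, y) = g₀(e^v, y)` and its Fourier transform -/

variable {g₀ : ℝ × ℝ → ℝ}

/-- `h(v, y) = g₀(e^v, y)` as a complex-valued function on `ℝ²`. [folklore] -/
def logPull (g₀ : ℝ × ℝ → ℝ) (p : E2) : ℂ := ((g₀ (Real.exp (p.ofLp 0), p.ofLp 1) : ℝ) : ℂ)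

/-- `h` is smooth when `g₀` is. [folklore] -/
theorem contDiff_logPull (hg : ContDiff ℝ ∞ g₀) : ContDiff ℝ ∞ (logPull g₀) := by
  unfold logPull
  refine Complex.ofRealCLM.contDiff.comp (hg.comp ?_)
  exact (Real.contDiff_exp.comp (contDiff_coord 0)).prodMk (contDiff_coord 1)

/-- `h` is continuous when `g₀` is smooth. [folklore] -/
theorem continuous_logPull (hg : ContDiff ℝ ∞ g₀) : Continuous (logPull g₀) :=
  (contDiff_logPull hg).continuous

/-- `h` has compact support when `g₀` has compact support inside `[1, 2] × (0, ∞)`. [folklore] -/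
theorem hasCompactSupport_logPull (hc : HasCompactSupport g₀)
    (hsupp : tsupport g₀ ⊆ Set.Icc (1 : ℝ) 2 ×ˢ Set.Ioi (0 : ℝ)) : HasCompactSupport (logPull g₀) := by
  obtain ⟨B, hB⟩ := hc.isCompact.isBounded.subset_closedBall 0
  set K : Set E2 := {p | p.ofLp 0 ∈ Set.Icc (0 : ℝ) (Real.log 2) ∧ p.ofLp 1 ∈ Set.Icc (-B) B} with hK
  have hKc : IsClosed K :=
    (isClosed_Icc.preimage (continuous_coord 0)).inter (isClosed_Icc.preimage (continuous_coord 1))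
  have hKb : Bornology.IsBounded K := by
    refine (Metric.isBounded_closedBall (x := (0 : E2)) (r := Real.log 2 + B)).subset fun p hp => ?_
    rw [Metric.mem_closedBall, dist_zero_right]
    obtain ⟨h0, h1⟩ := hp
    have := norm_le_abs_add_abs p
    have a0 : |p.ofLp 0| ≤ Real.log 2 := abs_le.2 ⟨by linarith [h0.1, Real.log_nonneg one_le_two], h0.2⟩
    have a1 : |p.ofLp 1| ≤ B := abs_le.2 ⟨by linarith [h1.1], h1.2⟩
    linarith
  refine HasCompactSupport.intro (Metric.isCompact_of_isClosed_isBounded hKc hKb) fun p hp => ?_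
  -- outside `K`, `g₀(e^{p₀}, p₁) = 0`
  unfold logPull
  by_contra hne
  have hne' : g₀ (Real.exp (p.ofLp 0), p.ofLp 1) ≠ 0 := by
    intro h0; exact hne (by rw [h0]; simp)
  have hmem : (Real.exp (p.ofLp 0), p.ofLp 1) ∈ tsupport g₀ := subset_tsupport _ hne'
  have h12 := hsupp hmem
  rw [Set.mem_prod, Set.mem_Icc] at h12
  have hball := hB hmem
  rw [Metric.mem_closedBall, dist_zero_right] at hball
  have hy : |p.ofLp 1| ≤ B := by
    have h2 := norm_snd_le (Real.exp (p.ofLp 0), p.ofLp 1)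
    rw [Real.norm_eq_abs] at h2
    exact h2.trans hball
  apply hp
  refine ⟨⟨?_, ?_⟩, abs_le.1 hy⟩
  · have := h12.1.1
    by_contra hlt; rw [not_le] at hlt
    have : Real.exp (p.ofLp 0) < 1 := by simpa using Real.exp_lt_exp.2 hlt
    linarith
  · have h2 := h12.1.2
    by_contra hlt; rw [not_le] at hlt
    have : (2 : ℝ) < Real.exp (p.ofLp 0) := by
      calc (2 : ℝ) = Real.exp (Real.log 2) := (Real.exp_log two_pos).symm
        _ < Real.exp (p.ofLp 0) := Real.exp_lt_exp.2 hlt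
    linarith

/-- `h` as a Schwartz function. [folklore] -/
def schw (hg : ContDiff ℝ ∞ g₀) (hc : HasCompactSupport g₀)
    (hsupp : tsupport g₀ ⊆ Set.Icc (1 : ℝ) 2 ×ˢ Set.Ioi (0 : ℝ)) : SchwartzMap E2 ℂ :=
  (hasCompactSupport_logPull hc hsupp).toSchwartzMap (contDiff_logPull hg)

/-- **The Fourier transform `ĥ` of `h`, a Schwartz function on `ℝ²`.** [folklore] -/
def FT (hg : ContDiff ℝ ∞ g₀) (hc : HasCompactSupport g₀)
    (hsupp : tsupport g₀ ⊆ Set.Icc (1 : ℝ) 2 ×ˢ Set.Ioi (0 : ℝ)) : SchwartzMap E2 ℂ :=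
  SchwartzMap.fourierTransformCLM ℂ (schw hg hc hsupp)

/-- The Schwartz function `h` coerces to `logPull`. [folklore] -/
theorem schw_coe (hg : ContDiff ℝ ∞ g₀) (hc : HasCompactSupport g₀)
    (hsupp : tsupport g₀ ⊆ Set.Icc (1 : ℝ) 2 ×ˢ Set.Ioi (0 : ℝ)) : ⇑(schw hg hc hsupp) = logPull g₀ := rfl

/-- `ĥ = 𝓕 h` as functions. [folklore] -/
theorem FT_coe (hg : ContDiff ℝ ∞ g₀) (hc : HasCompactSupport g₀)
    (hsupp : tsupport g₀ ⊆ Set.Icc (1 : ℝ) 2 ×ˢ Set.Ioi (0 : ℝ)) :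
    ⇑(FT hg hc hsupp) = 𝓕 (logPull g₀) := by
  rw [FT, SchwartzMap.fourierTransformCLM_apply, SchwartzMap.fourier_coe, schw_coe]

/-- **Schwartz decay of `ĥ`**: `(1 + ‖w‖)^k |ĥ(w)| ≤ A_k`. [folklore] -/
theorem FT_decay (hg : ContDiff ℝ ∞ g₀) (hc : HasCompactSupport g₀)
    (hsupp : tsupport g₀ ⊆ Set.Icc (1 : ℝ) 2 ×ˢ Set.Ioi (0 : ℝ)) (k : ℕ) :
    ∃ A : ℝ, 0 ≤ A ∧ ∀ w : E2, (1 + ‖w‖) ^ k * ‖FT hg hc hsupp w‖ ≤ A := by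
  refine ⟨2 ^ k * ((Finset.Iic (k, 0)).sup fun m => SchwartzMap.seminorm ℂ m.1 m.2) (FT hg hc hsupp),
    by positivity, fun w => ?_⟩
  have := SchwartzMap.one_add_le_sup_seminorm_apply (𝕜 := ℂ) (m := (k, 0)) (k := k) (n := 0)
    le_rfl le_rfl (FT hg hc hsupp) w
  rwa [norm_iteratedFDeriv_zero] at this

/-- **Fourier inversion for `h`**: `h(p) = ∫ e(⟪w, p⟫) ĥ(w) dw`. [folklore] -/
theorem logPull_eq_integral (hg : ContDiff ℝ ∞ g₀) (hc : HasCompactSupport g₀)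
    (hsupp : tsupport g₀ ⊆ Set.Icc (1 : ℝ) 2 ×ˢ Set.Ioi (0 : ℝ)) (p : E2) :
    logPull g₀ p = ∫ w : E2, ((𝐞 (inner ℝ w p) : Circle) : ℂ) * FT hg hc hsupp w := by
  have hint : Integrable (logPull g₀) :=
    (continuous_logPull hg).integrable_of_hasCompactSupport (hasCompactSupport_logPull hc hsupp)
  have hint' : Integrable (𝓕 (logPull g₀)) := by
    rw [← FT_coe hg hc hsupp]; exact (FT hg hc hsupp).integrable
  have hinv := (continuous_logPull hg).fourierInv_fourier_eq hint hint'
  have := congrFun hinv p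
  rw [← this, Real.fourierInv_eq, ← FT_coe hg hc hsupp]
  refine integral_congr_ae (Filter.Eventually.of_forall fun w => ?_)
  simp only [Circle.smul_def, smul_eq_mul]

/-- **Separation of variables for the dilation weight**: for `x > 0`,
`g₀(x, y) = ∫_{ℝ²} ĥ(w) e(w₀ log x + w₁ y) dw` (`e(w₀ log x) = x^{2πi w₀}`).
[cite: DeshouillersIwaniec1982, §7 ("separation of variables"); §9.1 p. 278] -/
theorem dilation_eq_integral (hg : ContDiff ℝ ∞ g₀) (hc : HasCompactSupport g₀)
    (hsupp : tsupport g₀ ⊆ Set.Icc (1 : ℝ) 2 ×ˢ Set.Ioi (0 : ℝ)) {x : ℝ} (hx : 0 < x) (y : ℝ) :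
    ((g₀ (x, y) : ℝ) : ℂ) =
      ∫ w : E2, ((𝐞 (w.ofLp 0 * Real.log x + w.ofLp 1 * y) : Circle) : ℂ) * FT hg hc hsupp w := by
  have h := logPull_eq_integral hg hc hsupp (pt (Real.log x) y)
  have e1 : logPull g₀ (pt (Real.log x) y) = ((g₀ (x, y) : ℝ) : ℂ) := by
    unfold logPull; rw [pt_zero, pt_one, Real.exp_log hx]
  rw [← e1, h]
  refine integral_congr_ae (Filter.Eventually.of_forall fun w => ?_)
  dsimp only
  rw [inner_pt]

/-- The decay makes `|ĥ(w)| (1 + ‖w‖)^j` integrable on `ℝ²` for every `j`. [folklore] -/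
theorem integrable_FT_mul_pow (hg : ContDiff ℝ ∞ g₀) (hc : HasCompactSupport g₀)
    (hsupp : tsupport g₀ ⊆ Set.Icc (1 : ℝ) 2 ×ˢ Set.Ioi (0 : ℝ)) (j : ℕ) :
    Integrable fun w : E2 => ‖FT hg hc hsupp w‖ * (1 + ‖w‖) ^ j := by
  obtain ⟨A, hA0, hA⟩ := FT_decay hg hc hsupp (j + 3)
  have hdom : Integrable fun w : E2 => A * (1 + ‖w‖) ^ (-(3 : ℝ)) := by
    refine (integrable_one_add_norm ?_).const_mul A
    simp [finrank_euclideanSpace]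
    norm_num
  refine hdom.mono' ?_ (Filter.Eventually.of_forall fun w => ?_)
  · exact ((FT hg hc hsupp).continuous.norm.mul
      ((continuous_const.add continuous_norm).pow j)).aestronglyMeasurable
  · rw [Real.norm_of_nonneg (by positivity)]
    have h1 : 0 < 1 + ‖w‖ := by positivity
    have key := hA w
    -- `‖F‖ (1+‖w‖)^j = (1+‖w‖)^{j+3}‖F‖ · (1+‖w‖)^{-3}`
    have e : ‖FT hg hc hsupp w‖ * (1 + ‖w‖) ^ j =
        ((1 + ‖w‖) ^ (j + 3) * ‖FT hg hc hsupp w‖) * (1 + ‖w‖) ^ (-(3 : ℝ)) := by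
      rw [Real.rpow_neg h1.le, show (3 : ℝ) = ((3 : ℕ) : ℝ) by norm_num, Real.rpow_natCast, pow_add]
      field_simp
    rw [e]
    exact mul_le_mul_of_nonneg_right key (Real.rpow_nonneg h1.le _)




/-! ### Complex powers `x ↦ x^s` on `(0, ∞)`: iterated derivatives -/

/-- `x ↦ x^s` (`x` real, `s` complex). [folklore] -/
def cpw (s : ℂ) (x : ℝ) : ℂ := (x : ℂ) ^ s

/-- The falling factorial `s(s − 1)⋯(s − k + 1)`. [folklore] -/
def cpwCoef (s : ℂ) (k : ℕ) : ℂ := ∏ i ∈ Finset.range k, (s - i)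

/-- `|s(s−1)⋯(s−k+1)| ≤ (|s| + k)^k`. [folklore] -/
theorem norm_cpwCoef_le (s : ℂ) (k : ℕ) : ‖cpwCoef s k‖ ≤ (‖s‖ + k) ^ k := by
  unfold cpwCoef
  rw [norm_prod]
  calc ∏ i ∈ Finset.range k, ‖s - (i : ℂ)‖ ≤ ∏ _i ∈ Finset.range k, (‖s‖ + k) := by
        refine Finset.prod_le_prod (fun i _ => norm_nonneg _) fun i hi => ?_
        have hik : (i : ℝ) ≤ k := by exact_mod_cast (Finset.mem_range.1 hi).le
        calc ‖s - (i : ℂ)‖ ≤ ‖s‖ + ‖(i : ℂ)‖ := norm_sub_le _ _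
          _ = ‖s‖ + i := by rw [Complex.norm_natCast]
          _ ≤ ‖s‖ + k := by linarith
    _ = (‖s‖ + k) ^ k := by rw [Finset.prod_const, Finset.card_range]

/-- For `x > 0`, `x^s = exp(s log x)`. [folklore] -/
theorem cpw_eq_exp {s : ℂ} {x : ℝ} (hx : 0 < x) : cpw s x = Complex.exp ((Real.log x : ℂ) * s) := by
  unfold cpw
  rw [Complex.cpow_def_of_ne_zero (by exact_mod_cast hx.ne'), Complex.ofReal_log hx.le]

/-- `x ↦ x^s` is smooth on `(0, ∞)`. [folklore] -/
theorem contDiffOn_cpw (s : ℂ) {n : ℕ∞} : ContDiffOn ℝ n (cpw s) (Set.Ioi 0) := by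
  have h : ContDiffOn ℝ n (fun x : ℝ => Complex.exp ((Real.log x : ℂ) * s)) (Set.Ioi 0) := by
    refine Complex.contDiff_exp.comp_contDiffOn (ContDiffOn.mul ?_ contDiffOn_const)
    refine Complex.ofRealCLM.contDiff.comp_contDiffOn ?_
    exact Real.contDiffOn_log.mono fun x hx => ne_of_gt hx
  exact h.congr fun x hx => cpw_eq_exp hx

/-- **`(x^s)^{(k)} = s(s−1)⋯(s−k+1) x^{s−k}` on `(0, ∞)`** (for `s` off `ℕ`, so that no exponent
vanishes along the way; we assume `re s < 0`). [folklore] -/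
theorem iteratedDerivWithin_cpw {s : ℂ} (hs : s.re < 0) (k : ℕ) {x : ℝ} (hx : 0 < x) :
    iteratedDerivWithin k (cpw s) (Set.Ioi 0) x = cpwCoef s k * cpw (s - k) x := by
  induction k generalizing x with
  | zero => simp [cpwCoef, cpw]
  | succ k ih =>
    rw [iteratedDerivWithin_succ]
    have hopen : IsOpen (Set.Ioi (0 : ℝ)) := isOpen_Ioi
    -- on `(0,∞)` the `k`-th derivative is `P_k · x^{s-k}`
    have heq : Set.EqOn (iteratedDerivWithin k (cpw s) (Set.Ioi 0))
        (fun y => cpwCoef s k * cpw (s - k) y) (Set.Ioi 0) := fun y hy => ih hy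
    rw [derivWithin_congr heq (ih hx), derivWithin_of_isOpen hopen hx]
    have hsk : s - (k : ℂ) ≠ 0 := by
      intro h0; have := congrArg Complex.re h0; simp at this; linarith
    have hd : HasDerivAt (fun y : ℝ => cpwCoef s k * cpw (s - k) y)
        (cpwCoef s k * ((s - k) * (x : ℂ) ^ (s - k - 1))) x := by
      unfold cpw
      exact (hasDerivAt_ofReal_cpow_const hx.ne' hsk).const_mul _
    rw [hd.deriv]
    unfold cpwCoef cpw
    rw [Finset.prod_range_succ]
    push_cast
    ring_nf

/-- The size of `(x^s)^{(k)}` on `(0, ∞)`: `= |s(s−1)⋯| x^{re s − k}`. [folklore] -/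
theorem norm_iteratedDerivWithin_cpw {s : ℂ} (hs : s.re < 0) (k : ℕ) {x : ℝ} (hx : 0 < x) :
    ‖iteratedDerivWithin k (cpw s) (Set.Ioi 0) x‖ = ‖cpwCoef s k‖ * x ^ (s.re - k) := by
  rw [iteratedDerivWithin_cpw hs k hx, norm_mul]
  unfold cpw
  rw [Complex.norm_cpow_eq_rpow_re_of_pos hx]
  simp


/-! ### Smooth dyadic pieces of ratio `< 2`: `P_t = σ_t − σ_{1.8t}` -/

/-- `σ_t(x) = ψ(20x/t − 19)`: `0` for `x ≤ 0.95t`, `1` for `x ≥ t`. [folklore] -/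
def sigT (t x : ℝ) : ℝ := Real.smoothTransition (20 * t⁻¹ * x - 19)

/-- `σ_t(x) = 0` for `x ≤ 0.95 t` (`t > 0`). [folklore] -/
theorem sigT_eq_zero {t x : ℝ} (ht : 0 < t) (hx : x ≤ 19 / 20 * t) : sigT t x = 0 := by
  refine Real.smoothTransition.zero_of_nonpos ?_
  rw [mul_assoc, mul_comm t⁻¹ x, ← div_eq_mul_inv, sub_nonpos, ← le_div_iff₀' (by norm_num : (0:ℝ) < 20),
    div_le_iff₀ ht]
  linarith

/-- `σ_t(x) = 1` for `x ≥ t` (`t > 0`). [folklore] -/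
theorem sigT_eq_one {t x : ℝ} (ht : 0 < t) (hx : t ≤ x) : sigT t x = 1 := by
  refine Real.smoothTransition.one_of_one_le ?_
  have : 20 * t⁻¹ * x = 20 * (x / t) := by ring
  rw [this]
  have h1 : 1 ≤ x / t := by rw [le_div_iff₀ ht]; linarith
  linarith

/-- `σ_t ≥ 0`. [folklore] -/
theorem sigT_nonneg (t x : ℝ) : 0 ≤ sigT t x := Real.smoothTransition.nonneg _
/-- `σ_t ≤ 1`. [folklore] -/
theorem sigT_le_one (t x : ℝ) : sigT t x ≤ 1 := Real.smoothTransition.le_one _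

/-- `σ_t` is smooth. [folklore] -/
theorem contDiff_sigT (t : ℝ) : ContDiff ℝ ∞ (sigT t) :=
  Real.smoothTransition.contDiff.comp ((contDiff_const.mul contDiff_id).sub contDiff_const)

/-- `σ_t^{(k)}(x) = (20/t)^k ψ^{(k)}(20x/t − 19)` (`t ≠ 0`). [folklore] -/
theorem iteratedDeriv_sigT (k : ℕ) {t : ℝ} (ht : t ≠ 0) (x : ℝ) :
    iteratedDeriv k (sigT t) x = (20 * t⁻¹) ^ k * iteratedDeriv k Real.smoothTransition (20 * t⁻¹ * x - 19) := by
  have hψ : ContDiff ℝ k Real.smoothTransition := Real.smoothTransition.contDiff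
  have h20 : (20 : ℝ) * t⁻¹ ≠ 0 := mul_ne_zero (by norm_num) (inv_ne_zero ht)
  have hfun : sigT t = fun x => (fun w => Real.smoothTransition (20 * t⁻¹ * w)) (x - 19 / (20 * t⁻¹)) := by
    funext y
    unfold sigT
    congr 1; field_simp
  have h := congrFun (iteratedDeriv_comp_sub_const k (fun w => Real.smoothTransition (20 * t⁻¹ * w)) (19 / (20 * t⁻¹))) x
  rw [iteratedDeriv_comp_const_mul hψ] at h
  rw [hfun, h]
  show (20 * t⁻¹) ^ k * iteratedDeriv k smoothTransition (20 * t⁻¹ * (x - 19 / (20 * t⁻¹))) = _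
  congr 2; field_simp

/-- `|σ_t^{(k)}| ≤ (20/t)^k K_n` for `k ≤ n`, `t > 0`. [folklore] -/
theorem norm_iteratedDeriv_sigT_le {k n : ℕ} (hk : k ≤ n) {t : ℝ} (ht : 0 < t) (x : ℝ) :
    ‖iteratedDeriv k (sigT t) x‖ ≤ (20 * t⁻¹) ^ k * derivConst n := by
  rw [iteratedDeriv_sigT k ht.ne', norm_mul, norm_pow, Real.norm_of_nonneg (by positivity)]
  exact mul_le_mul_of_nonneg_left (norm_iteratedDeriv_smoothTransition_le hk _) (by positivity)

/-- **The piece `P_t = σ_t − σ_{1.8 t}`**, supported in `[0.95 t, 1.8 t]`. [folklore] -/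
def pieceT (t x : ℝ) : ℝ := sigT t x - sigT (9 / 5 * t) x

/-- `P_t(x) = 0` for `x ≤ 0.95 t`. [folklore] -/
theorem pieceT_eq_zero_of_le {t x : ℝ} (ht : 0 < t) (hx : x ≤ 19 / 20 * t) : pieceT t x = 0 := by
  unfold pieceT
  rw [sigT_eq_zero ht hx, sigT_eq_zero (by positivity) (by linarith), sub_zero]

/-- `P_t(x) = 0` for `x ≥ 1.8 t`. [folklore] -/
theorem pieceT_eq_zero_of_ge {t x : ℝ} (ht : 0 < t) (hx : 9 / 5 * t ≤ x) : pieceT t x = 0 := by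
  unfold pieceT
  rw [sigT_eq_one ht (by linarith), sigT_eq_one (by positivity) hx, sub_self]

/-- `|P_t| ≤ 1`. [folklore] -/
theorem abs_pieceT_le_one (t x : ℝ) : |pieceT t x| ≤ 1 := by
  unfold pieceT
  have := sigT_nonneg t x; have := sigT_le_one t x
  have := sigT_nonneg (9 / 5 * t) x; have := sigT_le_one (9 / 5 * t) x
  rw [abs_le]; constructor <;> linarith

/-- `P_t` is smooth. [folklore] -/
theorem contDiff_pieceT (t : ℝ) : ContDiff ℝ ∞ (pieceT t) := (contDiff_sigT t).sub (contDiff_sigT _)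

/-- `|P_t^{(k)}| ≤ 2 (20/t)^k K_n` for `k ≤ n`, `t > 0`. [folklore] -/
theorem norm_iteratedDeriv_pieceT_le {k n : ℕ} (hk : k ≤ n) {t : ℝ} (ht : 0 < t) (x : ℝ) :
    ‖iteratedDeriv k (pieceT t) x‖ ≤ 2 * ((20 * t⁻¹) ^ k * derivConst n) := by
  have hfun : pieceT t = fun x => sigT t x - sigT (9 / 5 * t) x := rfl
  have hk' : ((k : ℕ∞) : WithTop ℕ∞) ≤ ∞ := by exact_mod_cast le_top
  rw [hfun, iteratedDeriv_fun_sub ((contDiff_sigT t).of_le hk').contDiffAt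
    ((contDiff_sigT _).of_le hk').contDiffAt]
  refine (norm_sub_le _ _).trans ?_
  have h1 := norm_iteratedDeriv_sigT_le hk ht x
  have h2 := norm_iteratedDeriv_sigT_le hk (by positivity : 0 < 9 / 5 * t) x
  have h3 : (20 * (9 / 5 * t)⁻¹) ^ k * derivConst n ≤ (20 * t⁻¹) ^ k * derivConst n := by
    have hK : 0 ≤ derivConst n := le_trans zero_le_one (one_le_derivConst n)
    refine mul_le_mul_of_nonneg_right (pow_le_pow_left₀ (by positivity) ?_ k) hK
    rw [mul_inv, ← mul_assoc]
    have : (0 : ℝ) < t⁻¹ := inv_pos.2 ht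
    nlinarith
  linarith

/-- **Telescoping**: `∑_{ℓ<L} P_{(9/5)^ℓ t₀}(x) = σ_{t₀}(x) − σ_{(9/5)^L t₀}(x)`. [folklore] -/
theorem sum_pieceT (t₀ x : ℝ) (L : ℕ) :
    ∑ ℓ ∈ Finset.range L, pieceT ((9 / 5) ^ ℓ * t₀) x = sigT t₀ x - sigT ((9 / 5) ^ L * t₀) x := by
  induction L with
  | zero => simp
  | succ L ih =>
    rw [Finset.sum_range_succ, ih]
    unfold pieceT
    rw [show 9 / 5 * ((9 / 5 : ℝ) ^ L * t₀) = (9 / 5) ^ (L + 1) * t₀ by ring]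
    ring

/-- **The pieces sum to `1` on `[t₀, 0.95 (9/5)^L t₀]`** (`t₀ > 0`). [folklore] -/
theorem sum_pieceT_eq_one {t₀ x : ℝ} (ht₀ : 0 < t₀) (L : ℕ) (h1 : t₀ ≤ x)
    (h2 : x ≤ 19 / 20 * ((9 / 5) ^ L * t₀)) :
    ∑ ℓ ∈ Finset.range L, pieceT ((9 / 5) ^ ℓ * t₀) x = 1 := by
  rw [sum_pieceT, sigT_eq_one ht₀ h1, sigT_eq_zero (by positivity) h2, sub_zero]

/-! ### The Kuznetsov test functions `φ_{t,s}(x) = P_t(x) x^s` and their admissibility -/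

/-- The complexified piece. [folklore] -/
def pieceC (t x : ℝ) : ℂ := ((pieceT t x : ℝ) : ℂ)

/-- `pieceC` is smooth. [folklore] -/
theorem contDiff_pieceC (t : ℝ) : ContDiff ℝ ∞ (pieceC t) :=
  Complex.ofRealCLM.contDiff.comp (contDiff_pieceT t)

/-- `‖pieceC^{(k)}‖ ≤ ‖P_t^{(k)}‖`. [folklore] -/
theorem norm_iteratedDeriv_pieceC_le (k : ℕ) (t x : ℝ) :
    ‖iteratedDeriv k (pieceC t) x‖ ≤ ‖iteratedDeriv k (pieceT t) x‖ := by
  rw [← norm_iteratedFDeriv_eq_norm_iteratedDeriv, ← norm_iteratedFDeriv_eq_norm_iteratedDeriv]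
  have h := ContinuousLinearMap.iteratedFDeriv_comp_left (x := x) (i := k) Complex.ofRealCLM
    ((contDiff_pieceT t).contDiffAt) (by exact_mod_cast le_top)
  have hfun : pieceC t = ⇑Complex.ofRealCLM ∘ pieceT t := rfl
  rw [hfun, h]
  refine (ContinuousLinearMap.norm_compContinuousMultilinearMap_le _ _).trans ?_
  rw [Complex.ofRealCLM_norm, one_mul]

/-- **The test function** `φ_{t,s}(x) = P_t(x) · x^s`. [folklore] -/
def testFn (t : ℝ) (s : ℂ) (x : ℝ) : ℂ := pieceC t x * cpw s x

/-- `φ_{t,s}` vanishes off `[0.95 t, 1.8 t]`. [folklore] -/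
theorem testFn_eq_zero {t : ℝ} (ht : 0 < t) {s : ℂ} {x : ℝ} (hx : x ≤ 19 / 20 * t ∨ 9 / 5 * t ≤ x) :
    testFn t s x = 0 := by
  unfold testFn pieceC
  rcases hx with hx | hx
  · rw [pieceT_eq_zero_of_le ht hx]; simp
  · rw [pieceT_eq_zero_of_ge ht hx]; simp

/-- `φ_{t,s}` is smooth on `ℝ` (`t > 0`): the smooth formula on `(0, ∞)`, and `0` near every
`x ≤ 0.9 t`. [folklore] -/
theorem contDiff_testFn {t : ℝ} (ht : 0 < t) (s : ℂ) : ContDiff ℝ ∞ (testFn t s) := by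
  rw [contDiff_iff_contDiffAt]
  intro x
  by_cases hx : 9 / 10 * t < x
  · have hx0 : 0 < x := lt_trans (by positivity) hx
    have h1 : ContDiffAt ℝ ∞ (cpw s) x :=
      (contDiffOn_cpw s).contDiffAt (Ioi_mem_nhds hx0)
    exact (contDiff_pieceC t).contDiffAt.mul h1
  · rw [not_lt] at hx
    have hzero : testFn t s =ᶠ[𝓝 x] fun _ => (0 : ℂ) := by
      have hV : Set.Iio (19 / 20 * t) ∈ 𝓝 x := Iio_mem_nhds (by linarith)
      refine Filter.eventuallyEq_of_mem hV fun y hy => ?_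
      exact testFn_eq_zero ht (Or.inl (le_of_lt hy))
    exact (contDiffAt_const (c := (0 : ℂ))).congr_of_eventuallyEq hzero

/-- **Admissibility of the test functions**: for `t > 0`, `re s = −1`, `j ≤ 4` and all `x`,
`|φ_{t,s}^{(j)}(x)| ≤ 2·20⁴ K₄ (|s| + 4)⁴ X^{−1−j}`, `X = 0.95 t`. [folklore] -/
theorem norm_iteratedDeriv_testFn_le {t : ℝ} (ht : 0 < t) {s : ℂ} (hs : s.re = -1) {j : ℕ}
    (hj : j ≤ 4) (x : ℝ) :
    ‖iteratedDeriv j (testFn t s) x‖ ≤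
      2 * 20 ^ 4 * derivConst 4 * (‖s‖ + 4) ^ 4 * (19 / 20 * t) ^ (-(1 : ℝ) - j) := by
  set X : ℝ := 19 / 20 * t with hX
  have hX0 : 0 < X := by positivity
  have hK : 1 ≤ derivConst 4 := one_le_derivConst 4
  have hrhs0 : 0 ≤ 2 * 20 ^ 4 * derivConst 4 * (‖s‖ + 4) ^ 4 * X ^ (-(1 : ℝ) - j) := by positivity
  by_cases hx : x < X
  · -- `φ ≡ 0` near `x`
    have hzero : testFn t s =ᶠ[𝓝 x] fun _ => (0 : ℂ) := by
      refine Filter.eventuallyEq_of_mem (Iio_mem_nhds hx) fun y hy => ?_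
      exact testFn_eq_zero ht (Or.inl (le_of_lt hy))
    rw [Filter.EventuallyEq.iteratedDeriv_eq j hzero, iteratedDeriv_const]
    split_ifs <;> simpa using hrhs0
  · rw [not_lt] at hx
    have hx0 : 0 < x := lt_of_lt_of_le hX0 hx
    have hopen : IsOpen (Set.Ioi (0 : ℝ)) := isOpen_Ioi
    have hmem : x ∈ Set.Ioi (0 : ℝ) := hx0
    have h4 : ((4 : ℕ∞) : WithTop ℕ∞) ≤ ∞ := by exact_mod_cast le_top
    have hpc : ContDiffOn ℝ (4 : ℕ∞) (pieceC t) (Set.Ioi 0) := ((contDiff_pieceC t).of_le h4).contDiffOn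
    -- Leibniz on `(0, ∞)`
    have hL := norm_iteratedFDerivWithin_mul_le hpc (contDiffOn_cpw s (n := 4)) hopen.uniqueDiffOn hmem
      (n := j) (by exact_mod_cast hj)
    have hlhs : ‖iteratedFDerivWithin ℝ j (fun y => pieceC t y * cpw s y) (Set.Ioi 0) x‖ =
        ‖iteratedDeriv j (testFn t s) x‖ := by
      rw [iteratedFDerivWithin_of_isOpen j hopen hmem, norm_iteratedFDeriv_eq_norm_iteratedDeriv]
      rfl
    rw [hlhs] at hL
    refine hL.trans ?_
    -- bound each term
    have hterm : ∀ i ∈ Finset.range (j + 1),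
        (j.choose i : ℝ) * ‖iteratedFDerivWithin ℝ i (pieceC t) (Set.Ioi 0) x‖ *
          ‖iteratedFDerivWithin ℝ (j - i) (cpw s) (Set.Ioi 0) x‖ ≤
        (j.choose i : ℝ) * 19 ^ i * (2 * derivConst 4 * (‖s‖ + 4) ^ 4 * X ^ (-(1 : ℝ) - j)) := by
      intro i hi
      have hij : i ≤ j := Nat.lt_succ_iff.1 (Finset.mem_range.1 hi)
      have hi4 : i ≤ 4 := hij.trans hj
      -- the piece
      have hp : ‖iteratedFDerivWithin ℝ i (pieceC t) (Set.Ioi 0) x‖ ≤ 2 * ((20 * t⁻¹) ^ i * derivConst 4) := by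
        rw [iteratedFDerivWithin_of_isOpen i hopen hmem, norm_iteratedFDeriv_eq_norm_iteratedDeriv]
        exact (norm_iteratedDeriv_pieceC_le i t x).trans (norm_iteratedDeriv_pieceT_le hi4 ht x)
      -- the power
      have hq : ‖iteratedFDerivWithin ℝ (j - i) (cpw s) (Set.Ioi 0) x‖ ≤ (‖s‖ + 4) ^ 4 * X ^ (-(1 : ℝ) - (j - i : ℕ)) := by
        rw [norm_iteratedFDerivWithin_eq_norm_iteratedDerivWithin,
          norm_iteratedDerivWithin_cpw (by rw [hs]; norm_num) (j - i) hx0, hs]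
        have hc : ‖cpwCoef s (j - i)‖ ≤ (‖s‖ + 4) ^ 4 := by
          refine (norm_cpwCoef_le s (j - i)).trans ?_
          have hle : (j - i : ℕ) ≤ 4 := (Nat.sub_le j i).trans hj
          have h1 : (‖s‖ + ((j - i : ℕ) : ℝ)) ≤ ‖s‖ + 4 := by
            have : ((j - i : ℕ) : ℝ) ≤ 4 := by exact_mod_cast hle
            linarith
          have h2 : 1 ≤ ‖s‖ + 4 := by linarith [norm_nonneg s]
          calc (‖s‖ + ((j - i : ℕ) : ℝ)) ^ (j - i) ≤ (‖s‖ + 4) ^ (j - i) :=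
                pow_le_pow_left₀ (by positivity) h1 _
            _ ≤ (‖s‖ + 4) ^ 4 := pow_le_pow_right₀ h2 hle
        have hxX : x ^ ((-1 : ℝ) - ((j - i : ℕ) : ℝ)) ≤ X ^ (-(1 : ℝ) - (j - i : ℕ)) := by
          exact Real.rpow_le_rpow_of_nonpos hX0 hx (by
            have : (0 : ℝ) ≤ ((j - i : ℕ) : ℝ) := Nat.cast_nonneg _
            linarith)
        exact mul_le_mul hc hxX (Real.rpow_nonneg hx0.le _) (by positivity)
      -- combine: `(20/t)^i = (19/X)^i` and `X^{-i} X^{-1-(j-i)} = X^{-1-j}`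
      have e20 : (20 : ℝ) * t⁻¹ = 19 * X⁻¹ := by rw [hX]; field_simp
      have epow : (19 * X⁻¹) ^ i * X ^ (-(1 : ℝ) - (j - i : ℕ)) = 19 ^ i * X ^ (-(1 : ℝ) - j) := by
        rw [mul_pow, inv_pow, ← Real.rpow_natCast X i, ← Real.rpow_neg hX0.le, mul_assoc,
          ← Real.rpow_add hX0]
        congr 2
        push_cast [Nat.cast_sub hij]
        ring
      calc (j.choose i : ℝ) * ‖iteratedFDerivWithin ℝ i (pieceC t) (Set.Ioi 0) x‖ *
            ‖iteratedFDerivWithin ℝ (j - i) (cpw s) (Set.Ioi 0) x‖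
          ≤ (j.choose i : ℝ) * (2 * ((20 * t⁻¹) ^ i * derivConst 4)) *
              ((‖s‖ + 4) ^ 4 * X ^ (-(1 : ℝ) - (j - i : ℕ))) := by
            gcongr
          _ = (j.choose i : ℝ) * (2 * derivConst 4 * (‖s‖ + 4) ^ 4) *
              ((19 * X⁻¹) ^ i * X ^ (-(1 : ℝ) - (j - i : ℕ))) := by rw [e20]; ring
          _ = (j.choose i : ℝ) * 19 ^ i * (2 * derivConst 4 * (‖s‖ + 4) ^ 4 * X ^ (-(1 : ℝ) - j)) := by
            rw [epow]; ring
    refine (Finset.sum_le_sum hterm).trans ?_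
    rw [← Finset.sum_mul]
    have hbin : ∑ i ∈ Finset.range (j + 1), (j.choose i : ℝ) * 19 ^ i = 20 ^ j := by
      have := (add_pow (19 : ℝ) 1 j).symm
      rw [show (19 : ℝ) + 1 = 20 by norm_num] at this
      rw [← this]
      refine Finset.sum_congr rfl fun i _ => ?_
      rw [one_pow, mul_one, mul_comm]
    rw [hbin]
    have h20 : (20 : ℝ) ^ j ≤ 20 ^ 4 := pow_le_pow_right₀ (by norm_num) hj
    have hpos : 0 ≤ 2 * derivConst 4 * (‖s‖ + 4) ^ 4 * X ^ (-(1 : ℝ) - j) := by positivity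
    calc (20 : ℝ) ^ j * (2 * derivConst 4 * (‖s‖ + 4) ^ 4 * X ^ (-(1 : ℝ) - j))
        ≤ 20 ^ 4 * (2 * derivConst 4 * (‖s‖ + 4) ^ 4 * X ^ (-(1 : ℝ) - j)) :=
          mul_le_mul_of_nonneg_right h20 hpos
      _ = _ := by ring


/-! ### Abel summation against `m^κ` (`re κ = 1/2`) -/

/-- `∫_{(a,b]} t^{-1/2} dt ≤ 2√b` for `a ≤ b`. [folklore] -/
theorem setIntegral_rpow_neg_half_le {a b : ℝ} (hab : a ≤ b) :
    ∫ t in Set.Ioc a b, t ^ (-(1 / 2 : ℝ)) ≤ 2 * Real.sqrt b := by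
  rw [← intervalIntegral.integral_of_le hab]
  have h := integral_rpow (a := a) (b := b) (r := -(1 / 2 : ℝ)) (Or.inl (by norm_num))
  rw [h]
  have e : -(1 / 2 : ℝ) + 1 = 1 / 2 := by norm_num
  rw [e, ← Real.sqrt_eq_rpow, ← Real.sqrt_eq_rpow]
  have := Real.sqrt_nonneg a
  rw [div_le_iff₀ (by norm_num : (0:ℝ) < 1 / 2)]
  nlinarith [Real.sqrt_nonneg b]

/-- **Abel summation against `m^κ`, `re κ = 1/2`**: if all partial sums `∑_{a<m≤k} F(m)`, `a ≤ k ≤ u`,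
are bounded by `B`, then `|∑_{a<m≤u} m^κ F(m)| ≤ (1 + 2|κ|) √u · B`. [folklore] -/
theorem abel_cpow_bound {κ : ℂ} (hκ : κ.re = 1 / 2) (F : ℕ → ℂ) {a u : ℕ} (hau : a ≤ u) {B : ℝ}
    (hB : ∀ k : ℕ, a ≤ k → k ≤ u → ‖∑ m ∈ Finset.Ioc a k, F m‖ ≤ B) :
    ‖∑ m ∈ Finset.Ioc a u, ((m : ℝ) : ℂ) ^ κ * F m‖ ≤ (1 + 2 * ‖κ‖) * Real.sqrt u * B := by
  have hB0 : 0 ≤ B := le_trans (norm_nonneg _) (hB a le_rfl hau)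
  rcases Nat.eq_zero_or_pos u with hu0 | hupos
  · subst hu0
    have ha0 : a = 0 := by omega
    subst ha0
    simp only [Finset.Ioc_self, Finset.sum_empty, norm_zero]
    positivity
  -- real endpoints `a' = max a 1/2 > 0`, `b = u`
  set a' : ℝ := max (a : ℝ) (1 / 2) with ha'
  have ha'0 : 0 < a' := lt_of_lt_of_le (by norm_num) (le_max_right _ _)
  have hfloor_a : ⌊a'⌋₊ = a := by
    rcases Nat.eq_zero_or_pos a with h0 | hpos
    · subst h0
      rw [ha', Nat.cast_zero, max_eq_right (by norm_num)]
      norm_num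
    · have : a' = a := by
        rw [ha', max_eq_left]
        have : (1 : ℝ) ≤ a := by exact_mod_cast hpos
        linarith
      rw [this, Nat.floor_natCast]
  have hfloor_u : ⌊((u : ℕ) : ℝ)⌋₊ = u := Nat.floor_natCast u
  have hua : (1 : ℝ) ≤ u := by exact_mod_cast hupos
  have ha'u : a' ≤ u := by
    rw [ha']
    exact max_le (by exact_mod_cast hau) (by linarith)
  -- the coefficients: `c k = F k` for `k > a`, `0` otherwise
  set c : ℕ → ℂ := fun k => if a < k then F k else 0 with hc
  have hcum : ∀ t : ℝ, ∑ k ∈ Finset.Icc 0 ⌊t⌋₊, c k = ∑ m ∈ Finset.Ioc a ⌊t⌋₊, F m := by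
    intro t
    rw [hc, Finset.sum_ite, Finset.sum_const_zero, add_zero]
    refine Finset.sum_congr ?_ fun _ _ => rfl
    ext k
    simp only [Finset.mem_filter, Finset.mem_Icc, Finset.mem_Ioc, Nat.zero_le, true_and]
    tauto
  have hcum_a : ∑ k ∈ Finset.Icc 0 a, c k = 0 := by
    have := hcum a'
    rwa [hfloor_a, Finset.Ioc_self, Finset.sum_empty] at this
  have hcum_u : ∑ k ∈ Finset.Icc 0 u, c k = ∑ m ∈ Finset.Ioc a u, F m := by
    have := hcum u
    rwa [hfloor_u] at this
  -- `f(t) = t^κ`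
  have hκ0 : κ ≠ 0 := by intro h; rw [h] at hκ; norm_num at hκ
  have hκ1 : κ - 1 ≠ 0 := by
    intro h; have := congrArg Complex.re h; simp at this; rw [hκ] at this; norm_num at this
  have hdiff : ∀ t ∈ Set.Icc a' u, DifferentiableAt ℝ (fun t : ℝ => ((t : ℝ) : ℂ) ^ κ) t := by
    intro t ht
    exact (hasDerivAt_ofReal_cpow_const (by linarith [ht.1] : t ≠ 0) hκ0).differentiableAt
  have hderiv : ∀ t : ℝ, 0 < t → deriv (fun t : ℝ => ((t : ℝ) : ℂ) ^ κ) t = κ * (t : ℂ) ^ (κ - 1) :=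
    fun t ht => (hasDerivAt_ofReal_cpow_const ht.ne' hκ0).deriv
  have hcont_pow : ContinuousOn (fun t : ℝ => κ * (t : ℂ) ^ (κ - 1)) (Set.Icc a' u) := by
    intro t ht
    have ht0 : 0 < t := by linarith [ht.1]
    exact (continuousAt_const.mul
      (Complex.continuousAt_ofReal_cpow_const t (κ - 1) (Or.inr ht0.ne'))).continuousWithinAt
  have hint_deriv : IntegrableOn (deriv fun t : ℝ => ((t : ℝ) : ℂ) ^ κ) (Set.Icc a' u) := by
    refine (hcont_pow.integrableOn_compact isCompact_Icc).congr_fun (fun t ht => ?_) measurableSet_Icc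
    exact (hderiv t (by linarith [ht.1])).symm
  -- Abel's formula
  have habel := sum_mul_eq_sub_sub_integral_mul c ha'0.le ha'u hdiff hint_deriv
  rw [hfloor_a, hfloor_u, hcum_a, mul_zero, sub_zero] at habel
  -- identify the left side
  have hlhs : ∑ k ∈ Finset.Ioc a u, ((k : ℝ) : ℂ) ^ κ * c k =
      ∑ m ∈ Finset.Ioc a u, ((m : ℝ) : ℂ) ^ κ * F m := by
    refine Finset.sum_congr rfl fun k hk => ?_
    rw [hc]
    simp only [if_pos (Finset.mem_Ioc.1 hk).1]
  rw [← hlhs, habel, hcum_u]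
  -- bound the two terms
  have hS : ∀ t : ℝ, t ∈ Set.Ioc a' u → ‖∑ m ∈ Finset.Ioc a ⌊t⌋₊, F m‖ ≤ B := by
    intro t ht
    refine hB _ ?_ ?_
    · have : (a : ℝ) ≤ t := le_trans (le_max_left _ _) ht.1.le
      exact Nat.le_floor this
    · exact (Nat.floor_le_floor ht.2).trans (Nat.floor_natCast u).le
  have h1 : ‖(((u : ℕ) : ℝ) : ℂ) ^ κ * ∑ m ∈ Finset.Ioc a u, F m‖ ≤ Real.sqrt u * B := by
    rw [norm_mul, Complex.norm_cpow_eq_rpow_re_of_pos (by exact_mod_cast hupos), hκ,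
      ← Real.sqrt_eq_rpow]
    exact mul_le_mul_of_nonneg_left (hB u hau le_rfl) (Real.sqrt_nonneg _)
  have h2 : ‖∫ t in Set.Ioc a' u, deriv (fun t : ℝ => ((t : ℝ) : ℂ) ^ κ) t *
      ∑ k ∈ Finset.Icc 0 ⌊t⌋₊, c k‖ ≤ 2 * ‖κ‖ * Real.sqrt u * B := by
    have hmono : ∀ t ∈ Set.Ioc a' (u : ℝ),
        ‖deriv (fun t : ℝ => ((t : ℝ) : ℂ) ^ κ) t * ∑ k ∈ Finset.Icc 0 ⌊t⌋₊, c k‖ ≤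
          ‖κ‖ * B * t ^ (-(1 / 2 : ℝ)) := by
      intro t ht
      have ht0 : 0 < t := lt_trans ha'0 ht.1
      rw [hcum t, hderiv t ht0, norm_mul, norm_mul, Complex.norm_cpow_eq_rpow_re_of_pos ht0]
      have hre : (κ - 1).re = -(1 / 2 : ℝ) := by simp [hκ]; norm_num
      rw [hre]
      have := hS t ht
      have hpos : 0 ≤ ‖κ‖ * t ^ (-(1 / 2 : ℝ)) := by positivity
      calc ‖κ‖ * t ^ (-(1 / 2 : ℝ)) * ‖∑ m ∈ Finset.Ioc a ⌊t⌋₊, F m‖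
          ≤ ‖κ‖ * t ^ (-(1 / 2 : ℝ)) * B := mul_le_mul_of_nonneg_left this hpos
        _ = ‖κ‖ * B * t ^ (-(1 / 2 : ℝ)) := by ring
    have hint_rhs : IntegrableOn (fun t : ℝ => ‖κ‖ * B * t ^ (-(1 / 2 : ℝ))) (Set.Ioc a' u) := by
      refine ContinuousOn.integrableOn_Icc (fun t ht => ?_) |>.mono_set Set.Ioc_subset_Icc_self
      exact (continuousAt_const.mul (Real.continuousAt_rpow_const _ _
        (Or.inl (by linarith [ht.1] : t ≠ 0)))).continuousWithinAt
    calc ‖∫ t in Set.Ioc a' u, deriv (fun t : ℝ => ((t : ℝ) : ℂ) ^ κ) t * ∑ k ∈ Finset.Icc 0 ⌊t⌋₊, c k‖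
        ≤ ∫ t in Set.Ioc a' u, ‖deriv (fun t : ℝ => ((t : ℝ) : ℂ) ^ κ) t * ∑ k ∈ Finset.Icc 0 ⌊t⌋₊, c k‖ :=
          norm_integral_le_integral_norm _
      _ ≤ ∫ t in Set.Ioc a' u, ‖κ‖ * B * t ^ (-(1 / 2 : ℝ)) := by
          refine integral_mono_of_nonneg (Filter.Eventually.of_forall fun _ => norm_nonneg _) hint_rhs ?_
          rw [Filter.EventuallyLE, ae_restrict_iff' measurableSet_Ioc]
          exact Filter.Eventually.of_forall hmono
      _ = ‖κ‖ * B * ∫ t in Set.Ioc a' u, t ^ (-(1 / 2 : ℝ)) := by rw [integral_const_mul]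
      _ ≤ ‖κ‖ * B * (2 * Real.sqrt u) :=
          mul_le_mul_of_nonneg_left (setIntegral_rpow_neg_half_le ha'u) (by positivity)
      _ = 2 * ‖κ‖ * Real.sqrt u * B := by ring
  calc ‖(((u : ℕ) : ℝ) : ℂ) ^ κ * ∑ m ∈ Finset.Ioc a u, F m -
        ∫ t in Set.Ioc a' u, deriv (fun t : ℝ => ((t : ℝ) : ℂ) ^ κ) t * ∑ k ∈ Finset.Icc 0 ⌊t⌋₊, c k‖
      ≤ Real.sqrt u * B + 2 * ‖κ‖ * Real.sqrt u * B := (norm_sub_le _ _).trans (add_le_add h1 h2)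
    _ = (1 + 2 * ‖κ‖) * Real.sqrt u * B := by ring





/-! ### The majorants of Deshouillers–Iwaniec §9.1 (Drappeau, Prop. 4.12) and their conversion to `L` -/

/-- **The regular-spectrum majorant** of Deshouillers–Iwaniec's proof of Theorem 10 ((9.4); Drappeau
Prop. 4.12's `L_reg`) at `S = 1/2`:
`L_reg = (1 + X + √(N/(R/2)))(1 + X + √(M/(R/2))) (√(R/2)/(1+X)) √M`. [cite: DeshouillersIwaniec1982, §9.1 (9.4) p. 279] -/
def Lreg (X M N R : ℝ) : ℝ :=
  (1 + X + Real.sqrt (N / (R / 2))) * (1 + X + Real.sqrt (M / (R / 2))) * (Real.sqrt (R / 2) / (1 + X)) *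
    Real.sqrt M

/-- **The exceptional-spectrum majorant** ((9.7); Drappeau Prop. 4.12's `L_exc`, the form for `a_m`
the characteristic sequence of an interval) at `S = 1/2`:
`L_exc = (1 + √(N/(R/2))) √((1+X⁻¹)/(R/2)) (MN/(R/2+N))^{1/4} (√(R/2)/(1+X)) √M` (the fourth root
written as `√√`). [cite: DeshouillersIwaniec1982, §9.1 (9.7) p. 280] -/
def Lexc (X M N R : ℝ) : ℝ :=
  (1 + Real.sqrt (N / (R / 2))) * Real.sqrt ((1 + X⁻¹) / (R / 2)) *
    Real.sqrt (Real.sqrt (M * N / (R / 2 + N))) * (Real.sqrt (R / 2) / (1 + X)) * Real.sqrt M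

/-- `L_reg ≥ 0`. [folklore] -/
theorem Lreg_nonneg {X M N R : ℝ} (hX : 0 ≤ X) : 0 ≤ Lreg X M N R := by
  unfold Lreg; positivity

/-- `L_exc ≥ 0`. [folklore] -/
theorem Lexc_nonneg {X M N R : ℝ} (hX : 0 ≤ X) : 0 ≤ Lexc X M N R := by
  unfold Lexc
  have : 0 ≤ 1 + X⁻¹ := by positivity
  positivity

/-- `K_reg² = R (C²R + MN + C²N)(C²R + MN + C²M)/(C²R + MN)` (Drappeau Prop. 4.13 with `q = S = 1`). [folklore] -/
def KregSq (C M N R : ℝ) : ℝ :=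
  R * ((C ^ 2 * R + M * N + C ^ 2 * N) * (C ^ 2 * R + M * N + C ^ 2 * M) / (C ^ 2 * R + M * N))

/-- `K_exc² = C³ √(R(R + N))`. [folklore] -/
def KexcSq (C N R : ℝ) : ℝ := C ^ 3 * Real.sqrt (R * (R + N))

/-- `K_reg² ≥ 0`. [folklore] -/
theorem KregSq_nonneg {C M N R : ℝ} (hM : 0 ≤ M) (hN : 0 ≤ N) (hR : 0 ≤ R) : 0 ≤ KregSq C M N R := by
  unfold KregSq; positivity

/-- `K_exc² ≥ 0`. [folklore] -/
theorem KexcSq_nonneg {C N R : ℝ} (hC : 0 ≤ C) : 0 ≤ KexcSq C N R := by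
  unfold KexcSq; positivity

/-- `a + b + c ≤ √3 · √(a² + b² + c²)`. [folklore] -/
theorem add_three_le_sqrt (a b c : ℝ) : a + b + c ≤ Real.sqrt 3 * Real.sqrt (a ^ 2 + b ^ 2 + c ^ 2) := by
  rw [← Real.sqrt_mul (by norm_num)]
  refine (le_abs_self _).trans (Real.abs_le_sqrt ?_)
  nlinarith [sq_nonneg (a - b), sq_nonneg (b - c), sq_nonneg (a - c)]

/-- `a + b ≤ √2 · √(a² + b²)`. [folklore] -/
theorem add_two_le_sqrt (a b : ℝ) : a + b ≤ Real.sqrt 2 * Real.sqrt (a ^ 2 + b ^ 2) := by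
  rw [← Real.sqrt_mul (by norm_num)]
  refine (le_abs_self _).trans (Real.abs_le_sqrt ?_)
  nlinarith [sq_nonneg (a - b)]

/-- `√(a² + b²) ≤ a + b` for `a, b ≥ 0`. [folklore] -/
theorem sqrt_sq_add_sq_le {a b : ℝ} (ha : 0 ≤ a) (hb : 0 ≤ b) : Real.sqrt (a ^ 2 + b ^ 2) ≤ a + b := by
  rw [Real.sqrt_le_left (by positivity)]
  nlinarith [mul_nonneg ha hb]

/-- **The regular majorant in terms of `K_reg`**: with `X = κ √(MN)/(C√R)`,
`√(MN) X⁻¹ L_reg ≤ A_reg(κ) √(K_reg²) √M`, `A_reg(κ) = 3 max(√2,κ)²/(√2 κ min(1,κ))`.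
[cite: Drappeau2017, §4.3.2, end of the proof of Prop. 4.13 (`W_reg`); DeshouillersIwaniec1982, §9.1 (9.4) p. 279] -/
theorem reg_conversion {C M N R κ : ℝ} (hC : 0 < C) (hM : 0 < M) (hN : 0 < N) (hR : 0 < R) (hκ : 0 < κ) :
    Real.sqrt (M * N) * (κ * Real.sqrt (M * N) / (C * Real.sqrt R))⁻¹ *
        Lreg (κ * Real.sqrt (M * N) / (C * Real.sqrt R)) M N R ≤
      (3 * max (Real.sqrt 2) κ ^ 2 / (Real.sqrt 2 * κ * min 1 κ)) * Real.sqrt (KregSq C M N R) * Real.sqrt M := by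
  -- the atoms `p = C√R`, `q = √(MN)`, `sN = C√N`, `sM = C√M`
  set p : ℝ := C * Real.sqrt R with hp
  set q : ℝ := Real.sqrt (M * N) with hq
  set sN : ℝ := C * Real.sqrt N with hsN
  set sM : ℝ := C * Real.sqrt M with hsM
  have hRs : 0 < Real.sqrt R := Real.sqrt_pos.2 hR
  have hp0 : 0 < p := by positivity
  have hq0 : 0 < q := by rw [hq]; positivity
  have hsN0 : 0 < sN := by positivity
  have hsM0 : 0 < sM := by positivity
  set X : ℝ := κ * q / p with hX
  have hX0 : 0 < X := by positivity
  -- rewrite the pieces of `L_reg`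
  have e1 : Real.sqrt (N / (R / 2)) = Real.sqrt 2 * sN / p := by
    rw [hsN, hp]
    have : N / (R / 2) = 2 * N / R := by field_simp
    rw [this, Real.sqrt_div' _ hR.le, Real.sqrt_mul (by norm_num)]
    field_simp
  have e2 : Real.sqrt (M / (R / 2)) = Real.sqrt 2 * sM / p := by
    rw [hsM, hp]
    have : M / (R / 2) = 2 * M / R := by field_simp
    rw [this, Real.sqrt_div' _ hR.le, Real.sqrt_mul (by norm_num)]
    field_simp
  have e3 : Real.sqrt (R / 2) = Real.sqrt R / Real.sqrt 2 := Real.sqrt_div' R (by norm_num)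
  have lhs_eq : Real.sqrt (M * N) * X⁻¹ * Lreg X M N R =
      (p + κ * q + Real.sqrt 2 * sN) * (p + κ * q + Real.sqrt 2 * sM) / (κ * (p + κ * q)) *
        (Real.sqrt R / Real.sqrt 2) * Real.sqrt M := by
    unfold Lreg
    rw [e1, e2, e3, ← hq, hX]
    have h2 : Real.sqrt 2 ≠ 0 := by positivity
    field_simp
  rw [lhs_eq]
  -- the bounds on the three factors
  set m₁ : ℝ := max (Real.sqrt 2) κ with hm₁
  have hm₁1 : Real.sqrt 2 ≤ m₁ := le_max_left _ _
  have hm₁κ : κ ≤ m₁ := le_max_right _ _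
  have hm₁0 : 0 < m₁ := lt_of_lt_of_le (by positivity) hm₁1
  have h1m : 1 ≤ m₁ := le_trans (by rw [Real.le_sqrt (by norm_num) (by norm_num)]; norm_num) hm₁1
  have F1 : p + κ * q + Real.sqrt 2 * sN ≤ m₁ * (Real.sqrt 3 * Real.sqrt (p ^ 2 + q ^ 2 + sN ^ 2)) := by
    have h := add_three_le_sqrt p q sN
    have : p + κ * q + Real.sqrt 2 * sN ≤ m₁ * (p + q + sN) := by
      nlinarith [mul_le_mul_of_nonneg_right hm₁κ hq0.le, mul_le_mul_of_nonneg_right hm₁1 hsN0.le,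
        mul_le_mul_of_nonneg_right h1m hp0.le]
    exact this.trans (mul_le_mul_of_nonneg_left h hm₁0.le)
  have F2 : p + κ * q + Real.sqrt 2 * sM ≤ m₁ * (Real.sqrt 3 * Real.sqrt (p ^ 2 + q ^ 2 + sM ^ 2)) := by
    have h := add_three_le_sqrt p q sM
    have : p + κ * q + Real.sqrt 2 * sM ≤ m₁ * (p + q + sM) := by
      nlinarith [mul_le_mul_of_nonneg_right hm₁κ hq0.le, mul_le_mul_of_nonneg_right hm₁1 hsM0.le,
        mul_le_mul_of_nonneg_right h1m hp0.le]
    exact this.trans (mul_le_mul_of_nonneg_left h hm₁0.le)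
  set m₀ : ℝ := min 1 κ with hm₀
  have hm₀0 : 0 < m₀ := lt_min zero_lt_one hκ
  have F3 : m₀ * Real.sqrt (p ^ 2 + q ^ 2) ≤ p + κ * q := by
    have h := sqrt_sq_add_sq_le hp0.le hq0.le
    have h1 : m₀ ≤ 1 := min_le_left _ _
    have h2 : m₀ ≤ κ := min_le_right _ _
    nlinarith [mul_le_mul_of_nonneg_right h1 hp0.le, mul_le_mul_of_nonneg_right h2 hq0.le,
      mul_le_mul_of_nonneg_left h hm₀0.le]
  -- `√(K_reg²) = √R √(p²+q²+sN²) √(p²+q²+sM²)/√(p²+q²)`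
  have hpq : 0 < p ^ 2 + q ^ 2 := by positivity
  have kreg_eq : Real.sqrt (KregSq C M N R) =
      Real.sqrt R * (Real.sqrt (p ^ 2 + q ^ 2 + sN ^ 2) * Real.sqrt (p ^ 2 + q ^ 2 + sM ^ 2) /
        Real.sqrt (p ^ 2 + q ^ 2)) := by
    unfold KregSq
    have ep : p ^ 2 = C ^ 2 * R := by rw [hp, mul_pow, Real.sq_sqrt hR.le]
    have eq' : q ^ 2 = M * N := by rw [hq, Real.sq_sqrt (by positivity)]
    have esN : sN ^ 2 = C ^ 2 * N := by rw [hsN, mul_pow, Real.sq_sqrt hN.le]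
    have esM : sM ^ 2 = C ^ 2 * M := by rw [hsM, mul_pow, Real.sq_sqrt hM.le]
    rw [Real.sqrt_mul hR.le, Real.sqrt_div (by positivity), Real.sqrt_mul (by positivity), ep, eq', esN, esM]
  rw [kreg_eq]
  -- assemble
  have hsq3 : Real.sqrt 3 ^ 2 = 3 := Real.sq_sqrt (by norm_num)
  have hS1 : 0 ≤ Real.sqrt (p ^ 2 + q ^ 2 + sN ^ 2) := Real.sqrt_nonneg _
  have hS2 : 0 ≤ Real.sqrt (p ^ 2 + q ^ 2 + sM ^ 2) := Real.sqrt_nonneg _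
  have hS0 : 0 < Real.sqrt (p ^ 2 + q ^ 2) := Real.sqrt_pos.2 hpq
  have hnum : (p + κ * q + Real.sqrt 2 * sN) * (p + κ * q + Real.sqrt 2 * sM) ≤
      3 * m₁ ^ 2 * (Real.sqrt (p ^ 2 + q ^ 2 + sN ^ 2) * Real.sqrt (p ^ 2 + q ^ 2 + sM ^ 2)) := by
    have := mul_le_mul F1 F2 (by positivity) (by positivity)
    calc (p + κ * q + Real.sqrt 2 * sN) * (p + κ * q + Real.sqrt 2 * sM)
        ≤ m₁ * (Real.sqrt 3 * Real.sqrt (p ^ 2 + q ^ 2 + sN ^ 2)) *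
          (m₁ * (Real.sqrt 3 * Real.sqrt (p ^ 2 + q ^ 2 + sM ^ 2))) := this
      _ = Real.sqrt 3 ^ 2 * m₁ ^ 2 * (Real.sqrt (p ^ 2 + q ^ 2 + sN ^ 2) * Real.sqrt (p ^ 2 + q ^ 2 + sM ^ 2)) := by ring
      _ = _ := by rw [hsq3]
  have hden : κ * (m₀ * Real.sqrt (p ^ 2 + q ^ 2)) ≤ κ * (p + κ * q) := mul_le_mul_of_nonneg_left F3 hκ.le
  have hden0 : 0 < κ * (m₀ * Real.sqrt (p ^ 2 + q ^ 2)) := by positivity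
  calc (p + κ * q + Real.sqrt 2 * sN) * (p + κ * q + Real.sqrt 2 * sM) / (κ * (p + κ * q)) *
        (Real.sqrt R / Real.sqrt 2) * Real.sqrt M
      ≤ (3 * m₁ ^ 2 * (Real.sqrt (p ^ 2 + q ^ 2 + sN ^ 2) * Real.sqrt (p ^ 2 + q ^ 2 + sM ^ 2))) /
          (κ * (m₀ * Real.sqrt (p ^ 2 + q ^ 2))) * (Real.sqrt R / Real.sqrt 2) * Real.sqrt M := by
        gcongr ?_ * _ * _
        exact div_le_div₀ (by positivity) hnum hden0 hden
    _ = (3 * max (Real.sqrt 2) κ ^ 2 / (Real.sqrt 2 * κ * min 1 κ)) *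
          (Real.sqrt R * (Real.sqrt (p ^ 2 + q ^ 2 + sN ^ 2) * Real.sqrt (p ^ 2 + q ^ 2 + sM ^ 2) /
            Real.sqrt (p ^ 2 + q ^ 2))) * Real.sqrt M := by
        rw [← hm₁, ← hm₀]
        have h2 : Real.sqrt 2 ≠ 0 := by positivity
        field_simp


/-- `√(1 + X⁻¹)/(1 + X) ≤ (√X)⁻¹` for `X > 0`. [folklore] -/
theorem sqrt_one_add_inv_div_le {X : ℝ} (hX : 0 < X) : Real.sqrt (1 + X⁻¹) / (1 + X) ≤ (Real.sqrt X)⁻¹ := by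
  have hX1 : 0 < 1 + X := by linarith
  have hsX : 0 < Real.sqrt X := Real.sqrt_pos.2 hX
  have e : 1 + X⁻¹ = (1 + X) / X := by field_simp; ring
  have key : Real.sqrt (1 + X⁻¹) / (1 + X) * Real.sqrt X = Real.sqrt (1 + X) / (1 + X) := by
    rw [e, Real.sqrt_div hX1.le]
    field_simp
  have h2 : Real.sqrt (1 + X) / (1 + X) ≤ 1 := by
    rw [div_le_one hX1, Real.sqrt_le_left hX1.le]
    nlinarith
  calc Real.sqrt (1 + X⁻¹) / (1 + X) = (Real.sqrt (1 + X⁻¹) / (1 + X) * Real.sqrt X) / Real.sqrt X := by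
        field_simp
    _ = (Real.sqrt (1 + X) / (1 + X)) / Real.sqrt X := by rw [key]
    _ ≤ 1 / Real.sqrt X := div_le_div_of_nonneg_right h2 hsX.le
    _ = (Real.sqrt X)⁻¹ := one_div _

/-- **The exceptional majorant in terms of `K_exc`**: with `X = κ √(MN)/(C√R)`,
`√(MN) X⁻¹ L_exc ≤ (2/(κ√κ)) √(K_exc²) √M`.
[cite: Drappeau2017, §4.3.2, end of the proof of Prop. 4.13 (`W_exc`); DeshouillersIwaniec1982, §9.1 (9.7) p. 280] -/
theorem exc_conversion {C M N R κ : ℝ} (hC : 0 < C) (hM : 0 < M) (hN : 0 < N) (hR : 0 < R) (hκ : 0 < κ) :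
    Real.sqrt (M * N) * (κ * Real.sqrt (M * N) / (C * Real.sqrt R))⁻¹ *
        Lexc (κ * Real.sqrt (M * N) / (C * Real.sqrt R)) M N R ≤
      (2 / (κ * Real.sqrt κ)) * Real.sqrt (KexcSq C N R) * Real.sqrt M := by
  set p : ℝ := C * Real.sqrt R with hp
  set q : ℝ := Real.sqrt (M * N) with hq
  set sN : ℝ := C * Real.sqrt N with hsN
  have hRs : 0 < Real.sqrt R := Real.sqrt_pos.2 hR
  have hp0 : 0 < p := by positivity
  have hq0 : 0 < q := by rw [hq]; positivity
  have hκs : 0 < Real.sqrt κ := Real.sqrt_pos.2 hκ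
  set X : ℝ := κ * q / p with hX
  have hX0 : 0 < X := by positivity
  have hR2N : 0 < R + 2 * N := by positivity
  -- rewrite `L_exc`
  have e1 : Real.sqrt (N / (R / 2)) = Real.sqrt 2 * sN / p := by
    rw [hsN, hp]
    have : N / (R / 2) = 2 * N / R := by field_simp
    rw [this, Real.sqrt_div' _ hR.le, Real.sqrt_mul (by norm_num)]
    field_simp
  have e2 : Real.sqrt ((1 + X⁻¹) / (R / 2)) = Real.sqrt 2 * Real.sqrt (1 + X⁻¹) / Real.sqrt R := by
    have : (1 + X⁻¹) / (R / 2) = 2 * (1 + X⁻¹) / R := by field_simp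
    rw [this, Real.sqrt_div' _ hR.le, Real.sqrt_mul (by norm_num)]
  have e3 : Real.sqrt (R / 2) = Real.sqrt R / Real.sqrt 2 := Real.sqrt_div' R (by norm_num)
  set T : ℝ := Real.sqrt (M * N / (R / 2 + N)) with hT
  have hT0 : 0 ≤ T := Real.sqrt_nonneg _
  have lhs_eq : Real.sqrt (M * N) * X⁻¹ * Lexc X M N R =
      (1 / κ) * (p + Real.sqrt 2 * sN) * (Real.sqrt (1 + X⁻¹) / (1 + X)) * Real.sqrt T * Real.sqrt M := by
    unfold Lexc
    rw [e1, e2, e3, ← hq, ← hT, hX]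
    have h2 : Real.sqrt 2 ≠ 0 := by positivity
    have h1X : 1 + κ * q / p ≠ 0 := by positivity
    field_simp
  rw [lhs_eq]
  -- factor bounds
  have f1 := sqrt_one_add_inv_div_le hX0
  have f1' : Real.sqrt (1 + X⁻¹) / (1 + X) ≤ Real.sqrt p / (Real.sqrt κ * Real.sqrt q) := by
    refine f1.trans (le_of_eq ?_)
    rw [hX, Real.sqrt_div' _ hp0.le, Real.sqrt_mul hκ.le, inv_div]
  have hTq : T = Real.sqrt 2 * q / Real.sqrt (R + 2 * N) := by
    rw [hT, hq]
    have : M * N / (R / 2 + N) = 2 * (M * N) / (R + 2 * N) := by field_simp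
    rw [this, Real.sqrt_div' _ hR2N.le, Real.sqrt_mul (by norm_num)]
  -- `(p + √2 sN) ≤ √2 C √(R + 2N)`
  have f2 : p + Real.sqrt 2 * sN ≤ Real.sqrt 2 * (C * Real.sqrt (R + 2 * N)) := by
    have h := add_two_le_sqrt p (Real.sqrt 2 * sN)
    have e : p ^ 2 + (Real.sqrt 2 * sN) ^ 2 = C ^ 2 * (R + 2 * N) := by
      rw [hp, hsN, mul_pow, mul_pow, mul_pow, Real.sq_sqrt hR.le, Real.sq_sqrt hN.le,
        Real.sq_sqrt (by norm_num : (0:ℝ) ≤ 2)]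
      ring
    rw [e, Real.sqrt_mul (by positivity), Real.sqrt_sq hC.le] at h
    exact h
  -- main chain, working with `Z := √T · √p/√q = √(√2 p/√(R+2N))`
  have hsqT : Real.sqrt T * (Real.sqrt p / (Real.sqrt κ * Real.sqrt q)) =
      (Real.sqrt κ)⁻¹ * Real.sqrt (Real.sqrt 2 * p / Real.sqrt (R + 2 * N)) := by
    have hq2 : Real.sqrt q ≠ 0 := (Real.sqrt_pos.2 hq0).ne'
    have hTpq : T * p / q = Real.sqrt 2 * p / Real.sqrt (R + 2 * N) := by
      rw [hTq]; field_simp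
    have e : Real.sqrt T * (Real.sqrt p / (Real.sqrt κ * Real.sqrt q)) =
        (Real.sqrt κ)⁻¹ * (Real.sqrt T * Real.sqrt p / Real.sqrt q) := by
      field_simp
    rw [e, ← Real.sqrt_mul hT0, ← Real.sqrt_div' _ hq0.le, hTpq]
  have key1 : (1 / κ) * (p + Real.sqrt 2 * sN) * (Real.sqrt (1 + X⁻¹) / (1 + X)) * Real.sqrt T * Real.sqrt M ≤
      (1 / κ) * (Real.sqrt 2 * (C * Real.sqrt (R + 2 * N))) * (Real.sqrt p / (Real.sqrt κ * Real.sqrt q)) *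
        Real.sqrt T * Real.sqrt M := by
    gcongr
  refine key1.trans ?_
  have e4 : (1 / κ) * (Real.sqrt 2 * (C * Real.sqrt (R + 2 * N))) * (Real.sqrt p / (Real.sqrt κ * Real.sqrt q)) *
      Real.sqrt T * Real.sqrt M =
      (Real.sqrt 2 * C / (κ * Real.sqrt κ)) * (Real.sqrt (R + 2 * N) * Real.sqrt (Real.sqrt 2 * p / Real.sqrt (R + 2 * N))) *
        Real.sqrt M := by
    have := hsqT
    calc (1 / κ) * (Real.sqrt 2 * (C * Real.sqrt (R + 2 * N))) * (Real.sqrt p / (Real.sqrt κ * Real.sqrt q)) *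
          Real.sqrt T * Real.sqrt M
        = (1 / κ) * (Real.sqrt 2 * (C * Real.sqrt (R + 2 * N))) *
            (Real.sqrt T * (Real.sqrt p / (Real.sqrt κ * Real.sqrt q))) * Real.sqrt M := by ring
      _ = _ := by rw [hsqT]; field_simp
  rw [e4]
  -- `√(R+2N) √(√2 p/√(R+2N)) = √(√2 p √(R+2N)) ≤ √(2 C √(R(R+N)))`
  have hs2N : 0 < Real.sqrt (R + 2 * N) := Real.sqrt_pos.2 hR2N
  have e5 : Real.sqrt (R + 2 * N) * Real.sqrt (Real.sqrt 2 * p / Real.sqrt (R + 2 * N)) =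
      Real.sqrt (Real.sqrt 2 * p * Real.sqrt (R + 2 * N)) := by
    rw [← Real.sqrt_sq hs2N.le, ← Real.sqrt_mul (sq_nonneg _)]
    congr 1
    rw [Real.sqrt_sq hs2N.le]
    field_simp
  have f3 : Real.sqrt 2 * p * Real.sqrt (R + 2 * N) ≤ 2 * (C * Real.sqrt (R * (R + N))) := by
    have h1 : p * Real.sqrt (R + 2 * N) = C * Real.sqrt (R * (R + 2 * N)) := by
      rw [hp, mul_assoc, ← Real.sqrt_mul hR.le]
    have h2 : Real.sqrt (R * (R + 2 * N)) ≤ Real.sqrt 2 * Real.sqrt (R * (R + N)) := by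
      rw [← Real.sqrt_mul (by norm_num)]
      exact Real.sqrt_le_sqrt (by nlinarith)
    have hs22 : Real.sqrt 2 * Real.sqrt 2 = 2 := Real.mul_self_sqrt (by norm_num)
    calc Real.sqrt 2 * p * Real.sqrt (R + 2 * N) = Real.sqrt 2 * (p * Real.sqrt (R + 2 * N)) := by ring
      _ = Real.sqrt 2 * (C * Real.sqrt (R * (R + 2 * N))) := by rw [h1]
      _ ≤ Real.sqrt 2 * (C * (Real.sqrt 2 * Real.sqrt (R * (R + N)))) := by gcongr
      _ = (Real.sqrt 2 * Real.sqrt 2) * (C * Real.sqrt (R * (R + N))) := by ring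
      _ = 2 * (C * Real.sqrt (R * (R + N))) := by rw [hs22]
  have f4 : Real.sqrt (Real.sqrt 2 * p * Real.sqrt (R + 2 * N)) ≤ Real.sqrt 2 * Real.sqrt (C * Real.sqrt (R * (R + N))) := by
    rw [← Real.sqrt_mul (by norm_num)]
    exact Real.sqrt_le_sqrt (by linarith)
  rw [e5]
  have kexc_eq : Real.sqrt (KexcSq C N R) = C * Real.sqrt (C * Real.sqrt (R * (R + N))) := by
    unfold KexcSq
    rw [show C ^ 3 * Real.sqrt (R * (R + N)) = C ^ 2 * (C * Real.sqrt (R * (R + N))) by ring,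
      Real.sqrt_mul (sq_nonneg _), Real.sqrt_sq hC.le]
  rw [kexc_eq]
  have hs22 : Real.sqrt 2 * Real.sqrt 2 = 2 := Real.mul_self_sqrt (by norm_num)
  calc Real.sqrt 2 * C / (κ * Real.sqrt κ) * Real.sqrt (Real.sqrt 2 * p * Real.sqrt (R + 2 * N)) * Real.sqrt M
      ≤ Real.sqrt 2 * C / (κ * Real.sqrt κ) * (Real.sqrt 2 * Real.sqrt (C * Real.sqrt (R * (R + N)))) * Real.sqrt M := by
        gcongr
    _ = (Real.sqrt 2 * Real.sqrt 2) / (κ * Real.sqrt κ) * (C * Real.sqrt (C * Real.sqrt (R * (R + N)))) * Real.sqrt M := by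
        ring
    _ = 2 / (κ * Real.sqrt κ) * (C * Real.sqrt (C * Real.sqrt (R * (R + N)))) * Real.sqrt M := by rw [hs22]



/-! ### `K_reg`, `K_exc` against the quantity `L` of Theorem 11 -/

/-- The function `g(M, N) = (P + MN + bN)(P + MN + bM)/(P + MN)`. [folklore] -/
def gfun (P b M N : ℝ) : ℝ := (P + M * N + b * N) * (P + M * N + b * M) / (P + M * N)

/-- `g = u + bM + bN + b²MN/u`, `u = P + MN`. [folklore] -/
theorem gfun_eq {P b M N : ℝ} (hu : P + M * N ≠ 0) :
    gfun P b M N = (P + M * N) + b * M + b * N + b ^ 2 * M * N / (P + M * N) := by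
  unfold gfun
  field_simp
  ring

/-- `g` is monotone in `(M, N)` (`P > 0`, `b ≥ 0`). [folklore] -/
theorem gfun_mono {P b M₁ M₂ N₁ N₂ : ℝ} (hP : 0 < P) (hb : 0 ≤ b) (hM₁ : 0 ≤ M₁) (hM : M₁ ≤ M₂)
    (hN₁ : 0 ≤ N₁) (hN : N₁ ≤ N₂) : gfun P b M₁ N₁ ≤ gfun P b M₂ N₂ := by
  have hu₁ : 0 < P + M₁ * N₁ := by positivity
  have hM₂ : 0 ≤ M₂ := hM₁.trans hM
  have hN₂ : 0 ≤ N₂ := hN₁.trans hN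
  have hu₂ : 0 < P + M₂ * N₂ := by positivity
  rw [gfun_eq hu₁.ne', gfun_eq hu₂.ne']
  have hMN : M₁ * N₁ ≤ M₂ * N₂ := mul_le_mul hM hN hN₁ hM₂
  have h4 : b ^ 2 * M₁ * N₁ / (P + M₁ * N₁) ≤ b ^ 2 * M₂ * N₂ / (P + M₂ * N₂) := by
    rw [div_le_div_iff₀ hu₁ hu₂]
    have : M₁ * N₁ * (P + M₂ * N₂) ≤ M₂ * N₂ * (P + M₁ * N₁) := by nlinarith
    nlinarith [sq_nonneg b]
  have h2 : b * M₁ ≤ b * M₂ := mul_le_mul_of_nonneg_left hM hb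
  have h3 : b * N₁ ≤ b * N₂ := mul_le_mul_of_nonneg_left hN hb
  linarith

/-- `g(λM, N) ≤ λ² g(M, N)` for `λ ≥ 1`. [folklore] -/
theorem gfun_scale {P b M N lam : ℝ} (hP : 0 < P) (hb : 0 ≤ b) (hM : 0 ≤ M) (hN : 0 ≤ N) (hlam : 1 ≤ lam) :
    gfun P b (lam * M) N ≤ lam ^ 2 * gfun P b M N := by
  unfold gfun
  have hu : 0 < P + M * N := by positivity
  have hu' : 0 < P + lam * M * N := by positivity
  have hA : P + lam * M * N + b * N ≤ lam * (P + M * N + b * N) := by nlinarith [mul_nonneg hb hN]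
  have hB : P + lam * M * N + b * (lam * M) ≤ lam * (P + M * N + b * M) := by nlinarith [mul_nonneg hb hM]
  have hr : P + M * N ≤ P + lam * M * N := by nlinarith [mul_nonneg hM hN]
  have h0' : 0 ≤ P + lam * M * N + b * (lam * M) := by positivity
  have key : (P + lam * M * N + b * N) * (P + lam * M * N + b * (lam * M)) * (P + M * N) ≤
      lam ^ 2 * ((P + M * N + b * N) * (P + M * N + b * M)) * (P + lam * M * N) := by
    calc (P + lam * M * N + b * N) * (P + lam * M * N + b * (lam * M)) * (P + M * N)
        ≤ (lam * (P + M * N + b * N)) * (lam * (P + M * N + b * M)) * (P + M * N) :=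
          mul_le_mul_of_nonneg_right (mul_le_mul hA hB h0' (by positivity)) hu.le
      _ ≤ (lam * (P + M * N + b * N)) * (lam * (P + M * N + b * M)) * (P + lam * M * N) :=
          mul_le_mul_of_nonneg_left hr (by positivity)
      _ = _ := by ring
  rw [show (P + lam * M * N + b * N) * (P + lam * M * N + b * (lam * M)) / (P + lam * M * N) =
      ((P + lam * M * N + b * N) * (P + lam * M * N + b * (lam * M))) * (P + lam * M * N)⁻¹ by ring,
    show lam ^ 2 * ((P + M * N + b * N) * (P + M * N + b * M) / (P + M * N)) =
      (lam ^ 2 * ((P + M * N + b * N) * (P + M * N + b * M))) * (P + M * N)⁻¹ by ring,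
    ← div_eq_mul_inv, ← div_eq_mul_inv, div_le_div_iff₀ hu' hu]
  calc (P + lam * M * N + b * N) * (P + lam * M * N + b * (lam * M)) * (P + M * N)
      ≤ lam ^ 2 * ((P + M * N + b * N) * (P + M * N + b * M)) * (P + lam * M * N) := key

/-- The `S = 1` form against the `S = 1/2` form: `g(P, b; M, N) ≤ 16 g(P/4, b/2; M, N)`. [folklore] -/
theorem gfun_le_half {P b M N : ℝ} (hP : 0 < P) (hb : 0 ≤ b) (hM : 0 ≤ M) (hN : 0 ≤ N) :
    gfun P b M N ≤ 16 * gfun (P / 4) (b / 2) M N := by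
  unfold gfun
  have hu : 0 < P + M * N := by positivity
  have hu' : 0 < P / 4 + M * N := by positivity
  have hA : P + M * N + b * N ≤ 4 * (P / 4 + M * N + b / 2 * N) := by nlinarith [mul_nonneg hb hN, mul_nonneg hM hN]
  have hB : P + M * N + b * M ≤ 4 * (P / 4 + M * N + b / 2 * M) := by nlinarith [mul_nonneg hb hM, mul_nonneg hM hN]
  have hr : P / 4 + M * N ≤ P + M * N := by linarith
  have key : (P + M * N + b * N) * (P + M * N + b * M) * (P / 4 + M * N) ≤
      16 * ((P / 4 + M * N + b / 2 * N) * (P / 4 + M * N + b / 2 * M)) * (P + M * N) := by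
    calc (P + M * N + b * N) * (P + M * N + b * M) * (P / 4 + M * N)
        ≤ (4 * (P / 4 + M * N + b / 2 * N)) * (4 * (P / 4 + M * N + b / 2 * M)) * (P / 4 + M * N) :=
          mul_le_mul_of_nonneg_right (mul_le_mul hA hB (by positivity) (by positivity)) hu'.le
      _ ≤ (4 * (P / 4 + M * N + b / 2 * N)) * (4 * (P / 4 + M * N + b / 2 * M)) * (P + M * N) :=
          mul_le_mul_of_nonneg_left hr (by positivity)
      _ = _ := by ring
  rw [show (P + M * N + b * N) * (P + M * N + b * M) / (P + M * N) =
      ((P + M * N + b * N) * (P + M * N + b * M)) * (P + M * N)⁻¹ by ring,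
    show 16 * ((P / 4 + M * N + b / 2 * N) * (P / 4 + M * N + b / 2 * M) / (P / 4 + M * N)) =
      (16 * ((P / 4 + M * N + b / 2 * N) * (P / 4 + M * N + b / 2 * M))) * (P / 4 + M * N)⁻¹ by ring,
    ← div_eq_mul_inv, ← div_eq_mul_inv, div_le_div_iff₀ hu hu']
  calc (P + M * N + b * N) * (P + M * N + b * M) * (P / 4 + M * N)
      ≤ 16 * ((P / 4 + M * N + b / 2 * N) * (P / 4 + M * N + b / 2 * M)) * (P + M * N) := key

/-- The radicand of `BFI.L1.diL` (`= diL²`). [folklore] -/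
def diLSq (C M N R : ℝ) : ℝ :=
  R * (1 / 2) * ((C ^ 2 * (1 / 2) ^ 2 * R + M * N + C ^ 2 * (1 / 2) * N) *
      (C ^ 2 * (1 / 2) ^ 2 * R + M * N + C ^ 2 * (1 / 2) * M) / (C ^ 2 * (1 / 2) ^ 2 * R + M * N)) +
    C ^ 3 * (1 / 2) ^ 2 * Real.sqrt (R * (N + R * (1 / 2)))

/-- **`K_reg²(C, M', N', R) ≤ 32 λ² · diL²(C, M, N, R)`** for `M' ≤ λM`, `N' ≤ N`, `λ ≥ 1`. [folklore] -/
theorem KregSq_le_diLSq {C M N R M' N' lam : ℝ} (hC : 0 < C) (hR : 0 < R) (hM : 0 < M) (hN : 0 < N)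
    (hM'0 : 0 ≤ M') (hM' : M' ≤ lam * M) (hN'0 : 0 ≤ N') (hN' : N' ≤ N) (hlam : 1 ≤ lam) :
    KregSq C M' N' R ≤ 32 * lam ^ 2 * diLSq C M N R := by
  have hP : 0 < C ^ 2 * R := by positivity
  have hb : 0 ≤ C ^ 2 := sq_nonneg _
  have e1 : KregSq C M' N' R = R * gfun (C ^ 2 * R) (C ^ 2) M' N' := by
    unfold KregSq gfun; ring_nf
  have e2 : diLSq C M N R = R / 2 * gfun (C ^ 2 * R / 4) (C ^ 2 / 2) M N +
      C ^ 3 * (1 / 2) ^ 2 * Real.sqrt (R * (N + R * (1 / 2))) := by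
    unfold diLSq gfun; ring_nf
  have h1 : gfun (C ^ 2 * R) (C ^ 2) M' N' ≤ gfun (C ^ 2 * R) (C ^ 2) (lam * M) N :=
    gfun_mono hP hb hM'0 hM' hN'0 hN'
  have h2 : gfun (C ^ 2 * R) (C ^ 2) (lam * M) N ≤ lam ^ 2 * gfun (C ^ 2 * R) (C ^ 2) M N :=
    gfun_scale hP hb hM.le hN.le hlam
  have h3 : gfun (C ^ 2 * R) (C ^ 2) M N ≤ 16 * gfun (C ^ 2 * R / 4) (C ^ 2 / 2) M N :=
    gfun_le_half hP hb hM.le hN.le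
  have h4 : 0 ≤ C ^ 3 * (1 / 2) ^ 2 * Real.sqrt (R * (N + R * (1 / 2))) := by positivity
  have hg0 : 0 ≤ gfun (C ^ 2 * R / 4) (C ^ 2 / 2) M N := by unfold gfun; positivity
  rw [e1, e2]
  have : R * gfun (C ^ 2 * R) (C ^ 2) M' N' ≤ R * (lam ^ 2 * (16 * gfun (C ^ 2 * R / 4) (C ^ 2 / 2) M N)) := by
    refine mul_le_mul_of_nonneg_left (h1.trans (h2.trans ?_)) hR.le
    exact mul_le_mul_of_nonneg_left h3 (by positivity)
  nlinarith [mul_nonneg (sq_nonneg lam) h4, mul_nonneg (sq_nonneg lam) (mul_nonneg hR.le hg0)]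

/-- **`K_exc²(C, N', R) ≤ 4√2 · diL²(C, M, N, R)`** for `N' ≤ N`. [folklore] -/
theorem KexcSq_le_diLSq {C M N R N' : ℝ} (hC : 0 < C) (hR : 0 < R) (hM : 0 ≤ M) (hN : 0 ≤ N)
    (hN' : N' ≤ N) :
    KexcSq C N' R ≤ 4 * Real.sqrt 2 * diLSq C M N R := by
  unfold KexcSq diLSq
  have h1 : Real.sqrt (R * (R + N')) ≤ Real.sqrt 2 * Real.sqrt (R * (N + R * (1 / 2))) := by
    rw [← Real.sqrt_mul (by norm_num)]
    exact Real.sqrt_le_sqrt (by nlinarith)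
  have hfirst : 0 ≤ R * (1 / 2) * ((C ^ 2 * (1 / 2) ^ 2 * R + M * N + C ^ 2 * (1 / 2) * N) *
      (C ^ 2 * (1 / 2) ^ 2 * R + M * N + C ^ 2 * (1 / 2) * M) / (C ^ 2 * (1 / 2) ^ 2 * R + M * N)) := by positivity
  have hs : 0 ≤ Real.sqrt (R * (N + R * (1 / 2))) := Real.sqrt_nonneg _
  have hC3 : 0 < C ^ 3 := by positivity
  have := mul_le_mul_of_nonneg_left h1 hC3.le
  nlinarith [mul_nonneg (Real.sqrt_nonneg 2) hfirst, Real.sqrt_nonneg 2,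
    mul_nonneg (mul_nonneg (Real.sqrt_nonneg 2) hC3.le) hs]





/-! ### The Kuznetsov-shaped sum of Deshouillers–Iwaniec §9.1 at `s = 1` and the hypothesis (Prop. 4.12) -/

/-- The Kuznetsov variable `x = 4π√(mn)/(c√r)`. [cite: DeshouillersIwaniec1982, §9.1 (9.1)–(9.2) p. 278–279] -/
def xK (m n r c : ℕ) : ℝ := 4 * π * Real.sqrt ((m : ℝ) * n) / ((c : ℝ) * Real.sqrt r)

/-- **The sum of Deshouillers–Iwaniec's (9.2) at `s = 1`** (Drappeau Prop. 4.12 with `q = 1`, cusp pair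
`∞, 0` of `Γ₀(r)` with the translation phase `e(θm)`), in classical terms:
`∑_{r∼R} ∑_{n∼N} β_{nr} ∑_{a<m≤u} e(θm) ∑_{c≤cM,(c,r)=1} (c√r)⁻¹ φ(4π√(mn)/(c√r)) 𝓢_c(±m; n, r)`
(`𝓢_c(m;n,r) = S(m r̄, n; c)`; the cusp phase `e(n/r)` of `S_{∞,1}` is absorbed in `β`).
[cite: DeshouillersIwaniec1982, §9.1 (9.2) p. 279] -/
def kuzSum (φ : ℝ → ℂ) (θ R N : ℝ) (a u : ℕ) (sgn : ℤ) (cM : ℕ) (β : ℕ → ℕ → ℂ) : ℂ :=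
  ∑ r ∈ dyadic R, ∑ n ∈ dyadic N, β n r *
    ∑ m ∈ Finset.Ioc a u, ((𝐞 (θ * m) : Circle) : ℂ) *
      ∑ c ∈ (Finset.Icc 1 cM).filter (fun c => r.Coprime c),
        ((((c : ℝ) * Real.sqrt r)⁻¹ : ℝ) : ℂ) * φ (xK m n r c) * kl c r n (sgn * m)

/-- `log x_K = log 4π + (log m + log n)/2 − log c − (log r)/2` (`m, n, r, c ≥ 1`). [folklore] -/
theorem log_xK {m n r c : ℕ} (hm : 0 < m) (hn : 0 < n) (hr : 0 < r) (hc : 0 < c) :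
    Real.log (xK m n r c) = Real.log (4 * π) + (Real.log m + Real.log n) / 2 - Real.log c - Real.log r / 2 := by
  unfold xK
  have hm' : (0:ℝ) < m := by exact_mod_cast hm
  have hn' : (0:ℝ) < n := by exact_mod_cast hn
  have hr' : (0:ℝ) < r := by exact_mod_cast hr
  have hc' : (0:ℝ) < c := by exact_mod_cast hc
  have hsr : 0 < Real.sqrt r := Real.sqrt_pos.2 hr'
  rw [Real.log_div (by positivity) (by positivity), Real.log_mul (by positivity) (by positivity),
    Real.log_mul (by positivity) (by positivity), Real.log_sqrt (by positivity),
    Real.log_mul hc'.ne' hsr.ne', Real.log_sqrt hr'.le, Real.log_mul hm'.ne' hn'.ne']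
  ring

/-- `x_K > 0`. [folklore] -/
theorem xK_pos {m n r c : ℕ} (hm : 0 < m) (hn : 0 < n) (hr : 0 < r) (hc : 0 < c) : 0 < xK m n r c := by
  unfold xK
  have hm' : (0:ℝ) < m := by exact_mod_cast hm
  have hn' : (0:ℝ) < n := by exact_mod_cast hn
  have hr' : (0:ℝ) < r := by exact_mod_cast hr
  have hc' : (0:ℝ) < c := by exact_mod_cast hc
  positivity

/-- `e(a + b) = e(a) e(b)` in `ℂ` (local copy of `BFI.L1R.e_add_eq_mul` of
`…Lemma1Refutation`, which is not imported here). [folklore] -/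
private theorem e_add (a b : ℝ) : ((𝐞 (a + b) : Circle) : ℂ) = (𝐞 a : ℂ) * (𝐞 b : ℂ) := by
  rw [AddChar.map_add_eq_mul, Circle.coe_mul]

/-- **The phase of the separated weight**:
`e(w₀ log(c/C)) = e(w₀ log(4π/C)) e((w₀/2) log m) e((w₀/2) log n) e(−(w₀/2) log r) e(−w₀ log x_K)`. [folklore] -/
theorem e_log_div_eq {m n r c : ℕ} (hm : 0 < m) (hn : 0 < n) (hr : 0 < r) (hc : 0 < c) {C : ℝ} (hC : 0 < C) (w₀ : ℝ) :
    ((𝐞 (w₀ * Real.log ((c : ℝ) / C)) : Circle) : ℂ) =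
      (𝐞 (w₀ * Real.log (4 * π / C)) : ℂ) * (𝐞 (w₀ / 2 * Real.log m) : ℂ) * (𝐞 (w₀ / 2 * Real.log n) : ℂ) *
        (𝐞 (-(w₀ / 2) * Real.log r) : ℂ) * (𝐞 (-w₀ * Real.log (xK m n r c)) : ℂ) := by
  rw [← e_add, ← e_add, ← e_add, ← e_add]
  congr 2
  have hc' : (0:ℝ) < c := by exact_mod_cast hc
  rw [log_xK hm hn hr hc, Real.log_div hc'.ne' hC.ne', Real.log_div (by positivity) hC.ne']
  ring

/-- `x^{−1−2πiw₀} = x⁻¹ e(−w₀ log x)` for `x > 0`. [folklore] -/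
theorem cpw_neg_one_sub (w₀ : ℝ) {x : ℝ} (hx : 0 < x) :
    cpw (-1 - 2 * π * w₀ * Complex.I) x = ((x⁻¹ : ℝ) : ℂ) * (𝐞 (-w₀ * Real.log x) : ℂ) := by
  rw [cpw_eq_exp hx, Real.fourierChar_apply]
  have : ((Real.log x : ℝ) : ℂ) * (-1 - 2 * π * w₀ * Complex.I) =
      (-(Real.log x) : ℝ) + ((2 * π * (-w₀ * Real.log x) : ℝ) : ℂ) * Complex.I := by
    push_cast; ring
  rw [this, Complex.exp_add]
  congr 1
  rw [Complex.ofReal_neg, Complex.exp_neg, ← Complex.ofReal_exp, Real.exp_log hx, Complex.ofReal_inv]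

/-- **The test function appears**: `P_t(x) e(−w₀ log x) = x · φ_{t,s}(x)`, `s = −1 − 2πiw₀`, `x > 0`. [folklore] -/
theorem pieceT_mul_e_eq (t w₀ : ℝ) {x : ℝ} (hx : 0 < x) :
    ((pieceT t x : ℝ) : ℂ) * (𝐞 (-w₀ * Real.log x) : ℂ) = (x : ℂ) * testFn t (-1 - 2 * π * w₀ * Complex.I) x := by
  unfold testFn pieceC
  rw [cpw_neg_one_sub w₀ hx]
  have hx' : (x : ℂ) ≠ 0 := by exact_mod_cast hx.ne'
  push_cast
  field_simp

/-- `√m · e((w₀/2) log m) = m^{1/2 + πiw₀}` (`m > 0`). [folklore] -/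
theorem sqrt_mul_e_log (w₀ : ℝ) {m : ℝ} (hm : 0 < m) :
    ((Real.sqrt m : ℝ) : ℂ) * (𝐞 (w₀ / 2 * Real.log m) : ℂ) = (m : ℂ) ^ ((1 / 2 : ℂ) + π * w₀ * Complex.I) := by
  have hm0 : (m : ℂ) ≠ 0 := by exact_mod_cast hm.ne'
  have h1 : ((Real.sqrt m : ℝ) : ℂ) = (m : ℂ) ^ ((1 / 2 : ℝ) : ℂ) := by
    rw [Real.sqrt_eq_rpow, Complex.ofReal_cpow hm.le]
  have h2 : ((𝐞 (w₀ / 2 * Real.log m) : Circle) : ℂ) = (m : ℂ) ^ ((π * w₀ : ℂ) * Complex.I) := by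
    rw [Complex.cpow_def_of_ne_zero hm0, ← Complex.ofReal_log hm.le, Real.fourierChar_apply]
    congr 1
    push_cast
    ring
  rw [h1, h2, ← Complex.cpow_add _ _ hm0]
  congr 1
  push_cast
  ring


/-- `x_K = 4π √m √n (c√r)⁻¹`. [folklore] -/
theorem xK_eq (m n r c : ℕ) : xK m n r c = 4 * π * Real.sqrt m * Real.sqrt n * ((c : ℝ) * Real.sqrt r)⁻¹ := by
  unfold xK
  rw [Real.sqrt_mul (Nat.cast_nonneg m)]
  ring

/-- **The separated summand** (for fixed frequencies `w = (w₀, w₁)`): with `κ = 1/2 + πiw₀`,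
`s = −1 − 2πiw₀`,
`e(w₀ log(c/C) + w₁ m/M) · P_τ(x_K) = e(w₀ log(4π/C)) · (4π m^κ e(w₁ m/M)) · (n^κ e(−(w₀/2) log r)) · (c√r)⁻¹ φ_{τ,s}(x_K)`.
[cite: DeshouillersIwaniec1982, §9.1 (9.1)–(9.2) p. 278–279] -/
theorem separated_summand {m n r c : ℕ} (hm : 0 < m) (hn : 0 < n) (hr : 0 < r) (hc : 0 < c) {C M : ℝ}
    (hC : 0 < C) (τ w₀ w₁ : ℝ) :
    ((𝐞 (w₀ * Real.log ((c : ℝ) / C) + w₁ * ((m : ℝ) / M)) : Circle) : ℂ) * ((pieceT τ (xK m n r c) : ℝ) : ℂ) =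
      (𝐞 (w₀ * Real.log (4 * π / C)) : ℂ) *
        ((4 * π : ℂ) * (m : ℂ) ^ ((1 / 2 : ℂ) + π * w₀ * Complex.I) * (𝐞 (w₁ * ((m : ℝ) / M)) : ℂ)) *
        ((n : ℂ) ^ ((1 / 2 : ℂ) + π * w₀ * Complex.I) * (𝐞 (-(w₀ / 2) * Real.log r) : ℂ)) *
        (((((c : ℝ) * Real.sqrt r)⁻¹ : ℝ) : ℂ) * testFn τ (-1 - 2 * π * w₀ * Complex.I) (xK m n r c)) := by
  have hx := xK_pos hm hn hr hc
  rw [e_add, e_log_div_eq hm hn hr hc hC w₀]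
  have hm' : (0:ℝ) < m := by exact_mod_cast hm
  have hn' : (0:ℝ) < n := by exact_mod_cast hn
  -- `e(−w₀ log x) P(x) = x φ(x)` and `x = 4π √m √n (c√r)⁻¹`
  have key : (𝐞 (-w₀ * Real.log (xK m n r c)) : ℂ) * ((pieceT τ (xK m n r c) : ℝ) : ℂ) =
      ((4 * π : ℂ) * ((Real.sqrt m : ℝ) : ℂ) * ((Real.sqrt n : ℝ) : ℂ) * ((((c : ℝ) * Real.sqrt r)⁻¹ : ℝ) : ℂ)) *
        testFn τ (-1 - 2 * π * w₀ * Complex.I) (xK m n r c) := by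
    rw [mul_comm, pieceT_mul_e_eq τ w₀ hx, xK_eq]
    push_cast
    ring
  have hsm := sqrt_mul_e_log w₀ hm'
  have hsn := sqrt_mul_e_log w₀ hn'
  -- reassemble
  calc (𝐞 (w₀ * Real.log (4 * π / C)) : ℂ) * (𝐞 (w₀ / 2 * Real.log m) : ℂ) * (𝐞 (w₀ / 2 * Real.log n) : ℂ) *
        (𝐞 (-(w₀ / 2) * Real.log r) : ℂ) * (𝐞 (-w₀ * Real.log (xK m n r c)) : ℂ) *
        (𝐞 (w₁ * ((m : ℝ) / M)) : ℂ) * ((pieceT τ (xK m n r c) : ℝ) : ℂ)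
      = (𝐞 (w₀ * Real.log (4 * π / C)) : ℂ) * (𝐞 (w₀ / 2 * Real.log m) : ℂ) * (𝐞 (w₀ / 2 * Real.log n) : ℂ) *
        (𝐞 (-(w₀ / 2) * Real.log r) : ℂ) * (𝐞 (w₁ * ((m : ℝ) / M)) : ℂ) *
        ((𝐞 (-w₀ * Real.log (xK m n r c)) : ℂ) * ((pieceT τ (xK m n r c) : ℝ) : ℂ)) := by ring
    _ = (𝐞 (w₀ * Real.log (4 * π / C)) : ℂ) *
        ((4 * π : ℂ) * ((((Real.sqrt m : ℝ) : ℂ) * (𝐞 (w₀ / 2 * Real.log m) : ℂ))) * (𝐞 (w₁ * ((m : ℝ) / M)) : ℂ)) *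
        ((((Real.sqrt n : ℝ) : ℂ) * (𝐞 (w₀ / 2 * Real.log n) : ℂ)) * (𝐞 (-(w₀ / 2) * Real.log r) : ℂ)) *
        (((((c : ℝ) * Real.sqrt r)⁻¹ : ℝ) : ℂ) * testFn τ (-1 - 2 * π * w₀ * Complex.I) (xK m n r c)) := by
        rw [key]; ring
    _ = _ := by rw [hsm, hsn]; simp only [Complex.ofReal_natCast]



/-! ### The support of `g₀` in the second variable -/

/-- **`y`-support of the weight**: a smooth `g₀` with compact support inside `[1, 2] × (0, ∞)` vanishes
unless `1 ≤ x ≤ 2` and `μ₁ ≤ y ≤ μ₂`, for some `0 < μ₁ ≤ μ₂`. [folklore] -/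
theorem exists_ySupport {g₀ : ℝ × ℝ → ℝ} (hc : HasCompactSupport g₀)
    (hsupp : tsupport g₀ ⊆ Set.Icc (1 : ℝ) 2 ×ˢ Set.Ioi (0 : ℝ)) :
    ∃ μ₁ μ₂ : ℝ, 0 < μ₁ ∧ μ₁ ≤ μ₂ ∧
      ∀ x y : ℝ, g₀ (x, y) ≠ 0 → (1 ≤ x ∧ x ≤ 2) ∧ (μ₁ ≤ y ∧ y ≤ μ₂) := by
  by_cases hne : (tsupport g₀).Nonempty
  · -- the continuous second coordinate attains its min and max on the compact support
    obtain ⟨pmin, hpmin, hmin⟩ := hc.isCompact.exists_isMinOn hne continuous_snd.continuousOn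
    obtain ⟨pmax, hpmax, hmax⟩ := hc.isCompact.exists_isMaxOn hne continuous_snd.continuousOn
    have hμ₁ : 0 < pmin.2 := by
      have := hsupp hpmin
      rw [Set.mem_prod] at this
      exact this.2
    refine ⟨pmin.2, pmax.2, hμ₁, hmin hpmax, fun x y hxy => ?_⟩
    have hmem : (x, y) ∈ tsupport g₀ := subset_tsupport _ hxy
    have h12 := hsupp hmem
    rw [Set.mem_prod, Set.mem_Icc] at h12
    exact ⟨h12.1, hmin hmem, hmax hmem⟩
  · -- empty support: `g₀ ≡ 0`
    refine ⟨1, 1, one_pos, le_rfl, fun x y hxy => ?_⟩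
    exfalso
    exact hne ⟨(x, y), subset_tsupport _ hxy⟩



/-! ### One dyadic piece of `𝒯`: the sum, and the insertion of the `x`-partition -/

/-- One piece of the Deshouillers–Iwaniec sum: `n` over a finite set `Nb` (a dyadic block), `m` over
`(a, u]`, `c ≤ cM` coprime to `r`. [folklore] -/
def pieceSum (g₀ : ℝ × ℝ → ℝ) (C M R : ℝ) (Nb : Finset ℕ) (a u : ℕ) (sgn : ℤ) (cM : ℕ)
    (b : ℕ → ℕ → ℂ) : ℂ :=
  ∑ r ∈ dyadic R, ∑ n ∈ Nb, b n r *
    ∑ m ∈ Finset.Ioc a u, ∑ c ∈ (Finset.Icc 1 cM).filter (fun c => r.Coprime c),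
      ((g₀ ((c : ℝ) / C, (m : ℝ) / M) : ℝ) : ℂ) * kl c r n (sgn * m)

/-- The lower end `X_a = 4π√(tN')/(2C√(2R))` of the range of `x_K` on a dyadic configuration. [folklore] -/
def Xa (C R N' t : ℝ) : ℝ := 4 * π * Real.sqrt (t * N') / (2 * C * Real.sqrt (2 * R))

/-- **Range of `x_K`** on a dyadic configuration: for `C ≤ c ≤ 2C`, `t < m ≤ 2t`, `N' < n ≤ 2N'`,
`R < r ≤ 2R`: `X_a ≤ x_K ≤ 4√2 X_a`. [folklore] -/
theorem xK_mem_range {C R N' t : ℝ} (hC : 0 < C) (hR : 0 < R) (hN' : 0 < N') (ht : 0 < t)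
    {m n r c : ℕ} (hm1 : t < m) (hm2 : (m : ℝ) ≤ 2 * t) (hn1 : N' < n) (hn2 : (n : ℝ) ≤ 2 * N')
    (hr1 : R < r) (hr2 : (r : ℝ) ≤ 2 * R) (hc1 : C ≤ c) (hc2 : (c : ℝ) ≤ 2 * C) :
    Xa C R N' t ≤ xK m n r c ∧ xK m n r c ≤ 4 * Real.sqrt 2 * Xa C R N' t := by
  have hm0 : (0:ℝ) < m := ht.trans hm1
  have hn0 : (0:ℝ) < n := hN'.trans hn1
  have hr0 : (0:ℝ) < r := hR.trans hr1
  have hc0 : (0:ℝ) < c := hC.trans_le hc1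
  have hsr : Real.sqrt r ≤ Real.sqrt (2 * R) := Real.sqrt_le_sqrt hr2
  have hsr' : Real.sqrt R ≤ Real.sqrt r := Real.sqrt_le_sqrt hr1.le
  have hs2R : Real.sqrt (2 * R) = Real.sqrt 2 * Real.sqrt R := Real.sqrt_mul (by norm_num) R
  have hmn_lo : Real.sqrt (t * N') ≤ Real.sqrt ((m : ℝ) * n) :=
    Real.sqrt_le_sqrt (mul_le_mul hm1.le hn1.le hN'.le hm0.le)
  have hmn_hi : Real.sqrt ((m : ℝ) * n) ≤ 2 * Real.sqrt (t * N') := by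
    rw [show (2 : ℝ) = Real.sqrt 4 by rw [show (4:ℝ) = 2 ^ 2 by norm_num, Real.sqrt_sq (by norm_num)],
      ← Real.sqrt_mul (by norm_num)]
    exact Real.sqrt_le_sqrt (by nlinarith)
  unfold Xa xK
  constructor
  · -- lower bound: shrink numerator, grow denominator
    rw [div_le_div_iff₀ (by positivity) (by positivity)]
    have h1 : (c : ℝ) * Real.sqrt r ≤ 2 * C * Real.sqrt (2 * R) :=
      mul_le_mul hc2 hsr (Real.sqrt_nonneg _) (by positivity)
    have h0 : 0 ≤ 4 * π * Real.sqrt (t * N') := by positivity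
    calc 4 * π * Real.sqrt (t * N') * ((c : ℝ) * Real.sqrt r)
        ≤ 4 * π * Real.sqrt (t * N') * (2 * C * Real.sqrt (2 * R)) := mul_le_mul_of_nonneg_left h1 h0
      _ ≤ 4 * π * Real.sqrt ((m : ℝ) * n) * (2 * C * Real.sqrt (2 * R)) := by gcongr
  · -- upper bound
    rw [div_le_iff₀ (by positivity)]
    have h2 : C * Real.sqrt R ≤ (c : ℝ) * Real.sqrt r := mul_le_mul hc1 hsr' (Real.sqrt_nonneg _) hc0.le
    have hs22 : Real.sqrt 2 * Real.sqrt 2 = 2 := Real.mul_self_sqrt (by norm_num)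
    have e : 4 * Real.sqrt 2 * (4 * π * Real.sqrt (t * N') / (2 * C * Real.sqrt (2 * R))) * ((c : ℝ) * Real.sqrt r) =
        4 * π * (2 * Real.sqrt (t * N')) * (((c : ℝ) * Real.sqrt r) / (C * Real.sqrt R)) * (Real.sqrt 2 * Real.sqrt 2 / 2) := by
      have hs2sq : Real.sqrt 2 ^ 2 = 2 := Real.sq_sqrt (by norm_num)
      rw [hs2R]; field_simp; nlinarith [hs2sq]
    rw [e, hs22]
    have hq : 1 ≤ ((c : ℝ) * Real.sqrt r) / (C * Real.sqrt R) := by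
      rw [le_div_iff₀ (by positivity)]; linarith
    calc 4 * π * Real.sqrt ((m : ℝ) * n) ≤ 4 * π * (2 * Real.sqrt (t * N')) * 1 * (2 / 2) := by
          rw [mul_one, div_self (two_ne_zero), mul_one]; gcongr
      _ ≤ 4 * π * (2 * Real.sqrt (t * N')) * (((c : ℝ) * Real.sqrt r) / (C * Real.sqrt R)) * (2 / 2) := by
          gcongr

/-- **Insertion of the partition**: on a dyadic configuration, wherever `g₀(c/C, m/M) ≠ 0` we have
`g₀(c/C, m/M) = g₀(c/C, m/M) · ∑_{ℓ<5} P_{(9/5)^ℓ X_a}(x_K)`. [folklore] -/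
theorem g0_mul_sum_pieceT {g₀ : ℝ × ℝ → ℝ} {μ₁ μ₂ : ℝ}
    (hys : ∀ x y : ℝ, g₀ (x, y) ≠ 0 → (1 ≤ x ∧ x ≤ 2) ∧ (μ₁ ≤ y ∧ y ≤ μ₂))
    {C M R N' t : ℝ} (hC : 0 < C) (hR : 0 < R) (hN' : 0 < N') (ht : 0 < t)
    {m n r c : ℕ} (hm1 : t < m) (hm2 : (m : ℝ) ≤ 2 * t) (hn1 : N' < n) (hn2 : (n : ℝ) ≤ 2 * N')
    (hr1 : R < r) (hr2 : (r : ℝ) ≤ 2 * R) :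
    g₀ ((c : ℝ) / C, (m : ℝ) / M) =
      g₀ ((c : ℝ) / C, (m : ℝ) / M) * ∑ ℓ ∈ Finset.range 5, pieceT ((9 / 5) ^ ℓ * Xa C R N' t) (xK m n r c) := by
  by_cases hg : g₀ ((c : ℝ) / C, (m : ℝ) / M) = 0
  · rw [hg, zero_mul]
  · obtain ⟨⟨hc1, hc2⟩, -⟩ := hys _ _ hg
    rw [le_div_iff₀ hC] at hc1
    rw [div_le_iff₀ hC] at hc2
    have hX0 : 0 < Xa C R N' t := by unfold Xa; positivity
    have hrange := xK_mem_range hC hR hN' ht hm1 hm2 hn1 hn2 hr1 hr2 (by linarith) (by linarith)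
    rw [sum_pieceT_eq_one hX0 5 hrange.1 ?_, mul_one]
    refine hrange.2.trans ?_
    have h95 : 4 * Real.sqrt 2 ≤ 19 / 20 * (9 / 5 : ℝ) ^ 5 := by
      have : Real.sqrt 2 ≤ 3 / 2 := by
        rw [Real.sqrt_le_left (by norm_num)]; norm_num
      norm_num; linarith
    nlinarith [hX0]



/-! ### Linearity of the Kuznetsov-shaped sum and the bound for the un-normalised test functions -/

/-- `kuzSum` is linear in the test function. [folklore] -/
theorem kuzSum_const_mul (cst : ℂ) (φ : ℝ → ℂ) (θ R N : ℝ) (a u : ℕ) (sgn : ℤ) (cM : ℕ) (β : ℕ → ℕ → ℂ) :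
    kuzSum (fun x => cst * φ x) θ R N a u sgn cM β = cst * kuzSum φ θ R N a u sgn cM β := by
  unfold kuzSum
  simp only [Finset.mul_sum]
  refine Finset.sum_congr rfl fun r _ => Finset.sum_congr rfl fun n _ =>
    Finset.sum_congr rfl fun m _ => Finset.sum_congr rfl fun c _ => ?_
  ring

/-- The normalising constant `A_s X⁻¹ = 2·20⁴ K₄ (|s|+4)⁴ X^{-1}` of `norm_iteratedDeriv_testFn_le`. [folklore] -/
def tfConst (s : ℂ) (X : ℝ) : ℝ := 2 * 20 ^ 4 * derivConst 4 * (‖s‖ + 4) ^ 4 * X ^ (-(1 : ℝ))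

/-- `A_s X⁻¹ > 0`. [folklore] -/
theorem tfConst_pos (s : ℂ) {X : ℝ} (hX : 0 < X) : 0 < tfConst s X := by
  unfold tfConst
  have := one_le_derivConst 4
  have : 0 < ‖s‖ + 4 := by linarith [norm_nonneg s]
  positivity

/-- **The normalised test function is admissible**: `ψ = (A_s X⁻¹)⁻¹ φ_{τ,s}` (`X = 0.95τ`, `re s = −1`)
is smooth, supported in `[X, 2X]`, with `|ψ^{(j)}| ≤ X^{-j}` for `j ≤ 4`. [folklore] -/
theorem testFn_normalised_admissible {τ : ℝ} (hτ : 0 < τ) {s : ℂ} (hs : s.re = -1) :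
    let X : ℝ := 19 / 20 * τ
    let ψ : ℝ → ℂ := fun x => ((tfConst s X)⁻¹ : ℂ) * testFn τ s x
    ContDiff ℝ ∞ ψ ∧ (∀ x, ψ x ≠ 0 → x ∈ Set.Icc X (2 * X)) ∧
      ∀ j ≤ 4, ∀ x, ‖iteratedDeriv j ψ x‖ ≤ X ^ (-(j : ℝ)) := by
  intro X ψ
  have hXdef : X = 19 / 20 * τ := rfl
  have hX0 : 0 < X := by positivity
  have hA := tfConst_pos s hX0
  refine ⟨contDiff_const.mul (contDiff_testFn hτ s), fun x hx => ?_, fun j hj x => ?_⟩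
  · -- support
    have hne : testFn τ s x ≠ 0 := by
      intro h0; exact hx (by simp only [ψ, h0, mul_zero])
    by_contra hnot
    rw [Set.mem_Icc, not_and_or, not_le, not_le] at hnot
    rcases hnot with h | h
    · exact hne (testFn_eq_zero hτ (Or.inl h.le))
    · exact hne (testFn_eq_zero hτ (Or.inr (by rw [hXdef] at h; linarith)))
  · -- derivatives: `D^j(c φ) = c D^j φ`
    have hj' : ((j : ℕ∞) : WithTop ℕ∞) ≤ ∞ := by exact_mod_cast le_top
    have hcd : ContDiffAt ℝ j (testFn τ s) x := ((contDiff_testFn hτ s).of_le hj').contDiffAt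
    have e : iteratedDeriv j ψ x = ((tfConst s X)⁻¹ : ℂ) * iteratedDeriv j (testFn τ s) x := by
      show iteratedDeriv j (fun y => ((tfConst s X)⁻¹ : ℂ) * testFn τ s y) x = _
      rw [iteratedDeriv_const_mul _ hcd]
    rw [e, norm_mul, norm_inv, Complex.norm_real, Real.norm_of_nonneg hA.le]
    have hb := norm_iteratedDeriv_testFn_le hτ hs hj x
    rw [inv_mul_le_iff₀ hA]
    refine hb.trans (le_of_eq ?_)
    unfold tfConst
    rw [show (-(1 : ℝ) - j) = -(1 : ℝ) + (-(j : ℝ)) by ring, Real.rpow_add hX0]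
    ring

/-- **The Kuznetsov bound for the un-normalised test function**: if the normalised `ψ` obeys a bound
`‖kuzSum ψ …‖ ≤ B`, then `‖kuzSum φ_{τ,s} …‖ ≤ A_s X⁻¹ · B`. [folklore] -/
theorem norm_kuzSum_testFn_le {τ : ℝ} (hτ : 0 < τ) (s : ℂ) (θ R N : ℝ) (a u : ℕ) (sgn : ℤ) (cM : ℕ)
    (β : ℕ → ℕ → ℂ) {B : ℝ}
    (hB : ‖kuzSum (fun x => ((tfConst s (19 / 20 * τ))⁻¹ : ℂ) * testFn τ s x) θ R N a u sgn cM β‖ ≤ B) :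
    ‖kuzSum (testFn τ s) θ R N a u sgn cM β‖ ≤ tfConst s (19 / 20 * τ) * B := by
  have hA := tfConst_pos s (by positivity : 0 < 19 / 20 * τ)
  rw [kuzSum_const_mul, norm_mul, norm_inv, Complex.norm_real, Real.norm_of_nonneg hA.le,
    inv_mul_le_iff₀ hA] at hB
  exact hB



/-! ### The piece as an integral over the frequencies -/

/-- The exponents `κ(w) = 1/2 + πiw₀`, `s(w) = −1 − 2πiw₀`. [folklore] -/
def kap (w : E2) : ℂ := (1 / 2 : ℂ) + π * (w.ofLp 0) * Complex.I

/-- See `kap`. [folklore] -/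
def sEx (w : E2) : ℂ := -1 - 2 * π * (w.ofLp 0) * Complex.I

/-- `re κ = 1/2`. [folklore] -/
theorem kap_re (w : E2) : (kap w).re = 1 / 2 := by simp [kap]
/-- `re s = −1`. [folklore] -/
theorem sEx_re (w : E2) : (sEx w).re = -1 := by simp [sEx]

/-- `|κ| ≤ 1/2 + π|w₀|`. [folklore] -/
theorem norm_kap_le (w : E2) : ‖kap w‖ ≤ 1 / 2 + π * |w.ofLp 0| := by
  unfold kap
  refine (norm_add_le _ _).trans ?_
  have h1 : ‖(1 / 2 : ℂ)‖ = 1 / 2 := by norm_num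
  rw [h1, norm_mul, norm_mul, Complex.norm_I, mul_one, Complex.norm_real, Complex.norm_real,
    Real.norm_of_nonneg Real.pi_pos.le, Real.norm_eq_abs]

/-- `|s| ≤ 1 + 2π|w₀|`. [folklore] -/
theorem norm_sEx_le (w : E2) : ‖sEx w‖ ≤ 1 + 2 * π * |w.ofLp 0| := by
  unfold sEx
  rw [show (-1 : ℂ) - 2 * π * (w.ofLp 0) * Complex.I = -(1 + 2 * π * (w.ofLp 0) * Complex.I) by ring, norm_neg]
  refine (norm_add_le _ _).trans ?_
  rw [norm_one, norm_mul, norm_mul, norm_mul, Complex.norm_I, mul_one, Complex.norm_real, Complex.norm_real,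
    Real.norm_of_nonneg Real.pi_pos.le, Real.norm_eq_abs]
  norm_num

/-- **The `ℓ`-th separated sum at frequency `w`**:
`𝒮_ℓ(w) = ∑_{r,n,m,c} b_{nr} 𝓢 · (4π m^κ e(w₁m/M)) (n^κ e(−(w₀/2) log r)) ((c√r)⁻¹ φ_{τ_ℓ,s}(x_K))`. [folklore] -/
def Sl (C M R N' t : ℝ) (Nb : Finset ℕ) (a u : ℕ) (sgn : ℤ) (cM : ℕ) (b : ℕ → ℕ → ℂ) (ℓ : ℕ) (w : E2) : ℂ :=
  ∑ r ∈ dyadic R, ∑ n ∈ Nb, ∑ m ∈ Finset.Ioc a u, ∑ c ∈ (Finset.Icc 1 cM).filter (fun c => r.Coprime c),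
    b n r * kl c r n (sgn * m) *
      (((4 * π : ℂ) * (m : ℂ) ^ kap w * (𝐞 (w.ofLp 1 * ((m : ℝ) / M)) : ℂ)) *
        ((n : ℂ) ^ kap w * (𝐞 (-(w.ofLp 0 / 2) * Real.log r) : ℂ)) *
        (((((c : ℝ) * Real.sqrt r)⁻¹ : ℝ) : ℂ) * testFn ((9 / 5) ^ ℓ * Xa C R N' t) (sEx w) (xK m n r c)))

/-- The summand of the piece as a function of the frequency, before separation. [folklore] -/
def rawTerm (g₀ : ℝ × ℝ → ℝ) (hg : ContDiff ℝ ∞ g₀) (hc : HasCompactSupport g₀)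
    (hsupp : tsupport g₀ ⊆ Set.Icc (1 : ℝ) 2 ×ˢ Set.Ioi (0 : ℝ))
    (C M R N' t : ℝ) (sgn : ℤ) (b : ℕ → ℕ → ℂ) (r n m c ℓ : ℕ) (w : E2) : ℂ :=
  b n r * kl c r n (sgn * m) *
    (((𝐞 (w.ofLp 0 * Real.log ((c : ℝ) / C) + w.ofLp 1 * ((m : ℝ) / M)) : Circle) : ℂ) * FT hg hc hsupp w *
      ((pieceT ((9 / 5) ^ ℓ * Xa C R N' t) (xK m n r c) : ℝ) : ℂ))

/-- Each raw term is integrable in `w` (it is `ĥ(w)` times a bounded continuous function). [folklore] -/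
theorem integrable_rawTerm {g₀ : ℝ × ℝ → ℝ} (hg : ContDiff ℝ ∞ g₀) (hc : HasCompactSupport g₀)
    (hsupp : tsupport g₀ ⊆ Set.Icc (1 : ℝ) 2 ×ˢ Set.Ioi (0 : ℝ))
    (C M R N' t : ℝ) (sgn : ℤ) (b : ℕ → ℕ → ℂ) (r n m c ℓ : ℕ) :
    Integrable (rawTerm g₀ hg hc hsupp C M R N' t sgn b r n m c ℓ) := by
  unfold rawTerm
  have hcont : Continuous fun w : E2 =>
      (((𝐞 (w.ofLp 0 * Real.log ((c : ℝ) / C) + w.ofLp 1 * ((m : ℝ) / M)) : Circle) : ℂ)) := by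
    have : (fun w : E2 => (((𝐞 (w.ofLp 0 * Real.log ((c : ℝ) / C) + w.ofLp 1 * ((m : ℝ) / M)) : Circle) : ℂ))) =
        fun w : E2 => Complex.exp (((2 * π * (w.ofLp 0 * Real.log ((c : ℝ) / C) + w.ofLp 1 * ((m : ℝ) / M)) : ℝ) : ℂ) *
          Complex.I) := by
      funext w; exact Real.fourierChar_apply _
    rw [this]
    refine Complex.continuous_exp.comp ((Complex.continuous_ofReal.comp ?_).mul continuous_const)
    exact continuous_const.mul (((continuous_coord 0).mul continuous_const).add
      ((continuous_coord 1).mul continuous_const))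
  have hmeas : AEStronglyMeasurable (rawTerm g₀ hg hc hsupp C M R N' t sgn b r n m c ℓ) volume := by
    unfold rawTerm
    exact (continuous_const.mul ((hcont.mul (FT hg hc hsupp).continuous).mul continuous_const)).aestronglyMeasurable
  have hdom := (integrable_FT_mul_pow hg hc hsupp 0).const_mul (‖b n r * kl c r n (sgn * m)‖ * 1)
  refine hdom.mono' hmeas (Filter.Eventually.of_forall fun w => ?_)
  have hP : ‖pieceT ((9 / 5) ^ ℓ * Xa C R N' t) (xK m n r c)‖ ≤ 1 := by
    rw [Real.norm_eq_abs]; exact abs_pieceT_le_one _ _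
  simp only [norm_mul, Circle.norm_coe, one_mul, pow_zero, mul_one, Complex.norm_real]
  have h0 : 0 ≤ ‖b n r‖ * ‖kl c r n (sgn * m)‖ * ‖FT hg hc hsupp w‖ := by positivity
  calc ‖b n r‖ * ‖kl c r n (sgn * m)‖ * (‖FT hg hc hsupp w‖ * ‖pieceT ((9 / 5) ^ ℓ * Xa C R N' t) (xK m n r c)‖)
      = ‖b n r‖ * ‖kl c r n (sgn * m)‖ * ‖FT hg hc hsupp w‖ * ‖pieceT ((9 / 5) ^ ℓ * Xa C R N' t) (xK m n r c)‖ := by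
        ring
    _ ≤ ‖b n r‖ * ‖kl c r n (sgn * m)‖ * ‖FT hg hc hsupp w‖ * 1 := mul_le_mul_of_nonneg_left hP h0
    _ = ‖b n r‖ * ‖kl c r n (sgn * m)‖ * ‖FT hg hc hsupp w‖ := mul_one _


/-- The summand of `𝒮_ℓ(w)`. [folklore] -/
def slTerm (C M R N' t : ℝ) (sgn : ℤ) (b : ℕ → ℕ → ℂ) (r n m c ℓ : ℕ) (w : E2) : ℂ :=
  b n r * kl c r n (sgn * m) *
    (((4 * π : ℂ) * (m : ℂ) ^ kap w * (𝐞 (w.ofLp 1 * ((m : ℝ) / M)) : ℂ)) *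
      ((n : ℂ) ^ kap w * (𝐞 (-(w.ofLp 0 / 2) * Real.log r) : ℂ)) *
      (((((c : ℝ) * Real.sqrt r)⁻¹ : ℝ) : ℂ) * testFn ((9 / 5) ^ ℓ * Xa C R N' t) (sEx w) (xK m n r c)))

/-- `𝒮_ℓ` as the iterated sum of `slTerm`. [folklore] -/
theorem Sl_eq_sum (C M R N' t : ℝ) (Nb : Finset ℕ) (a u : ℕ) (sgn : ℤ) (cM : ℕ) (b : ℕ → ℕ → ℂ) (ℓ : ℕ) (w : E2) :
    Sl C M R N' t Nb a u sgn cM b ℓ w =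
      ∑ r ∈ dyadic R, ∑ n ∈ Nb, ∑ m ∈ Finset.Ioc a u, ∑ c ∈ (Finset.Icc 1 cM).filter (fun c => r.Coprime c),
        slTerm C M R N' t sgn b r n m c ℓ w := rfl

/-- **The raw term after separation**: `rawTerm = ĥ(w) e(w₀ log(4π/C)) · slTerm`. [folklore] -/
theorem rawTerm_eq {g₀ : ℝ × ℝ → ℝ} (hg : ContDiff ℝ ∞ g₀) (hc : HasCompactSupport g₀)
    (hsupp : tsupport g₀ ⊆ Set.Icc (1 : ℝ) 2 ×ˢ Set.Ioi (0 : ℝ))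
    {C : ℝ} (hC : 0 < C) (M R N' t : ℝ) (sgn : ℤ) (b : ℕ → ℕ → ℂ) {r n m c : ℕ}
    (hr : 0 < r) (hn : 0 < n) (hm : 0 < m) (hc0 : 0 < c) (ℓ : ℕ) (w : E2) :
    rawTerm g₀ hg hc hsupp C M R N' t sgn b r n m c ℓ w =
      FT hg hc hsupp w * (𝐞 (w.ofLp 0 * Real.log (4 * π / C)) : ℂ) * slTerm C M R N' t sgn b r n m c ℓ w := by
  unfold rawTerm slTerm kap sEx
  have h := separated_summand hm hn hr hc0 hC ((9 / 5) ^ ℓ * Xa C R N' t) (w.ofLp 0) (w.ofLp 1) (M := M)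
  calc b n r * kl c r n (sgn * m) *
        (((𝐞 (w.ofLp 0 * Real.log ((c : ℝ) / C) + w.ofLp 1 * ((m : ℝ) / M)) : Circle) : ℂ) * FT hg hc hsupp w *
          ((pieceT ((9 / 5) ^ ℓ * Xa C R N' t) (xK m n r c) : ℝ) : ℂ))
      = b n r * kl c r n (sgn * m) * FT hg hc hsupp w *
          ((((𝐞 (w.ofLp 0 * Real.log ((c : ℝ) / C) + w.ofLp 1 * ((m : ℝ) / M)) : Circle) : ℂ)) *
            ((pieceT ((9 / 5) ^ ℓ * Xa C R N' t) (xK m n r c) : ℝ) : ℂ)) := by ring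
    _ = _ := by rw [h]; ring



/-- **The piece as an integral over the frequencies** (separation of variables carried through the
finite sums): `pieceSum = ∫ ĥ(w) e(w₀ log(4π/C)) ∑_{ℓ<5} 𝒮_ℓ(w) dw`.
[cite: DeshouillersIwaniec1982, §9.1 (9.2) p. 279; §7 (separation of variables)] -/
theorem pieceSum_eq_integral {g₀ : ℝ × ℝ → ℝ} (hg : ContDiff ℝ ∞ g₀) (hc : HasCompactSupport g₀)
    (hsupp : tsupport g₀ ⊆ Set.Icc (1 : ℝ) 2 ×ˢ Set.Ioi (0 : ℝ)) {μ₁ μ₂ : ℝ}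
    (hys : ∀ x y : ℝ, g₀ (x, y) ≠ 0 → (1 ≤ x ∧ x ≤ 2) ∧ (μ₁ ≤ y ∧ y ≤ μ₂))
    {C M R N' t : ℝ} (hC : 0 < C) (hR : 0 < R) (hN' : 0 < N') (ht : 0 < t)
    {Nb : Finset ℕ} (hNb : ∀ n ∈ Nb, N' < n ∧ (n : ℝ) ≤ 2 * N') {a u : ℕ} (hta : t < a + 1) (hu : (u : ℝ) ≤ 2 * t)
    (sgn : ℤ) (cM : ℕ) (b : ℕ → ℕ → ℂ) :
    pieceSum g₀ C M R Nb a u sgn cM b =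
      ∫ w : E2, FT hg hc hsupp w * (𝐞 (w.ofLp 0 * Real.log (4 * π / C)) : ℂ) *
        ∑ ℓ ∈ Finset.range 5, Sl C M R N' t Nb a u sgn cM b ℓ w := by
  -- positivity of the indices
  have hrpos : ∀ r ∈ dyadic R, 0 < r ∧ R < r ∧ (r : ℝ) ≤ 2 * R := by
    intro r hr
    have h := (mem_dyadic hR.le).1 hr
    exact ⟨by exact_mod_cast hR.trans h.1, h.1, h.2⟩
  have hnpos : ∀ n ∈ Nb, 0 < n := fun n hn => by
    have := (hNb n hn).1; exact_mod_cast hN'.trans this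
  have hmpos : ∀ m ∈ Finset.Ioc a u, 0 < m ∧ t < m ∧ (m : ℝ) ≤ 2 * t := by
    intro m hm
    rw [Finset.mem_Ioc] at hm
    refine ⟨by omega, ?_, ?_⟩
    · have : (a : ℝ) + 1 ≤ m := by exact_mod_cast hm.1
      linarith
    · have : (m : ℝ) ≤ u := by exact_mod_cast hm.2
      linarith
  have hcpos : ∀ r : ℕ, ∀ c ∈ (Finset.Icc 1 cM).filter (fun c => r.Coprime c), 0 < c := by
    intro r c hc'
    exact (Finset.mem_Icc.1 (Finset.mem_filter.1 hc').1).1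
  -- Step 1: termwise
  have term : ∀ r ∈ dyadic R, ∀ n ∈ Nb, ∀ m ∈ Finset.Ioc a u, ∀ c ∈ (Finset.Icc 1 cM).filter (fun c => r.Coprime c),
      b n r * (((g₀ ((c : ℝ) / C, (m : ℝ) / M) : ℝ) : ℂ) * kl c r n (sgn * m)) =
        ∑ ℓ ∈ Finset.range 5, ∫ w : E2, rawTerm g₀ hg hc hsupp C M R N' t sgn b r n m c ℓ w := by
    intro r hr n hn m hm c hc'
    obtain ⟨hr0, hr1, hr2⟩ := hrpos r hr
    obtain ⟨hm0, hm1, hm2⟩ := hmpos m hm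
    obtain ⟨hn1, hn2⟩ := hNb n hn
    have hc0 := hcpos r c hc'
    have hx : 0 < (c : ℝ) / C := by positivity
    rw [g0_mul_sum_pieceT hys hC hR hN' ht hm1 hm2 hn1 hn2 hr1 hr2 (m := m) (n := n) (r := r) (c := c),
      Complex.ofReal_mul, dilation_eq_integral hg hc hsupp hx ((m : ℝ) / M)]
    push_cast
    rw [Finset.mul_sum, Finset.sum_mul, Finset.mul_sum]
    refine Finset.sum_congr rfl fun ℓ _ => ?_
    rw [← integral_mul_const, ← integral_mul_const, ← integral_const_mul]
    refine integral_congr_ae (Filter.Eventually.of_forall fun w => ?_)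
    simp only [rawTerm]
    try ring
  -- Step 2: the whole sum as an integral of the sum
  have hint : ∀ r ∈ dyadic R, ∀ n ∈ Nb, ∀ m ∈ Finset.Ioc a u, ∀ c ∈ (Finset.Icc 1 cM).filter (fun c => r.Coprime c),
      ∀ ℓ ∈ Finset.range 5, Integrable (rawTerm g₀ hg hc hsupp C M R N' t sgn b r n m c ℓ) :=
    fun r _ n _ m _ c _ ℓ _ => integrable_rawTerm hg hc hsupp C M R N' t sgn b r n m c ℓ
  unfold pieceSum
  simp only [Finset.mul_sum]
  rw [Finset.sum_congr rfl fun r hr => Finset.sum_congr rfl fun n hn => Finset.sum_congr rfl fun m hm =>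
    Finset.sum_congr rfl fun c hc' => term r hr n hn m hm c hc']
  -- now LHS = Σ_r Σ_n Σ_m Σ_c Σ_ℓ ∫ rawTerm
  have hI5 : ∀ r ∈ dyadic R, ∀ n ∈ Nb, ∀ m ∈ Finset.Ioc a u, ∀ c ∈ (Finset.Icc 1 cM).filter (fun c => r.Coprime c),
      Integrable (fun w => ∑ ℓ ∈ Finset.range 5, rawTerm g₀ hg hc hsupp C M R N' t sgn b r n m c ℓ w) :=
    fun r hr n hn m hm c hc' => integrable_finsetSum _ fun ℓ hℓ => hint r hr n hn m hm c hc' ℓ hℓ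
  have hI4 : ∀ r ∈ dyadic R, ∀ n ∈ Nb, ∀ m ∈ Finset.Ioc a u,
      Integrable (fun w => ∑ c ∈ (Finset.Icc 1 cM).filter (fun c => r.Coprime c),
        ∑ ℓ ∈ Finset.range 5, rawTerm g₀ hg hc hsupp C M R N' t sgn b r n m c ℓ w) :=
    fun r hr n hn m hm => integrable_finsetSum _ fun c hc' => hI5 r hr n hn m hm c hc'
  have hI3 : ∀ r ∈ dyadic R, ∀ n ∈ Nb,
      Integrable (fun w => ∑ m ∈ Finset.Ioc a u, ∑ c ∈ (Finset.Icc 1 cM).filter (fun c => r.Coprime c),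
        ∑ ℓ ∈ Finset.range 5, rawTerm g₀ hg hc hsupp C M R N' t sgn b r n m c ℓ w) :=
    fun r hr n hn => integrable_finsetSum _ fun m hm => hI4 r hr n hn m hm
  have hI2 : ∀ r ∈ dyadic R,
      Integrable (fun w => ∑ n ∈ Nb, ∑ m ∈ Finset.Ioc a u, ∑ c ∈ (Finset.Icc 1 cM).filter (fun c => r.Coprime c),
        ∑ ℓ ∈ Finset.range 5, rawTerm g₀ hg hc hsupp C M R N' t sgn b r n m c ℓ w) :=
    fun r hr => integrable_finsetSum _ fun n hn => hI3 r hr n hn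
  have step2 : ∑ r ∈ dyadic R, ∑ n ∈ Nb, ∑ m ∈ Finset.Ioc a u, ∑ c ∈ (Finset.Icc 1 cM).filter (fun c => r.Coprime c),
      ∑ ℓ ∈ Finset.range 5, ∫ w : E2, rawTerm g₀ hg hc hsupp C M R N' t sgn b r n m c ℓ w =
      ∫ w : E2, ∑ r ∈ dyadic R, ∑ n ∈ Nb, ∑ m ∈ Finset.Ioc a u, ∑ c ∈ (Finset.Icc 1 cM).filter (fun c => r.Coprime c),
        ∑ ℓ ∈ Finset.range 5, rawTerm g₀ hg hc hsupp C M R N' t sgn b r n m c ℓ w := by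
    rw [integral_finsetSum _ hI2]
    refine Finset.sum_congr rfl fun r hr => ?_
    rw [integral_finsetSum _ (hI3 r hr)]
    refine Finset.sum_congr rfl fun n hn => ?_
    rw [integral_finsetSum _ (hI4 r hr n hn)]
    refine Finset.sum_congr rfl fun m hm => ?_
    rw [integral_finsetSum _ (hI5 r hr n hn m hm)]
    refine Finset.sum_congr rfl fun c hc' => ?_
    rw [integral_finsetSum _ (hint r hr n hn m hm c hc')]
  rw [step2]
  -- Step 3: pointwise identification
  refine integral_congr_ae (Filter.Eventually.of_forall fun w => ?_)
  simp only [Sl_eq_sum, Finset.mul_sum]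
  -- a generic reindexing: `ℓ` innermost ↔ outermost
  have reindex : ∀ Z : ℕ → ℕ → ℕ → ℕ → ℕ → ℂ,
      ∑ ℓ ∈ Finset.range 5, ∑ r ∈ dyadic R, ∑ n ∈ Nb, ∑ m ∈ Finset.Ioc a u,
        ∑ c ∈ (Finset.Icc 1 cM).filter (fun c => r.Coprime c), Z ℓ r n m c =
      ∑ r ∈ dyadic R, ∑ n ∈ Nb, ∑ m ∈ Finset.Ioc a u,
        ∑ c ∈ (Finset.Icc 1 cM).filter (fun c => r.Coprime c), ∑ ℓ ∈ Finset.range 5, Z ℓ r n m c := by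
    intro Z
    rw [Finset.sum_comm]
    refine Finset.sum_congr rfl fun r _ => ?_
    rw [Finset.sum_comm]
    refine Finset.sum_congr rfl fun n _ => ?_
    rw [Finset.sum_comm]
    refine Finset.sum_congr rfl fun m _ => ?_
    rw [Finset.sum_comm]
  rw [reindex]
  refine Finset.sum_congr rfl fun r hr => Finset.sum_congr rfl fun n hn => Finset.sum_congr rfl fun m hm =>
    Finset.sum_congr rfl fun c hc' => Finset.sum_congr rfl fun ℓ _ => ?_
  exact rawTerm_eq hg hc hsupp hC M R N' t sgn b (hrpos r hr).1 (hnpos n hn) (hmpos m hm).1 (hcpos r c hc') ℓ w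



/-! ### The Abel step: `𝒮_ℓ(w)` from the Kuznetsov-shaped partial sums -/

/-- The coefficients `β_w(n, r) = b_{nr} n^κ e(−(w₀/2) log r)` on the block `Nb`, `0` elsewhere. [folklore] -/
def betaW (Nb : Finset ℕ) (b : ℕ → ℕ → ℂ) (w : E2) (n r : ℕ) : ℂ :=
  if n ∈ Nb then b n r * (n : ℂ) ^ kap w * (𝐞 (-(w.ofLp 0 / 2) * Real.log r) : ℂ) else 0

/-- `‖β_w(n,r)‖ ≤ √n ‖b_{nr}‖` on the block, `0` elsewhere. [folklore] -/
theorem norm_betaW_le (Nb : Finset ℕ) (b : ℕ → ℕ → ℂ) (w : E2) (n r : ℕ) :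
    ‖betaW Nb b w n r‖ ≤ (if n ∈ Nb then Real.sqrt n * ‖b n r‖ else 0) := by
  unfold betaW
  split_ifs with h
  · rcases Nat.eq_zero_or_pos n with h0 | hpos
    · subst h0
      have hk : kap w ≠ 0 := by
        intro h0; have := congrArg Complex.re h0; rw [kap_re] at this; norm_num at this
      simp [Complex.zero_cpow hk]
    · rw [norm_mul, norm_mul, Circle.norm_coe, mul_one, Complex.norm_natCast_cpow_of_pos hpos, kap_re,
        ← Real.sqrt_eq_rpow, mul_comm]
  · simp

/-- **Abel summation for `𝒮_ℓ(w)`**: if the Kuznetsov-shaped partial sums over `(a, k]`, `k ≤ u`, of the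
test function `φ_{τ_ℓ, s(w)}` with phase `θ = w₁/M` and coefficients `β_w` are bounded by `B`, then
`‖𝒮_ℓ(w)‖ ≤ (1 + 2|κ(w)|) √u · 4π B`. [folklore] -/
theorem norm_Sl_le {C M R N' t : ℝ} {Nb : Finset ℕ} (hNb : Nb ⊆ dyadic N') {a u : ℕ} (hau : a ≤ u)
    (sgn : ℤ) (cM : ℕ) (b : ℕ → ℕ → ℂ) (ℓ : ℕ) (w : E2) {B : ℝ}
    (hB : ∀ k : ℕ, a ≤ k → k ≤ u →
      ‖kuzSum (testFn ((9 / 5) ^ ℓ * Xa C R N' t) (sEx w)) (w.ofLp 1 / M) R N' a k sgn cM (betaW Nb b w)‖ ≤ B) :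
    ‖Sl C M R N' t Nb a u sgn cM b ℓ w‖ ≤ (1 + 2 * ‖kap w‖) * Real.sqrt u * (4 * π * B) := by
  set τ : ℝ := (9 / 5) ^ ℓ * Xa C R N' t with hτ
  set θ : ℝ := w.ofLp 1 / M with hθ
  -- `F(m)`: everything but `m^κ`
  set F : ℕ → ℂ := fun m => (4 * π : ℂ) * (𝐞 (θ * m) : ℂ) *
    ∑ r ∈ dyadic R, ∑ n ∈ Nb, ∑ c ∈ (Finset.Icc 1 cM).filter (fun c => r.Coprime c),
      b n r * kl c r n (sgn * m) * ((n : ℂ) ^ kap w * (𝐞 (-(w.ofLp 0 / 2) * Real.log r) : ℂ)) *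
        (((((c : ℝ) * Real.sqrt r)⁻¹ : ℝ) : ℂ) * testFn τ (sEx w) (xK m n r c)) with hF
  -- `𝒮_ℓ = ∑_m m^κ F(m)`
  have hSl : Sl C M R N' t Nb a u sgn cM b ℓ w = ∑ m ∈ Finset.Ioc a u, ((m : ℝ) : ℂ) ^ kap w * F m := by
    rw [Sl_eq_sum]
    -- bring `m` to the front
    rw [Finset.sum_congr rfl fun r _ => Finset.sum_comm, Finset.sum_comm]
    refine Finset.sum_congr rfl fun m _ => ?_
    simp only [hF, Finset.mul_sum]
    refine Finset.sum_congr rfl fun r _ => Finset.sum_congr rfl fun n _ => Finset.sum_congr rfl fun c _ => ?_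
    unfold slTerm
    have eθ : w.ofLp 1 * ((m : ℝ) / M) = θ * m := by rw [hθ]; ring
    rw [eθ, Complex.ofReal_natCast]
    ring
  -- the partial sums of `F` are `4π · kuzSum`
  have hpartial : ∀ k : ℕ, ∑ m ∈ Finset.Ioc a k, F m =
      (4 * π : ℂ) * kuzSum (testFn τ (sEx w)) θ R N' a k sgn cM (betaW Nb b w) := by
    intro k
    unfold kuzSum
    -- restrict the `n`-sum to `Nb`
    have hn : ∀ r : ℕ, ∑ n ∈ dyadic N', betaW Nb b w n r *
        ∑ m ∈ Finset.Ioc a k, (𝐞 (θ * m) : ℂ) *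
          ∑ c ∈ (Finset.Icc 1 cM).filter (fun c => r.Coprime c),
            ((((c : ℝ) * Real.sqrt r)⁻¹ : ℝ) : ℂ) * testFn τ (sEx w) (xK m n r c) * kl c r n (sgn * m) =
        ∑ n ∈ Nb, (b n r * (n : ℂ) ^ kap w * (𝐞 (-(w.ofLp 0 / 2) * Real.log r) : ℂ)) *
        ∑ m ∈ Finset.Ioc a k, (𝐞 (θ * m) : ℂ) *
          ∑ c ∈ (Finset.Icc 1 cM).filter (fun c => r.Coprime c),
            ((((c : ℝ) * Real.sqrt r)⁻¹ : ℝ) : ℂ) * testFn τ (sEx w) (xK m n r c) * kl c r n (sgn * m) := by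
      intro r
      rw [← Finset.sum_subset hNb]
      · refine Finset.sum_congr rfl fun n hn' => ?_
        rw [betaW, if_pos hn']
      · intro n _ hn'
        rw [betaW, if_neg hn', zero_mul]
    simp_rw [hn]
    rw [hF, Finset.mul_sum]
    simp only [Finset.mul_sum]
    -- both sides are sums over `m, r, n, c` (in different orders) of the same terms
    rw [Finset.sum_comm]
    refine Finset.sum_congr rfl fun r _ => ?_
    rw [Finset.sum_comm]
    refine Finset.sum_congr rfl fun n _ => Finset.sum_congr rfl fun m _ => Finset.sum_congr rfl fun c _ => ?_
    ring
  -- Abel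
  rw [hSl]
  refine abel_cpow_bound (kap_re w) F hau fun k hak hku => ?_
  rw [hpartial k, norm_mul]
  have h4 : ‖(4 * π : ℂ)‖ = 4 * π := by
    rw [show (4 * π : ℂ) = ((4 * π : ℝ) : ℂ) by push_cast; ring, Complex.norm_real, Real.norm_of_nonneg (by positivity)]
  rw [h4]
  exact mul_le_mul_of_nonneg_left (hB k hak hku) (by positivity)



/-! ### The core bound for one piece -/

/-- `‖β_w‖₂ ≤ √(2N') ‖b‖₂` on a block `Nb ⊆ (N', 2N']`. [folklore] -/
theorem norm_betaW_l2_le {N' : ℝ} (hN' : 0 ≤ N') {Nb : Finset ℕ} (hNb : Nb ⊆ dyadic N') (b : ℕ → ℕ → ℂ)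
    (w : E2) (R : ℝ) :
    Real.sqrt (∑ r ∈ dyadic R, ∑ n ∈ dyadic N', ‖betaW Nb b w n r‖ ^ 2) ≤
      Real.sqrt (2 * N') * Real.sqrt (∑ r ∈ dyadic R, ∑ n ∈ Nb, ‖b n r‖ ^ 2) := by
  rw [← Real.sqrt_mul (by positivity)]
  refine Real.sqrt_le_sqrt ?_
  rw [Finset.mul_sum]
  refine Finset.sum_le_sum fun r _ => ?_
  rw [Finset.mul_sum, ← Finset.sum_subset hNb (f := fun n => ‖betaW Nb b w n r‖ ^ 2)]
  · refine Finset.sum_le_sum fun n hn => ?_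
    have h := norm_betaW_le Nb b w n r
    rw [if_pos hn] at h
    have hn2 : (n : ℝ) ≤ 2 * N' := ((mem_dyadic hN').1 (hNb hn)).2
    have h0 : 0 ≤ ‖betaW Nb b w n r‖ := norm_nonneg _
    calc ‖betaW Nb b w n r‖ ^ 2 ≤ (Real.sqrt n * ‖b n r‖) ^ 2 := pow_le_pow_left₀ h0 h 2
      _ = (n : ℝ) * ‖b n r‖ ^ 2 := by rw [mul_pow, Real.sq_sqrt (Nat.cast_nonneg n)]
      _ ≤ 2 * N' * ‖b n r‖ ^ 2 := by gcongr
  · intro n _ hn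
    have h := norm_betaW_le Nb b w n r
    rw [if_neg hn] at h
    have : ‖betaW Nb b w n r‖ = 0 := le_antisymm h (norm_nonneg _)
    rw [this]; ring

/-- The absolute constant of the core bound: `4π · 2(1+π) · 2·20⁴ K₄ (5+2π)⁴`. [folklore] -/
def coreConst : ℝ := 4 * π * (2 * (1 + π)) * (2 * 20 ^ 4 * derivConst 4 * (5 + 2 * π) ^ 4)

/-- `c₀ > 0`. [folklore] -/
theorem coreConst_pos : 0 < coreConst := by
  unfold coreConst; have := one_le_derivConst 4; positivity

/-- `(1 + 2|κ(w)|) ≤ 2(1+π)(1+‖w‖)`. [folklore] -/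
theorem one_add_two_norm_kap_le (w : E2) : 1 + 2 * ‖kap w‖ ≤ 2 * (1 + π) * (1 + ‖w‖) := by
  have h := norm_kap_le w
  have hw := abs_coord_le_norm w 0
  nlinarith [Real.pi_pos, norm_nonneg w, abs_nonneg (w.ofLp 0)]

/-- `tfConst(s(w), X) ≤ 2·20⁴K₄(5+2π)⁴ (1+‖w‖)⁴ X⁻¹`. [folklore] -/
theorem tfConst_le (w : E2) {X : ℝ} (hX : 0 < X) :
    tfConst (sEx w) X ≤ 2 * 20 ^ 4 * derivConst 4 * (5 + 2 * π) ^ 4 * ((1 + ‖w‖) ^ 4 * X⁻¹) := by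
  unfold tfConst
  have hs := norm_sEx_le w
  have hw := abs_coord_le_norm w 0
  have hK : 0 ≤ derivConst 4 := le_trans zero_le_one (one_le_derivConst 4)
  have h1 : ‖sEx w‖ + 4 ≤ (5 + 2 * π) * (1 + ‖w‖) := by nlinarith [Real.pi_pos, norm_nonneg w]
  have h2 : (‖sEx w‖ + 4) ^ 4 ≤ ((5 + 2 * π) * (1 + ‖w‖)) ^ 4 :=
    pow_le_pow_left₀ (by linarith [norm_nonneg (sEx w)]) h1 4
  rw [Real.rpow_neg hX.le, Real.rpow_one]
  calc 2 * 20 ^ 4 * derivConst 4 * (‖sEx w‖ + 4) ^ 4 * X⁻¹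
      ≤ 2 * 20 ^ 4 * derivConst 4 * ((5 + 2 * π) * (1 + ‖w‖)) ^ 4 * X⁻¹ := by gcongr
    _ = _ := by ring

/-- **The core bound for one piece.** If the normalised test functions `ψ_{ℓ,w}` satisfy the
Kuznetsov-shaped bound (the hypothesis of Deshouillers–Iwaniec §9.1 / Drappeau Prop. 4.12, specialised
to this configuration), then
`‖pieceSum‖ ≤ (∫ |ĥ|(1+‖w‖)⁵) · c₀ · ∑_{ℓ<5} √u X_ℓ⁻¹ K ((X_ℓ+X_ℓ⁻¹)RtN')^{ε₁} (L_reg+L_exc)(X_ℓ,t,N',R) · √(2N') ‖b‖_{Nb}`,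
`X_ℓ = 0.95 (9/5)^ℓ X_a`. [cite: DeshouillersIwaniec1982, §9.1 (9.1)–(9.8) pp. 278–280] -/
theorem norm_pieceSum_le {g₀ : ℝ × ℝ → ℝ} (hg : ContDiff ℝ ∞ g₀) (hc : HasCompactSupport g₀)
    (hsupp : tsupport g₀ ⊆ Set.Icc (1 : ℝ) 2 ×ˢ Set.Ioi (0 : ℝ)) {μ₁ μ₂ : ℝ}
    (hys : ∀ x y : ℝ, g₀ (x, y) ≠ 0 → (1 ≤ x ∧ x ≤ 2) ∧ (μ₁ ≤ y ∧ y ≤ μ₂))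
    {C M R N' t : ℝ} (hC : 0 < C) (hR : 0 < R) (hN' : 0 < N') (ht : 0 < t)
    {Nb : Finset ℕ} (hNb : Nb ⊆ dyadic N') {a u : ℕ} (hta : t < a + 1) (hu : (u : ℝ) ≤ 2 * t) (hau : a ≤ u)
    (sgn : ℤ) (cM : ℕ) (b : ℕ → ℕ → ℂ) {ε₁ K : ℝ} (hK0 : 0 ≤ K)
    (h412s : ∀ ℓ ∈ Finset.range 5, ∀ w : E2, ∀ k : ℕ, a ≤ k → k ≤ u →
      ‖kuzSum (fun x => ((tfConst (sEx w) (19 / 20 * ((9 / 5) ^ ℓ * Xa C R N' t)))⁻¹ : ℂ) *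
          testFn ((9 / 5) ^ ℓ * Xa C R N' t) (sEx w) x) (w.ofLp 1 / M) R N' a k sgn cM (betaW Nb b w)‖ ≤
        K * (((19 / 20 * ((9 / 5) ^ ℓ * Xa C R N' t)) + (19 / 20 * ((9 / 5) ^ ℓ * Xa C R N' t))⁻¹) * R * t * N') ^ ε₁ *
          (Lreg (19 / 20 * ((9 / 5) ^ ℓ * Xa C R N' t)) t N' R + Lexc (19 / 20 * ((9 / 5) ^ ℓ * Xa C R N' t)) t N' R) *
          Real.sqrt (∑ r ∈ dyadic R, ∑ n ∈ dyadic N', ‖betaW Nb b w n r‖ ^ 2)) :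
    ‖pieceSum g₀ C M R Nb a u sgn cM b‖ ≤
      (∫ w : E2, ‖FT hg hc hsupp w‖ * (1 + ‖w‖) ^ 5) * coreConst *
        ∑ ℓ ∈ Finset.range 5, Real.sqrt u * (19 / 20 * ((9 / 5) ^ ℓ * Xa C R N' t))⁻¹ * K *
          (((19 / 20 * ((9 / 5) ^ ℓ * Xa C R N' t)) + (19 / 20 * ((9 / 5) ^ ℓ * Xa C R N' t))⁻¹) * R * t * N') ^ ε₁ *
          (Lreg (19 / 20 * ((9 / 5) ^ ℓ * Xa C R N' t)) t N' R + Lexc (19 / 20 * ((9 / 5) ^ ℓ * Xa C R N' t)) t N' R) *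
          (Real.sqrt (2 * N') * Real.sqrt (∑ r ∈ dyadic R, ∑ n ∈ Nb, ‖b n r‖ ^ 2)) := by
  have hNb' : ∀ n ∈ Nb, N' < n ∧ (n : ℝ) ≤ 2 * N' := fun n hn => (mem_dyadic hN'.le).1 (hNb hn)
  have hXa : 0 < Xa C R N' t := by unfold Xa; positivity
  -- abbreviations
  set nb' : ℝ := Real.sqrt (∑ r ∈ dyadic R, ∑ n ∈ Nb, ‖b n r‖ ^ 2) with hnb'
  have hnb'0 : 0 ≤ nb' := Real.sqrt_nonneg _
  set Q : ℕ → ℝ := fun ℓ => Real.sqrt u * (19 / 20 * ((9 / 5) ^ ℓ * Xa C R N' t))⁻¹ * K *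
    (((19 / 20 * ((9 / 5) ^ ℓ * Xa C R N' t)) + (19 / 20 * ((9 / 5) ^ ℓ * Xa C R N' t))⁻¹) * R * t * N') ^ ε₁ *
    (Lreg (19 / 20 * ((9 / 5) ^ ℓ * Xa C R N' t)) t N' R + Lexc (19 / 20 * ((9 / 5) ^ ℓ * Xa C R N' t)) t N' R) *
    (Real.sqrt (2 * N') * nb') with hQ
  have hX : ∀ ℓ : ℕ, 0 < 19 / 20 * ((9 / 5) ^ ℓ * Xa C R N' t) := fun ℓ => by positivity
  have hQ0 : ∀ ℓ, 0 ≤ Q ℓ := by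
    intro ℓ
    have h1 : 0 ≤ Lreg (19 / 20 * ((9 / 5) ^ ℓ * Xa C R N' t)) t N' R := Lreg_nonneg (hX ℓ).le
    have h2 : 0 ≤ Lexc (19 / 20 * ((9 / 5) ^ ℓ * Xa C R N' t)) t N' R := Lexc_nonneg (hX ℓ).le
    have h3 : 0 ≤ (((19 / 20 * ((9 / 5) ^ ℓ * Xa C R N' t)) + (19 / 20 * ((9 / 5) ^ ℓ * Xa C R N' t))⁻¹) * R * t * N') ^ ε₁ := by
      have := (hX ℓ).le; positivity
    simp only [hQ]
    have := (hX ℓ).le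
    positivity
  -- pointwise bound of `𝒮_ℓ(w)`
  have hSl : ∀ ℓ ∈ Finset.range 5, ∀ w : E2,
      ‖Sl C M R N' t Nb a u sgn cM b ℓ w‖ ≤ (1 + ‖w‖) ^ 5 * (coreConst * Q ℓ) := by
    intro ℓ hℓ w
    set X : ℝ := 19 / 20 * ((9 / 5) ^ ℓ * Xa C R N' t) with hXdef
    have hX0 : 0 < X := hX ℓ
    -- the bound `B` for the un-normalised partial sums
    set B : ℝ := tfConst (sEx w) X * (K * ((X + X⁻¹) * R * t * N') ^ ε₁ * (Lreg X t N' R + Lexc X t N' R) *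
      Real.sqrt (∑ r ∈ dyadic R, ∑ n ∈ dyadic N', ‖betaW Nb b w n r‖ ^ 2)) with hBdef
    have hB : ∀ k : ℕ, a ≤ k → k ≤ u →
        ‖kuzSum (testFn ((9 / 5) ^ ℓ * Xa C R N' t) (sEx w)) (w.ofLp 1 / M) R N' a k sgn cM (betaW Nb b w)‖ ≤ B := by
      intro k hak hku
      have h := h412s ℓ hℓ w k hak hku
      exact norm_kuzSum_testFn_le (by positivity) (sEx w) _ R N' a k sgn cM _ h
    have h1 := norm_Sl_le hNb hau sgn cM b ℓ w hB
    refine h1.trans ?_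
    -- estimate the `w`-dependent factors
    have hκ := one_add_two_norm_kap_le w
    have htf := tfConst_le w hX0
    have hβ := norm_betaW_l2_le hN'.le hNb b w R
    have hw1 : 1 ≤ 1 + ‖w‖ := by linarith [norm_nonneg w]
    have hu0 : 0 ≤ Real.sqrt u := Real.sqrt_nonneg _
    have hK4 : 0 ≤ derivConst 4 := le_trans zero_le_one (one_le_derivConst 4)
    have hfac0 : 0 ≤ K * ((X + X⁻¹) * R * t * N') ^ ε₁ * (Lreg X t N' R + Lexc X t N' R) := by
      have := Lreg_nonneg (M := t) (N := N') (R := R) hX0.le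
      have := Lexc_nonneg (M := t) (N := N') (R := R) hX0.le
      positivity
    have hBle : B ≤ 2 * 20 ^ 4 * derivConst 4 * (5 + 2 * π) ^ 4 * ((1 + ‖w‖) ^ 4 * X⁻¹) *
        (K * ((X + X⁻¹) * R * t * N') ^ ε₁ * (Lreg X t N' R + Lexc X t N' R) * (Real.sqrt (2 * N') * nb')) := by
      rw [hBdef]
      exact mul_le_mul htf (mul_le_mul_of_nonneg_left hβ hfac0) (by positivity) (by positivity)
    have hB0 : 0 ≤ B := by rw [hBdef]; have := (tfConst_pos (sEx w) hX0).le; positivity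
    calc (1 + 2 * ‖kap w‖) * Real.sqrt u * (4 * π * B)
        ≤ (2 * (1 + π) * (1 + ‖w‖)) * Real.sqrt u * (4 * π *
            (2 * 20 ^ 4 * derivConst 4 * (5 + 2 * π) ^ 4 * ((1 + ‖w‖) ^ 4 * X⁻¹) *
              (K * ((X + X⁻¹) * R * t * N') ^ ε₁ * (Lreg X t N' R + Lexc X t N' R) * (Real.sqrt (2 * N') * nb')))) := by
          gcongr
      _ = (1 + ‖w‖) ^ 5 * (coreConst * Q ℓ) := by
          simp only [hQ, coreConst, ← hXdef]
          ring
  -- integrate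
  rw [pieceSum_eq_integral hg hc hsupp hys hC hR hN' ht hNb' hta hu sgn cM b]
  have hI := integrable_FT_mul_pow hg hc hsupp 5
  set Qs : ℝ := coreConst * ∑ ℓ ∈ Finset.range 5, Q ℓ with hQs
  have hQs0 : 0 ≤ Qs := by rw [hQs]; exact mul_nonneg coreConst_pos.le (Finset.sum_nonneg fun ℓ _ => hQ0 ℓ)
  have hbound : ∀ w : E2, ‖FT hg hc hsupp w * (𝐞 (w.ofLp 0 * Real.log (4 * π / C)) : ℂ) *
      ∑ ℓ ∈ Finset.range 5, Sl C M R N' t Nb a u sgn cM b ℓ w‖ ≤ ‖FT hg hc hsupp w‖ * (1 + ‖w‖) ^ 5 * Qs := by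
    intro w
    rw [norm_mul, norm_mul, Circle.norm_coe, mul_one]
    have hsum : ‖∑ ℓ ∈ Finset.range 5, Sl C M R N' t Nb a u sgn cM b ℓ w‖ ≤ (1 + ‖w‖) ^ 5 * Qs := by
      refine (norm_sum_le _ _).trans ?_
      rw [hQs, Finset.mul_sum, Finset.mul_sum]
      exact Finset.sum_le_sum fun ℓ hℓ => hSl ℓ hℓ w
    calc ‖FT hg hc hsupp w‖ * ‖∑ ℓ ∈ Finset.range 5, Sl C M R N' t Nb a u sgn cM b ℓ w‖
        ≤ ‖FT hg hc hsupp w‖ * ((1 + ‖w‖) ^ 5 * Qs) := mul_le_mul_of_nonneg_left hsum (norm_nonneg _)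
      _ = ‖FT hg hc hsupp w‖ * (1 + ‖w‖) ^ 5 * Qs := by ring
  calc ‖∫ w : E2, FT hg hc hsupp w * (𝐞 (w.ofLp 0 * Real.log (4 * π / C)) : ℂ) *
        ∑ ℓ ∈ Finset.range 5, Sl C M R N' t Nb a u sgn cM b ℓ w‖
      ≤ ∫ w : E2, ‖FT hg hc hsupp w‖ * (1 + ‖w‖) ^ 5 * Qs :=
        norm_integral_le_of_norm_le (hI.mul_const Qs) (Filter.Eventually.of_forall hbound)
    _ = (∫ w : E2, ‖FT hg hc hsupp w‖ * (1 + ‖w‖) ^ 5) * Qs := integral_mul_const Qs _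
    _ = _ := by
        rw [hQs, ← mul_assoc, Finset.mul_sum]



/-! ### Enlarging the `c`-cutoff, and the hypothesis of §9.1 specialised to a configuration -/

/-- Terms with `c > 2C` vanish, so the `c`-cutoff of a piece may be raised freely above `⌊2C⌋`. [folklore] -/
theorem pieceSum_cM_eq {g₀ : ℝ × ℝ → ℝ} {μ₁ μ₂ : ℝ}
    (hys : ∀ x y : ℝ, g₀ (x, y) ≠ 0 → (1 ≤ x ∧ x ≤ 2) ∧ (μ₁ ≤ y ∧ y ≤ μ₂))
    {C : ℝ} (hC : 0 < C) (M R : ℝ) (Nb : Finset ℕ) (a u : ℕ) (sgn : ℤ) {cM : ℕ} (hcM : ⌊2 * C⌋₊ ≤ cM)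
    (b : ℕ → ℕ → ℂ) :
    pieceSum g₀ C M R Nb a u sgn cM b = pieceSum g₀ C M R Nb a u sgn ⌊2 * C⌋₊ b := by
  unfold pieceSum
  refine Finset.sum_congr rfl fun r _ => Finset.sum_congr rfl fun n _ => ?_
  congr 1
  refine Finset.sum_congr rfl fun m _ => ?_
  symm
  refine Finset.sum_subset (fun c hc => ?_) (fun c hc hc' => ?_)
  · rw [Finset.mem_filter, Finset.mem_Icc] at hc ⊢
    exact ⟨⟨hc.1.1, hc.1.2.trans hcM⟩, hc.2⟩
  · -- `c > ⌊2C⌋`, so `c/C > 2` and `g₀ = 0`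
    rw [Finset.mem_filter, Finset.mem_Icc] at hc hc'
    have hc2 : ⌊2 * C⌋₊ < c := by
      by_contra h; exact hc' ⟨⟨hc.1.1, not_lt.1 h⟩, hc.2⟩
    have hg : g₀ ((c : ℝ) / C, (m : ℝ) / M) = 0 := by
      by_contra hne
      have h := (hys _ _ hne).1.2
      rw [div_le_iff₀ hC] at h
      have : (c : ℝ) < ⌊2 * C⌋₊ + 1 := by
        have := Nat.lt_floor_add_one (2 * C); linarith
      have : c < ⌊2 * C⌋₊ + 1 := by exact_mod_cast this
      omega
    rw [hg, Complex.ofReal_zero, zero_mul]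

/-- **The hypothesis: Deshouillers–Iwaniec's bound (9.4) + (9.7) at `s = 1`** (= Drappeau, Prop. 4.12 with
`q = 1`, for the cusps `∞` and `0 ≅ 1/r` of `Γ₀(r)`, `a_m` the characteristic sequence of an interval
`(a, u] ⊆ (M, 2M]` twisted by `e(θm)`): for every `ε > 0` there is `K` such that for all `X > 0`, all
smooth test functions `φ` supported in `[X, 2X]` with `|φ^{(j)}| ≤ X^{-j}` (`j ≤ 4`), all
`M, N, R ≥ 1/2`, `θ ∈ ℝ`, `(β_{n,r})`, signs `±` and cutoffs `cM` beyond the support,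
`|kuzSum φ θ R N a u ± cM β| ≤ K ((X+X⁻¹)RMN)^ε (L_reg + L_exc) ‖β‖₂`; `H91At ε` is the
instance for one `ε`.  This is a CITED, as yet UNPROVED statement of the literature (a named
hypothesis of every `_of_H91` result below, used as `∀ ε > 0, H91At ε`; its proof is the automorphic
side: Kuznetsov's formula for `Γ₀(r)`, the spectral large sieve and the exceptional-spectrum
theorems of Deshouillers–Iwaniec).  The test functions are smooth (`C^∞`), exactly as printed.
(Deshouillers–Iwaniec prove this for general `(a_m)` with `L_reg ‖a‖₂` in place of `L_reg √M`, via the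
Kuznetsov formula for `Γ₀(r)` at the cusps `∞, 1/s`, the large-sieve inequalities of their Theorem 2 and
the exceptional-spectrum bounds of their Theorems 5–7; (9.7) is the refinement for characteristic
sequences of intervals.  The normalisations here: `S = 1/2 < s = 1 ≤ 2S`, and the cusp phase of
`S_{∞1}(m, ±n; rc)` is absorbed in `β`.)
RANGES: Deshouillers–Iwaniec work with arbitrary positive reals `C, M, N, R, S` (Theorems 10–11,
p. 236: "Let `C, M, N, R, S` be positive numbers", and §9.1 is the proof of these theorems); the
ranges `M, N, R ≥ 1/2`, `S = 1/2` taken here are a sub-range of theirs, while Drappeau prints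
Prop. 4.12 for `M, N, R, S ≥ 1` only (a sub-range of the present one).
TWIST: the additive character `e(θm)` on the `m`-variable is the freedom in the choice of the
scaling matrix `σ_∞` (replace `σ_∞` by `σ_∞ (1 θ; 0 1)`), under which the Kloosterman sums
`S_{∞𝔟}(m, n; γ)` pick up exactly the factor `e(θm)` — this is how Drappeau uses Prop. 4.12 in the
proof of Prop. 4.13 (there `σ_∞ = (1 ξ₁−t; 0 1)`); the `n`-side cusp phase is absorbed in `β`.
[cite: DeshouillersIwaniec1982, §9.1 (9.2)–(9.8) pp. 278–280, Theorems 10–11 p. 236;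
Drappeau2017, Prop. 4.12 and proof of Prop. 4.13] -/
def H91At (ε : ℝ) : Prop :=
  ∃ K : ℝ, ∀ X : ℝ, 0 < X → ∀ φ : ℝ → ℂ, ContDiff ℝ ∞ φ →
    (∀ x, φ x ≠ 0 → x ∈ Set.Icc X (2 * X)) → (∀ j ≤ 4, ∀ x, ‖iteratedDeriv j φ x‖ ≤ X ^ (-(j : ℝ))) →
    ∀ M N R : ℝ, 1 / 2 ≤ M → 1 / 2 ≤ N → 1 / 2 ≤ R → ∀ θ : ℝ, ∀ β : ℕ → ℕ → ℂ, ∀ a u : ℕ,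
      M < a + 1 → (u : ℝ) ≤ 2 * M → ∀ sgn : ℤ, (sgn = 1 ∨ sgn = -1) → ∀ cM : ℕ,
      8 * π * Real.sqrt (M * N) / (X * Real.sqrt R) ≤ cM →
        ‖kuzSum φ θ R N a u sgn cM β‖ ≤
          K * ((X + X⁻¹) * R * M * N) ^ ε * (Lreg X M N R + Lexc X M N R) *
            Real.sqrt (∑ r ∈ dyadic R, ∑ n ∈ dyadic N, ‖β n r‖ ^ 2)



/-- **X4. The hypothesis specialised to a configuration.** From `H91At ε₁` (constant `K`) we get the
hypothesis `h412s` of `norm_pieceSum_le` for every configuration with `t, N', R ≥ 1/2`, `± = ±1` and a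
`c`-cutoff `cM ≥ 8π√(tN')/(X₀√R)`, `X₀ = 0.95 X_a`. [folklore] -/
theorem h412s_of_H91 {ε₁ K : ℝ}
    (hK : ∀ X : ℝ, 0 < X → ∀ φ : ℝ → ℂ, ContDiff ℝ ∞ φ →
      (∀ x, φ x ≠ 0 → x ∈ Set.Icc X (2 * X)) → (∀ j ≤ 4, ∀ x, ‖iteratedDeriv j φ x‖ ≤ X ^ (-(j : ℝ))) →
      ∀ M N R : ℝ, 1 / 2 ≤ M → 1 / 2 ≤ N → 1 / 2 ≤ R → ∀ θ : ℝ, ∀ β : ℕ → ℕ → ℂ, ∀ a u : ℕ,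
        M < a + 1 → (u : ℝ) ≤ 2 * M → ∀ sgn : ℤ, (sgn = 1 ∨ sgn = -1) → ∀ cM : ℕ,
        8 * π * Real.sqrt (M * N) / (X * Real.sqrt R) ≤ cM →
          ‖kuzSum φ θ R N a u sgn cM β‖ ≤
            K * ((X + X⁻¹) * R * M * N) ^ ε₁ * (Lreg X M N R + Lexc X M N R) *
              Real.sqrt (∑ r ∈ dyadic R, ∑ n ∈ dyadic N, ‖β n r‖ ^ 2))
    {C M R N' t : ℝ} (hC : 0 < C) (hR : 1 / 2 ≤ R) (hN' : 1 / 2 ≤ N') (ht : 1 / 2 ≤ t)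
    (Nb : Finset ℕ) {a u : ℕ} (hta : t < a + 1) (hu : (u : ℝ) ≤ 2 * t)
    {sgn : ℤ} (hsgn : sgn = 1 ∨ sgn = -1) {cM : ℕ}
    (hcM : 8 * π * Real.sqrt (t * N') / ((19 / 20 * Xa C R N' t) * Real.sqrt R) ≤ cM) (b : ℕ → ℕ → ℂ) :
    ∀ ℓ ∈ Finset.range 5, ∀ w : E2, ∀ k : ℕ, a ≤ k → k ≤ u →
      ‖kuzSum (fun x => ((tfConst (sEx w) (19 / 20 * ((9 / 5) ^ ℓ * Xa C R N' t)))⁻¹ : ℂ) *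
          testFn ((9 / 5) ^ ℓ * Xa C R N' t) (sEx w) x) (w.ofLp 1 / M) R N' a k sgn cM (betaW Nb b w)‖ ≤
        K * (((19 / 20 * ((9 / 5) ^ ℓ * Xa C R N' t)) + (19 / 20 * ((9 / 5) ^ ℓ * Xa C R N' t))⁻¹) * R * t * N') ^ ε₁ *
          (Lreg (19 / 20 * ((9 / 5) ^ ℓ * Xa C R N' t)) t N' R + Lexc (19 / 20 * ((9 / 5) ^ ℓ * Xa C R N' t)) t N' R) *
          Real.sqrt (∑ r ∈ dyadic R, ∑ n ∈ dyadic N', ‖betaW Nb b w n r‖ ^ 2) := by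
  intro ℓ _ w k hak hku
  have hR0 : 0 < R := by linarith
  have hN0 : 0 < N' := by linarith
  have ht0 : 0 < t := by linarith
  have hXa : 0 < Xa C R N' t := by unfold Xa; positivity
  set τ : ℝ := (9 / 5) ^ ℓ * Xa C R N' t with hτ
  have hτ0 : 0 < τ := by positivity
  obtain ⟨hcd, hsup, hder⟩ := testFn_normalised_admissible hτ0 (sEx_re w)
  have hku' : (k : ℝ) ≤ 2 * t := le_trans (by exact_mod_cast hku) hu
  refine hK (19 / 20 * τ) (by positivity) _ hcd hsup hder t N' R ht hN' hR (w.ofLp 1 / M) (betaW Nb b w) a k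
    hta hku' sgn hsgn cM (le_trans ?_ hcM)
  -- the cutoff condition is monotone in `X`, and `X_ℓ ≥ X₀`
  have h1 : 19 / 20 * Xa C R N' t ≤ 19 / 20 * τ := by
    rw [hτ]
    have : (1 : ℝ) ≤ (9 / 5) ^ ℓ := one_le_pow₀ (by norm_num)
    nlinarith
  have hpos : 0 < 19 / 20 * Xa C R N' t * Real.sqrt R := by
    have := Real.sqrt_pos.2 hR0; positivity
  exact div_le_div_of_nonneg_left (by positivity) hpos (by gcongr)



/-! ### X5. From `L_reg + L_exc` at `X_ℓ` to `K_reg`, `K_exc` -/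

/-- `κ_ℓ = 0.95 (9/5)^ℓ √2 π`, so that `X_ℓ = κ_ℓ √(tN')/(C√R)`. [folklore] -/
def kapL (ℓ : ℕ) : ℝ := 19 / 20 * (9 / 5) ^ ℓ * (Real.sqrt 2 * π)

/-- `κ_ℓ > 0`. [folklore] -/
theorem kapL_pos (ℓ : ℕ) : 0 < kapL ℓ := by unfold kapL; positivity

/-- `X_ℓ = κ_ℓ √(tN')/(C√R)`. [folklore] -/
theorem Xl_eq {C R N' t : ℝ} (hC : 0 < C) (hR : 0 < R) (ℓ : ℕ) :
    19 / 20 * ((9 / 5) ^ ℓ * Xa C R N' t) = kapL ℓ * Real.sqrt (t * N') / (C * Real.sqrt R) := by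
  unfold Xa kapL
  have hs2 : Real.sqrt (2 * R) = Real.sqrt 2 * Real.sqrt R := Real.sqrt_mul (by norm_num) R
  have h2 : Real.sqrt 2 ≠ 0 := by positivity
  have hR' : Real.sqrt R ≠ 0 := (Real.sqrt_pos.2 hR).ne'
  have hs2sq : Real.sqrt 2 ^ 2 = 2 := Real.sq_sqrt (by norm_num)
  rw [hs2]
  field_simp
  rw [hs2sq]
  ring

/-- The conversion constant `A_reg(κ_ℓ) + A_exc(κ_ℓ)`. [folklore] -/
def convConst (ℓ : ℕ) : ℝ :=
  3 * max (Real.sqrt 2) (kapL ℓ) ^ 2 / (Real.sqrt 2 * kapL ℓ * min 1 (kapL ℓ)) + 2 / (kapL ℓ * Real.sqrt (kapL ℓ))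

/-- `A_ℓ ≥ 0`. [folklore] -/
theorem convConst_nonneg (ℓ : ℕ) : 0 ≤ convConst ℓ := by
  unfold convConst
  have := kapL_pos ℓ
  have : 0 < min 1 (kapL ℓ) := lt_min zero_lt_one this
  positivity

/-- **X5.** `√(tN') X_ℓ⁻¹ (L_reg + L_exc)(X_ℓ, t, N', R) ≤ A_ℓ (√K_reg² + √K_exc²)(C, t, N', R) √t`.
[cite: Drappeau2017, §4.3.2, end of the proof of Prop. 4.13; DeshouillersIwaniec1982, §9.1 (9.4)–(9.8) pp. 279–280] -/
theorem conv_piece {C R N' t : ℝ} (hC : 0 < C) (hR : 0 < R) (hN' : 0 < N') (ht : 0 < t) (ℓ : ℕ) :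
    Real.sqrt (t * N') * (19 / 20 * ((9 / 5) ^ ℓ * Xa C R N' t))⁻¹ *
        (Lreg (19 / 20 * ((9 / 5) ^ ℓ * Xa C R N' t)) t N' R + Lexc (19 / 20 * ((9 / 5) ^ ℓ * Xa C R N' t)) t N' R) ≤
      convConst ℓ * (Real.sqrt (KregSq C t N' R) + Real.sqrt (KexcSq C N' R)) * Real.sqrt t := by
  rw [Xl_eq hC hR ℓ, mul_add]
  have h1 := reg_conversion hC ht hN' hR (kapL_pos ℓ)
  have h2 := exc_conversion hC ht hN' hR (kapL_pos ℓ)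
  have hA1 : 0 ≤ 3 * max (Real.sqrt 2) (kapL ℓ) ^ 2 / (Real.sqrt 2 * kapL ℓ * min 1 (kapL ℓ)) := by
    have := kapL_pos ℓ; have : 0 < min 1 (kapL ℓ) := lt_min zero_lt_one this; positivity
  have hA2 : 0 ≤ 2 / (kapL ℓ * Real.sqrt (kapL ℓ)) := by have := kapL_pos ℓ; positivity
  have hk1 : 0 ≤ Real.sqrt (KregSq C t N' R) := Real.sqrt_nonneg _
  have hk2 : 0 ≤ Real.sqrt (KexcSq C N' R) := Real.sqrt_nonneg _
  have ht' : 0 ≤ Real.sqrt t := Real.sqrt_nonneg _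
  refine (add_le_add h1 h2).trans ?_
  unfold convConst
  nlinarith [mul_nonneg (mul_nonneg hA1 hk2) ht', mul_nonneg (mul_nonneg hA2 hk1) ht']

/-- **X5'.** `(√K_reg² + √K_exc²)(C, t, N', R) ≤ (√32 λ + 3) √(diL²(C, M, N, R))` for `t ≤ λM`, `N' ≤ N`.
[folklore] -/
theorem Ksum_le_diL {C M N R t N' lam : ℝ} (hC : 0 < C) (hR : 0 < R) (hM : 0 < M) (hN : 0 < N)
    (ht : 0 ≤ t) (htl : t ≤ lam * M) (hN'0 : 0 ≤ N') (hN' : N' ≤ N) (hlam : 1 ≤ lam) :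
    Real.sqrt (KregSq C t N' R) + Real.sqrt (KexcSq C N' R) ≤
      (Real.sqrt 32 * lam + 3) * Real.sqrt (diLSq C M N R) := by
  have h1 := KregSq_le_diLSq hC hR hM hN ht htl hN'0 hN' hlam
  have h2 := KexcSq_le_diLSq (M := M) hC hR hM.le hN.le hN'
  have hd : 0 ≤ diLSq C M N R := by unfold diLSq; positivity
  have e1 : Real.sqrt (32 * lam ^ 2 * diLSq C M N R) = Real.sqrt 32 * lam * Real.sqrt (diLSq C M N R) := by
    rw [Real.sqrt_mul (by positivity), Real.sqrt_mul (by norm_num), Real.sqrt_sq (by linarith)]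
  have e2 : Real.sqrt (4 * Real.sqrt 2 * diLSq C M N R) ≤ 3 * Real.sqrt (diLSq C M N R) := by
    rw [Real.sqrt_mul (by positivity)]
    refine mul_le_mul_of_nonneg_right ?_ (Real.sqrt_nonneg _)
    rw [Real.sqrt_le_left (by norm_num)]
    have : Real.sqrt 2 ≤ 2 := by rw [Real.sqrt_le_left (by norm_num)]; norm_num
    linarith
  calc Real.sqrt (KregSq C t N' R) + Real.sqrt (KexcSq C N' R)
      ≤ Real.sqrt (32 * lam ^ 2 * diLSq C M N R) + Real.sqrt (4 * Real.sqrt 2 * diLSq C M N R) :=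
        add_le_add (Real.sqrt_le_sqrt h1) (Real.sqrt_le_sqrt h2)
    _ ≤ Real.sqrt 32 * lam * Real.sqrt (diLSq C M N R) + 3 * Real.sqrt (diLSq C M N R) := by rw [e1]; linarith
    _ = _ := by ring



/-! ### X6. Decomposition of `𝒯` into pieces -/

/-- The block `[2^j, min(N₀, 2^{j+1} − 1)]` lies in the dyadic range `(N', 2N']`, `N' = 2^j − 1/2`. [folklore] -/
theorem block_subset_dyadic (N₀ j : ℕ) : block N₀ j ⊆ dyadic ((2 : ℝ) ^ j - 1 / 2) := by
  intro n hn
  rw [mem_block] at hn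
  have hN' : (0 : ℝ) ≤ (2 : ℝ) ^ j - 1 / 2 := by
    have : (1 : ℝ) ≤ (2 : ℝ) ^ j := one_le_pow₀ (by norm_num); linarith
  rw [mem_dyadic hN']
  have h1 : ((2 : ℕ) ^ j : ℝ) ≤ n := by exact_mod_cast hn.1
  have h2 : (n : ℝ) + 1 ≤ (2 : ℕ) ^ (j + 1) := by exact_mod_cast hn.2.2
  push_cast at h1 h2
  constructor
  · linarith
  · rw [pow_succ] at h2; linarith

/-- Sums over a chain of consecutive intervals `(T i, T (i+1)]`. [folklore] -/
theorem sum_Ioc_chain {A : Type*} [AddCommMonoid A] (f : ℕ → A) {T : ℕ → ℕ} (hT : Monotone T) (n : ℕ) :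
    ∑ i ∈ Finset.range n, ∑ m ∈ Finset.Ioc (T i) (T (i + 1)), f m = ∑ m ∈ Finset.Ioc (T 0) (T n), f m := by
  induction n with
  | zero => simp
  | succ n ih =>
    rw [Finset.sum_range_succ, ih]
    exact Finset.sum_Ioc_consecutive f (hT (Nat.zero_le n)) (hT (Nat.le_succ n))

/-- **Decomposition of an `m`-sum along thresholds**: if `G(m) ≠ 0` only for `T 0 < m ≤ T n`, then
`∑_{m₁≤m≤m₂} G(m) = ∑_{i<n} ∑_{m ∈ (max(T i, m₁−1), min(T(i+1), m₂)]} G(m)` (`m₁ ≥ 1`). [folklore] -/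
theorem sum_Icc_eq_sum_pieces {A : Type*} [AddCommMonoid A] (G : ℕ → A) {T : ℕ → ℕ} (hT : Monotone T)
    (n : ℕ) {m₁ m₂ : ℕ} (hm₁ : 1 ≤ m₁) (hG : ∀ m ∈ Finset.Icc m₁ m₂, G m ≠ 0 → T 0 < m ∧ m ≤ T n) :
    ∑ m ∈ Finset.Icc m₁ m₂, G m =
      ∑ i ∈ Finset.range n, ∑ m ∈ Finset.Ioc (max (T i) (m₁ - 1)) (min (T (i + 1)) m₂), G m := by
  -- both sides equal `∑_{m ∈ (T 0, T n]} [m₁ ≤ m ≤ m₂] G m`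
  set G' : ℕ → A := fun m => if m ∈ Finset.Icc m₁ m₂ then G m else 0 with hG'
  have hpiece : ∀ i : ℕ, ∑ m ∈ Finset.Ioc (max (T i) (m₁ - 1)) (min (T (i + 1)) m₂), G m =
      ∑ m ∈ Finset.Ioc (T i) (T (i + 1)), G' m := by
    intro i
    rw [hG', ← Finset.sum_filter]
    refine Finset.sum_congr ?_ fun _ _ => rfl
    ext m
    simp only [Finset.mem_Ioc, Finset.mem_filter, Finset.mem_Icc]
    omega
  simp_rw [hpiece]
  rw [sum_Ioc_chain G' hT n, hG', Finset.sum_ite, Finset.sum_const_zero, add_zero]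
  have hset : (Finset.Ioc (T 0) (T n)).filter (fun m => m ∈ Finset.Icc m₁ m₂) =
      (Finset.Icc m₁ m₂).filter (fun m => m ∈ Finset.Ioc (T 0) (T n)) := by
    ext m; simp only [Finset.mem_filter]; tauto
  rw [hset, Finset.sum_filter_of_ne]
  intro m hm hne
  exact Finset.mem_Ioc.2 (hG m hm hne)



/-- The thresholds `T_i = ⌊2^i t₀⌋` of the `m`-pieces. [folklore] -/
def Tthr (t₀ : ℝ) (i : ℕ) : ℕ := ⌊(2 : ℝ) ^ i * t₀⌋₊

/-- `T_i` is monotone in `i`. [folklore] -/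
theorem Tthr_mono {t₀ : ℝ} (ht₀ : 0 ≤ t₀) : Monotone (Tthr t₀) := by
  intro i j hij
  unfold Tthr
  exact Nat.floor_le_floor (mul_le_mul_of_nonneg_right (pow_le_pow_right₀ (by norm_num) hij) ht₀)

/-- **`𝒯` is the sum of its pieces**: `n` in dyadic blocks, `m` in the pieces cut at `T_i = ⌊2^i t₀⌋`,
`t₀ = μ₁M/2`, `i < n_P` with `2^{n_P} t₀ ≥ μ₂ M`. [folklore] -/
theorem diSum_eq_sum_pieces {g₀ : ℝ × ℝ → ℝ} {μ₁ μ₂ : ℝ} (hμ₁ : 0 < μ₁)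
    (hys : ∀ x y : ℝ, g₀ (x, y) ≠ 0 → (1 ≤ x ∧ x ≤ 2) ∧ (μ₁ ≤ y ∧ y ≤ μ₂))
    (C : ℝ) {M : ℝ} (hM : 0 < M) (N₀ : ℕ) (R : ℝ) {m₁ m₂ : ℕ} (hm₁ : 1 ≤ m₁) (sgn : ℤ) (b : ℕ → ℕ → ℂ)
    {nP : ℕ} (hnP : μ₂ * M ≤ (2 : ℝ) ^ nP * (μ₁ * M / 2)) :
    diSum g₀ C M N₀ R m₁ m₂ sgn b =
      ∑ j ∈ Finset.range (Nat.log 2 N₀ + 1), ∑ i ∈ Finset.range nP,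
        pieceSum g₀ C M R (block N₀ j) (max (Tthr (μ₁ * M / 2) i) (m₁ - 1)) (min (Tthr (μ₁ * M / 2) (i + 1)) m₂)
          sgn ⌊2 * C⌋₊ b := by
  set t₀ : ℝ := μ₁ * M / 2 with ht₀
  have ht₀0 : 0 < t₀ := by positivity
  -- the `m`-decomposition for fixed `r, n`
  have hm : ∀ r n : ℕ, ∑ m ∈ Finset.Icc m₁ m₂, ∑ c ∈ (Finset.Icc 1 ⌊2 * C⌋₊).filter (fun c => r.Coprime c),
      ((g₀ ((c : ℝ) / C, (m : ℝ) / M) : ℝ) : ℂ) * kl c r n (sgn * m) =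
      ∑ i ∈ Finset.range nP, ∑ m ∈ Finset.Ioc (max (Tthr t₀ i) (m₁ - 1)) (min (Tthr t₀ (i + 1)) m₂),
        ∑ c ∈ (Finset.Icc 1 ⌊2 * C⌋₊).filter (fun c => r.Coprime c),
          ((g₀ ((c : ℝ) / C, (m : ℝ) / M) : ℝ) : ℂ) * kl c r n (sgn * m) := by
    intro r n
    refine sum_Icc_eq_sum_pieces _ (Tthr_mono ht₀0.le) nP hm₁ fun m _ hne => ?_
    -- some `c` has `g₀(c/C, m/M) ≠ 0`, so `μ₁ ≤ m/M ≤ μ₂`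
    obtain ⟨c, _, hc⟩ := Finset.exists_ne_zero_of_sum_ne_zero hne
    have hg : g₀ ((c : ℝ) / C, (m : ℝ) / M) ≠ 0 := by
      intro h0; exact hc (by rw [h0, Complex.ofReal_zero, zero_mul])
    obtain ⟨-, hy1, hy2⟩ := hys _ _ hg
    rw [le_div_iff₀ hM] at hy1
    rw [div_le_iff₀ hM] at hy2
    constructor
    · -- `T 0 = ⌊t₀⌋ ≤ t₀ < μ₁ M ≤ m`
      unfold Tthr
      have h1 : (⌊(2 : ℝ) ^ 0 * t₀⌋₊ : ℝ) ≤ t₀ := by rw [pow_zero, one_mul]; exact Nat.floor_le ht₀0.le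
      have h2 : t₀ < m := by rw [ht₀]; nlinarith
      exact_mod_cast h1.trans_lt h2
    · -- `m ≤ μ₂ M ≤ 2^{nP} t₀`
      unfold Tthr
      exact Nat.le_floor (hy2.trans hnP)
  unfold diSum pieceSum
  -- `n`-blocks, then swap
  rw [Finset.sum_congr rfl fun r _ => sum_Icc_eq_sum_block N₀ _, Finset.sum_comm]
  refine Finset.sum_congr rfl fun j _ => ?_
  rw [Finset.sum_congr rfl fun r _ => Finset.sum_congr rfl fun n _ => by rw [hm r n, Finset.mul_sum]]
  rw [Finset.sum_congr rfl fun r _ => Finset.sum_comm, Finset.sum_comm]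



/-! ### Small lemmas for the final assembly -/

/-- An empty `m`-range gives a vanishing piece. [folklore] -/
theorem pieceSum_eq_zero_of_le (g₀ : ℝ × ℝ → ℝ) (C M R : ℝ) (Nb : Finset ℕ) {a u : ℕ} (h : u ≤ a)
    (sgn : ℤ) (cM : ℕ) (b : ℕ → ℕ → ℂ) : pieceSum g₀ C M R Nb a u sgn cM b = 0 := by
  unfold pieceSum
  refine Finset.sum_eq_zero fun r _ => Finset.sum_eq_zero fun n _ => ?_
  rw [Finset.Ioc_eq_empty (by omega), Finset.sum_empty, mul_zero]

/-- The block norm is at most the full norm. [folklore] -/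
theorem blockNorm_le (b : ℕ → ℕ → ℂ) (R : ℝ) (N₀ j : ℕ) :
    Real.sqrt (∑ r ∈ dyadic R, ∑ n ∈ block N₀ j, ‖b n r‖ ^ 2) ≤
      Real.sqrt (∑ r ∈ dyadic R, ∑ n ∈ Finset.Icc 1 N₀, ‖b n r‖ ^ 2) := by
  refine Real.sqrt_le_sqrt (Finset.sum_le_sum fun r _ => ?_)
  refine Finset.sum_le_sum_of_subset_of_nonneg (fun n hn => ?_) fun _ _ _ => sq_nonneg _
  rw [mem_block] at hn
  rw [Finset.mem_Icc]
  exact ⟨le_trans (Nat.one_le_two_pow) hn.1, hn.2.1⟩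

/-- `kapL` is monotone. [folklore] -/
theorem kapL_mono {ℓ ℓ' : ℕ} (h : ℓ ≤ ℓ') : kapL ℓ ≤ kapL ℓ' := by
  unfold kapL
  have : (9 / 5 : ℝ) ^ ℓ ≤ (9 / 5) ^ ℓ' := pow_le_pow_right₀ (by norm_num) h
  have hp : 0 < Real.sqrt 2 * π := by positivity
  nlinarith

/-- The constant `c_E(λ, μ₂)` with `(X_ℓ + X_ℓ⁻¹) R t N' ≤ c_E (CMNR)²`. [folklore] -/
def cE (lam μ₂ : ℝ) : ℝ :=
  32 * kapL 4 * (lam * Real.sqrt lam) * Real.sqrt μ₂ + 3 * μ₂ * Real.sqrt lam * Real.sqrt μ₂ / kapL 0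

/-- `c_E ≥ 0`. [folklore] -/
theorem cE_nonneg {lam μ₂ : ℝ} (hl : 0 ≤ lam) (hμ : 0 ≤ μ₂) : 0 ≤ cE lam μ₂ := by
  unfold cE; have := kapL_pos 4; have := kapL_pos 0; positivity

set_option maxHeartbeats 800000 in
/-- **The `ε`-factor base**: `(X_ℓ + X_ℓ⁻¹) R t N' ≤ c_E (CMNR)²` for `C, R ≥ 1/2`, `μ₂ MN ≥ 1`,
`tN' ≤ λMN`, `ℓ ≤ 4`. [folklore] -/
theorem E_le {C M N R t N' lam μ₂ : ℝ} (hC : 1 / 2 ≤ C) (hR : 1 / 2 ≤ R) (hM : 0 < M) (hN : 0 < N)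
    (hμ₂ : 0 < μ₂) (hMN : 1 ≤ μ₂ * (M * N)) (ht : 0 < t) (hN' : 0 < N') (hlam : 1 ≤ lam)
    (htN : t * N' ≤ lam * (M * N)) {ℓ : ℕ} (hℓ : ℓ ≤ 4) :
    ((kapL ℓ * Real.sqrt (t * N') / (C * Real.sqrt R)) + (kapL ℓ * Real.sqrt (t * N') / (C * Real.sqrt R))⁻¹) *
        R * t * N' ≤ cE lam μ₂ * (C * M * N * R) ^ 2 := by
  have hC0 : 0 < C := by linarith
  have hR0 : 0 < R := by linarith
  set q : ℝ := Real.sqrt (t * N') with hq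
  set sR : ℝ := Real.sqrt R with hsR
  have hq0 : 0 < q := Real.sqrt_pos.2 (by positivity)
  have hsR0 : 0 < sR := Real.sqrt_pos.2 hR0
  have hq2 : q ^ 2 = t * N' := Real.sq_sqrt (by positivity)
  have hsR2 : sR ^ 2 = R := Real.sq_sqrt hR0.le
  have hk0 := kapL_pos 0
  have hkℓ := kapL_pos ℓ
  have hk4 : kapL ℓ ≤ kapL 4 := kapL_mono hℓ
  have hkℓ0 : kapL 0 ≤ kapL ℓ := kapL_mono (Nat.zero_le ℓ)
  -- `√(MN) ≤ √μ₂ · MN`, `q ≤ √λ √μ₂ MN`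
  have hMN0 : 0 < M * N := by positivity
  have hsMN : Real.sqrt (M * N) ≤ Real.sqrt μ₂ * (M * N) := by
    rw [Real.sqrt_le_left (by positivity), mul_pow, Real.sq_sqrt hμ₂.le]
    nlinarith
  have hql : q ≤ Real.sqrt lam * Real.sqrt μ₂ * (M * N) := by
    have : q ≤ Real.sqrt lam * Real.sqrt (M * N) := by
      rw [hq, ← Real.sqrt_mul (by linarith)]
      exact Real.sqrt_le_sqrt htN
    refine this.trans ?_
    rw [mul_assoc]
    exact mul_le_mul_of_nonneg_left hsMN (Real.sqrt_nonneg _)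
  have hsl1 : 1 ≤ Real.sqrt lam := by
    rw [show (1:ℝ) = Real.sqrt 1 from Real.sqrt_one.symm]; exact Real.sqrt_le_sqrt hlam
  have hsR1 : 1 ≤ Real.sqrt 2 * sR := by
    rw [hsR, ← Real.sqrt_mul (by norm_num), show (1:ℝ) = Real.sqrt 1 from Real.sqrt_one.symm]
    exact Real.sqrt_le_sqrt (by linarith)
  have hs2 : Real.sqrt 2 ≤ 3 / 2 := by rw [Real.sqrt_le_left (by norm_num)]; norm_num
  -- the two terms
  have hX : kapL ℓ * q / (C * sR) * R * t * N' = kapL ℓ * q ^ 3 * sR / C := by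
    have e : kapL ℓ * q / (C * sR) * R * t * N' = kapL ℓ * q / (C * sR) * sR ^ 2 * q ^ 2 := by
      rw [hq2, hsR2]; ring
    rw [e]; field_simp
  have hXi : (kapL ℓ * q / (C * sR))⁻¹ * R * t * N' = C * sR ^ 3 * q / kapL ℓ := by
    have e : (kapL ℓ * q / (C * sR))⁻¹ * R * t * N' = (kapL ℓ * q / (C * sR))⁻¹ * sR ^ 2 * q ^ 2 := by
      rw [hq2, hsR2]; ring
    rw [e]; field_simp
  have hP : (C * M * N * R) ^ 2 = C ^ 2 * (M * N) ^ 2 * sR ^ 4 := by rw [← hsR2]; ring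
  rw [add_mul, add_mul, add_mul, hX, hXi, hP]
  unfold cE
  rw [add_mul]
  refine add_le_add ?_ ?_
  · -- `kapL ℓ q³ sR / C ≤ 32 kapL 4 λ√λ √μ₂ · C² (MN)² sR⁴ · C`
    rw [div_le_iff₀ hC0]
    have hq3 : q ^ 3 ≤ lam * Real.sqrt lam * Real.sqrt μ₂ * (M * N) ^ 2 := by
      have : q * q ≤ lam * (M * N) := by nlinarith
      calc q ^ 3 = q * (q * q) := by ring
        _ ≤ Real.sqrt lam * Real.sqrt μ₂ * (M * N) * (lam * (M * N)) :=
          mul_le_mul hql this (by positivity) (by positivity)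
        _ = lam * Real.sqrt lam * Real.sqrt μ₂ * (M * N) ^ 2 := by ring
    have hC3 : 1 ≤ 32 * (C ^ 3 * sR ^ 3) := by
      have h1 : (1 / 2 : ℝ) ^ 3 ≤ C ^ 3 := pow_le_pow_left₀ (by norm_num) hC 3
      have hs : 2 / 3 ≤ sR := by nlinarith only [hsR1, hs2, hsR0.le]
      have h2 : (2 / 3 : ℝ) ^ 3 ≤ sR ^ 3 := pow_le_pow_left₀ (by norm_num) hs 3
      have h3 := mul_le_mul h1 h2 (by norm_num) (by positivity)
      have h4 : (1 : ℝ) ≤ 32 * ((1 / 2 : ℝ) ^ 3 * (2 / 3) ^ 3) := by norm_num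
      linarith only [h3, h4]
    have hA : 0 ≤ kapL 4 * (lam * Real.sqrt lam * Real.sqrt μ₂ * (M * N) ^ 2) * sR := by
      have := (kapL_pos 4).le; positivity
    calc kapL ℓ * q ^ 3 * sR ≤ kapL 4 * (lam * Real.sqrt lam * Real.sqrt μ₂ * (M * N) ^ 2) * sR :=
          mul_le_mul (mul_le_mul hk4 hq3 (by positivity) (kapL_pos 4).le) le_rfl hsR0.le
            (by have := (kapL_pos 4).le; positivity)
      _ = kapL 4 * (lam * Real.sqrt lam * Real.sqrt μ₂ * (M * N) ^ 2) * sR * 1 := (mul_one _).symm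
      _ ≤ kapL 4 * (lam * Real.sqrt lam * Real.sqrt μ₂ * (M * N) ^ 2) * sR * (32 * (C ^ 3 * sR ^ 3)) :=
          mul_le_mul_of_nonneg_left hC3 hA
      _ = 32 * kapL 4 * (lam * Real.sqrt lam) * Real.sqrt μ₂ * (C ^ 2 * (M * N) ^ 2 * sR ^ 4) * C := by ring
  · -- `C sR³ q / kapL ℓ ≤ 3 μ₂ √λ √μ₂ / kapL 0 · C² (MN)² sR⁴ · kapL ℓ`
    rw [div_le_iff₀ hkℓ]
    have hCMN : 1 ≤ 3 * μ₂ * (C * (M * N) * sR) := by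
      have hmn : 1 / μ₂ ≤ M * N := by rw [div_le_iff₀ hμ₂]; linarith only [hMN]
      have hs : 2 / 3 ≤ sR := by nlinarith only [hsR1, hs2, hsR0.le]
      have h1 : 1 / 2 * (1 / μ₂) * (2 / 3) ≤ C * (M * N) * sR :=
        mul_le_mul (mul_le_mul hC hmn (by positivity) hC0.le) hs (by norm_num) (by positivity)
      have h2 : 3 * μ₂ * (1 / 2 * (1 / μ₂) * (2 / 3)) = 1 := by field_simp
      have h3 := mul_le_mul_of_nonneg_left h1 (by positivity : (0:ℝ) ≤ 3 * μ₂)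
      linarith only [h2, h3]
    have hA : 0 ≤ Real.sqrt lam * Real.sqrt μ₂ * (C * (M * N) * sR ^ 3) := by positivity
    calc C * sR ^ 3 * q ≤ C * sR ^ 3 * (Real.sqrt lam * Real.sqrt μ₂ * (M * N)) :=
          mul_le_mul_of_nonneg_left hql (by positivity)
      _ = Real.sqrt lam * Real.sqrt μ₂ * (C * (M * N) * sR ^ 3) * 1 := by ring
      _ ≤ Real.sqrt lam * Real.sqrt μ₂ * (C * (M * N) * sR ^ 3) * (3 * μ₂ * (C * (M * N) * sR)) :=
          mul_le_mul_of_nonneg_left hCMN hA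
      _ = 3 * μ₂ * Real.sqrt lam * Real.sqrt μ₂ / kapL 0 * (C ^ 2 * (M * N) ^ 2 * sR ^ 4) * kapL 0 := by
          field_simp
      _ ≤ 3 * μ₂ * Real.sqrt lam * Real.sqrt μ₂ / kapL 0 * (C ^ 2 * (M * N) ^ 2 * sR ^ 4) * kapL ℓ :=
          mul_le_mul_of_nonneg_left hkℓ0 (by positivity)


/-! ### The final per-piece bound and the assembly -/

/-- The `ℓ`-sum of conversion constants. [folklore] -/
def convSum : ℝ := ∑ ℓ ∈ Finset.range 5, convConst ℓ

/-- `convSum ≥ 0`. [folklore] -/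
theorem convSum_nonneg : 0 ≤ convSum := Finset.sum_nonneg fun ℓ _ => convConst_nonneg ℓ

set_option maxHeartbeats 1600000 in
/-- **The bound for one piece `(j, i)` in final form.**
`‖piece‖ ≤ I₅ c₀ K c_E^{ε₁} P^{2ε₁} · 2 convSum (√32 λ + 3) √λ · √(diL²) √M ‖b‖₂`, `P = CMNR`.
[cite: DeshouillersIwaniec1982, §9.1 pp. 278–280; Drappeau2017, §4.3.2 proof of Prop. 4.13] -/
theorem norm_piece_final {g₀ : ℝ × ℝ → ℝ} (hg : ContDiff ℝ ∞ g₀) (hc : HasCompactSupport g₀)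
    (hsupp : tsupport g₀ ⊆ Set.Icc (1 : ℝ) 2 ×ˢ Set.Ioi (0 : ℝ)) {μ₁ μ₂ : ℝ} (hμ₁ : 0 < μ₁) (hμ₂ : 0 < μ₂)
    (hys : ∀ x y : ℝ, g₀ (x, y) ≠ 0 → (1 ≤ x ∧ x ≤ 2) ∧ (μ₁ ≤ y ∧ y ≤ μ₂))
    {ε₁ K : ℝ} (hε₁ : 0 ≤ ε₁) (hK0 : 0 ≤ K)
    (hK : ∀ X : ℝ, 0 < X → ∀ φ : ℝ → ℂ, ContDiff ℝ ∞ φ →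
      (∀ x, φ x ≠ 0 → x ∈ Set.Icc X (2 * X)) → (∀ j ≤ 4, ∀ x, ‖iteratedDeriv j φ x‖ ≤ X ^ (-(j : ℝ))) →
      ∀ M N R : ℝ, 1 / 2 ≤ M → 1 / 2 ≤ N → 1 / 2 ≤ R → ∀ θ : ℝ, ∀ β : ℕ → ℕ → ℂ, ∀ a u : ℕ,
        M < a + 1 → (u : ℝ) ≤ 2 * M → ∀ sgn : ℤ, (sgn = 1 ∨ sgn = -1) → ∀ cM : ℕ,
        8 * π * Real.sqrt (M * N) / (X * Real.sqrt R) ≤ cM →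
          ‖kuzSum φ θ R N a u sgn cM β‖ ≤
            K * ((X + X⁻¹) * R * M * N) ^ ε₁ * (Lreg X M N R + Lexc X M N R) *
              Real.sqrt (∑ r ∈ dyadic R, ∑ n ∈ dyadic N, ‖β n r‖ ^ 2))
    {C M N R : ℝ} (hC : 1 / 2 ≤ C) (hM : 0 < M) (hN : 1 ≤ N) (hR : 1 / 2 ≤ R) (hμM : 1 ≤ μ₂ * M)
    {j : ℕ} (hj : j ≤ Nat.log 2 ⌊N⌋₊) {nP i : ℕ} (hi : i < nP) {lam : ℝ} (hlam : 1 ≤ lam)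
    (hlam' : (2 : ℝ) ^ nP * (μ₁ / 2) ≤ lam) (m₁ m₂ : ℕ) {sgn : ℤ} (hsgn : sgn = 1 ∨ sgn = -1)
    (b : ℕ → ℕ → ℂ) :
    ‖pieceSum g₀ C M R (block ⌊N⌋₊ j) (max (Tthr (μ₁ * M / 2) i) (m₁ - 1)) (min (Tthr (μ₁ * M / 2) (i + 1)) m₂)
        sgn ⌊2 * C⌋₊ b‖ ≤
      (∫ w : E2, ‖FT hg hc hsupp w‖ * (1 + ‖w‖) ^ 5) * coreConst *
        (K * (cE lam μ₂ ^ ε₁ * (C * M * N * R) ^ (2 * ε₁)) * (2 * convSum) * (Real.sqrt 32 * lam + 3) *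
          Real.sqrt lam) *
        (Real.sqrt (diLSq C M N R) * Real.sqrt M *
          Real.sqrt (∑ r ∈ dyadic R, ∑ n ∈ Finset.Icc 1 ⌊N⌋₊, ‖b n r‖ ^ 2)) := by
  set t₀ : ℝ := μ₁ * M / 2 with ht₀
  set a : ℕ := max (Tthr t₀ i) (m₁ - 1) with ha
  set u : ℕ := min (Tthr t₀ (i + 1)) m₂ with hu
  have hC0 : 0 < C := by linarith
  have hR0 : 0 < R := by linarith
  have hN0 : 0 < N := by linarith
  have hI5 : 0 ≤ ∫ w : E2, ‖FT hg hc hsupp w‖ * (1 + ‖w‖) ^ 5 :=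
    integral_nonneg fun w => by positivity
  have hRHS0 : 0 ≤ (∫ w : E2, ‖FT hg hc hsupp w‖ * (1 + ‖w‖) ^ 5) * coreConst *
        (K * (cE lam μ₂ ^ ε₁ * (C * M * N * R) ^ (2 * ε₁)) * (2 * convSum) * (Real.sqrt 32 * lam + 3) *
          Real.sqrt lam) *
        (Real.sqrt (diLSq C M N R) * Real.sqrt M *
          Real.sqrt (∑ r ∈ dyadic R, ∑ n ∈ Finset.Icc 1 ⌊N⌋₊, ‖b n r‖ ^ 2)) := by
    have := coreConst_pos.le
    have := convSum_nonneg
    have := cE_nonneg (by linarith : 0 ≤ lam) hμ₂.le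
    positivity
  -- empty piece
  by_cases hau : u ≤ a
  · rw [pieceSum_eq_zero_of_le g₀ C M R _ hau, norm_zero]
    exact hRHS0
  replace hau : a < u := not_le.1 hau
  -- the configuration
  set t : ℝ := (2 : ℝ) ^ i * t₀ with htdef
  have ht₀0 : 0 < t₀ := by positivity
  have ht0 : 0 < t := by positivity
  have hu2t : (u : ℝ) ≤ 2 * t := by
    have h1 : u ≤ Tthr t₀ (i + 1) := min_le_left _ _
    have h2 : (Tthr t₀ (i + 1) : ℝ) ≤ 2 ^ (i + 1) * t₀ := Nat.floor_le (by positivity)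
    calc (u : ℝ) ≤ Tthr t₀ (i + 1) := by exact_mod_cast h1
      _ ≤ 2 ^ (i + 1) * t₀ := h2
      _ = 2 * t := by rw [htdef, pow_succ]; ring
  have hu1 : (1 : ℝ) ≤ u := by
    have : 1 ≤ u := by omega
    exact_mod_cast this
  have ht12 : 1 / 2 ≤ t := by linarith
  have hta : t < a + 1 := by
    have h1 : Tthr t₀ i ≤ a := le_max_left _ _
    have h2 : t < (Tthr t₀ i : ℝ) + 1 := Nat.lt_floor_add_one _
    have h3 : (Tthr t₀ i : ℝ) ≤ a := by exact_mod_cast h1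
    linarith
  set N' : ℝ := (2 : ℝ) ^ j - 1 / 2 with hN'def
  have h2j : (1 : ℝ) ≤ (2 : ℝ) ^ j := one_le_pow₀ (by norm_num)
  have hN'12 : 1 / 2 ≤ N' := by rw [hN'def]; linarith
  have hN'0 : 0 < N' := by linarith
  have hNb : block ⌊N⌋₊ j ⊆ dyadic N' := block_subset_dyadic ⌊N⌋₊ j
  have hN₀ : 1 ≤ ⌊N⌋₊ := Nat.le_floor (by exact_mod_cast hN)
  have hN'N : N' ≤ N := by
    have h1 : 2 ^ j ≤ ⌊N⌋₊ := (Nat.pow_le_pow_right (by norm_num) hj).trans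
      (Nat.pow_log_le_self 2 (by omega))
    have h2 : ((2 ^ j : ℕ) : ℝ) ≤ ⌊N⌋₊ := by exact_mod_cast h1
    have h3 : (⌊N⌋₊ : ℝ) ≤ N := Nat.floor_le hN0.le
    push_cast at h2
    rw [hN'def]; linarith
  have htlam : t ≤ lam * M := by
    have h1 : (2 : ℝ) ^ i ≤ 2 ^ nP := pow_le_pow_right₀ (by norm_num) hi.le
    calc t = 2 ^ i * t₀ := rfl
      _ ≤ 2 ^ nP * t₀ := mul_le_mul_of_nonneg_right h1 ht₀0.le
      _ = 2 ^ nP * (μ₁ / 2) * M := by rw [ht₀]; ring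
      _ ≤ lam * M := mul_le_mul_of_nonneg_right hlam' hM.le
  have htN : t * N' ≤ lam * (M * N) := by
    calc t * N' ≤ lam * M * N := mul_le_mul htlam hN'N hN'0.le (by positivity)
      _ = lam * (M * N) := by ring
  have hMN : 1 ≤ μ₂ * (M * N) := by nlinarith
  -- enlarge the cutoff
  set cM : ℕ := max ⌊2 * C⌋₊ ⌈8 * π * Real.sqrt (t * N') / ((19 / 20 * Xa C R N' t) * Real.sqrt R)⌉₊ with hcMdef
  rw [← pieceSum_cM_eq hys hC0 M R (block ⌊N⌋₊ j) a u sgn (le_max_left _ _ : ⌊2 * C⌋₊ ≤ cM) b]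
  have hcM : 8 * π * Real.sqrt (t * N') / ((19 / 20 * Xa C R N' t) * Real.sqrt R) ≤ cM :=
    (Nat.le_ceil _).trans (by rw [hcMdef]; exact_mod_cast le_max_right _ _)
  have h412s := h412s_of_H91 (M := M) hK hC0 hR hN'12 ht12 (block ⌊N⌋₊ j) hta hu2t hsgn hcM b
  have hmain := norm_pieceSum_le hg hc hsupp hys hC0 hR0 hN'0 ht0 hNb hta hu2t hau.le sgn cM b hK0 h412s
  refine hmain.trans ?_
  rw [mul_assoc _ _ (Real.sqrt (diLSq C M N R) * Real.sqrt M * _)]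
  refine mul_le_mul_of_nonneg_left ?_ (mul_nonneg hI5 coreConst_pos.le)
  -- the `ℓ`-sum
  set nb : ℝ := Real.sqrt (∑ r ∈ dyadic R, ∑ n ∈ block ⌊N⌋₊ j, ‖b n r‖ ^ 2) with hnbdef
  set nbF : ℝ := Real.sqrt (∑ r ∈ dyadic R, ∑ n ∈ Finset.Icc 1 ⌊N⌋₊, ‖b n r‖ ^ 2) with hnbFdef
  have hnb : nb ≤ nbF := blockNorm_le b R ⌊N⌋₊ j
  have hnb0 : 0 ≤ nb := Real.sqrt_nonneg _
  have hP0 : 0 < C * M * N * R := by positivity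
  have hdiL0 : 0 ≤ Real.sqrt (diLSq C M N R) := Real.sqrt_nonneg _
  have hKsum := Ksum_le_diL (C := C) (R := R) hC0 hR0 hM hN0 ht0.le htlam hN'0.le hN'N hlam
  have hterm : ∀ ℓ ∈ Finset.range 5,
      Real.sqrt u * (19 / 20 * ((9 / 5) ^ ℓ * Xa C R N' t))⁻¹ * K *
        (((19 / 20 * ((9 / 5) ^ ℓ * Xa C R N' t)) + (19 / 20 * ((9 / 5) ^ ℓ * Xa C R N' t))⁻¹) * R * t * N') ^ ε₁ *
        (Lreg (19 / 20 * ((9 / 5) ^ ℓ * Xa C R N' t)) t N' R + Lexc (19 / 20 * ((9 / 5) ^ ℓ * Xa C R N' t)) t N' R) *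
        (Real.sqrt (2 * N') * nb) ≤
      K * (cE lam μ₂ ^ ε₁ * (C * M * N * R) ^ (2 * ε₁)) * (2 * convConst ℓ) * (Real.sqrt 32 * lam + 3) *
        Real.sqrt lam * (Real.sqrt (diLSq C M N R) * Real.sqrt M * nbF) := by
    intro ℓ hℓ
    have hℓ4 : ℓ ≤ 4 := by have := Finset.mem_range.1 hℓ; omega
    set X : ℝ := 19 / 20 * ((9 / 5) ^ ℓ * Xa C R N' t) with hXdef
    have hXa0 : 0 < Xa C R N' t := by unfold Xa; positivity
    have hX0 : 0 < X := by positivity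
    -- (i) the `ε`-factor
    have hE : ((X + X⁻¹) * R * t * N') ^ ε₁ ≤ cE lam μ₂ ^ ε₁ * (C * M * N * R) ^ (2 * ε₁) := by
      have hEle : (X + X⁻¹) * R * t * N' ≤ cE lam μ₂ * (C * M * N * R) ^ 2 := by
        rw [hXdef, Xl_eq hC0 hR0 ℓ]
        exact E_le hC hR hM hN0 hμ₂ hMN ht0 hN'0 hlam htN hℓ4
      have hE0 : 0 ≤ (X + X⁻¹) * R * t * N' := by positivity
      calc ((X + X⁻¹) * R * t * N') ^ ε₁ ≤ (cE lam μ₂ * (C * M * N * R) ^ 2) ^ ε₁ :=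
            Real.rpow_le_rpow hE0 hEle hε₁
        _ = cE lam μ₂ ^ ε₁ * (C * M * N * R) ^ (2 * ε₁) := by
            rw [Real.mul_rpow (cE_nonneg (by linarith) hμ₂.le) (by positivity),
              show ((C * M * N * R) ^ 2 : ℝ) = (C * M * N * R) ^ (2 : ℝ) by norm_cast,
              ← Real.rpow_mul hP0.le]
    -- (ii) the conversion
    have hconv : Real.sqrt u * X⁻¹ *
        (Lreg X t N' R + Lexc X t N' R) * Real.sqrt (2 * N') ≤
        2 * convConst ℓ * (Real.sqrt 32 * lam + 3) * Real.sqrt (diLSq C M N R) * (Real.sqrt lam * Real.sqrt M) := by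
      have hL0 : 0 ≤ Lreg X t N' R + Lexc X t N' R := add_nonneg (Lreg_nonneg hX0.le) (Lexc_nonneg hX0.le)
      have hsu : Real.sqrt u ≤ Real.sqrt (2 * t) := Real.sqrt_le_sqrt hu2t
      have h22 : Real.sqrt (2 * t) * Real.sqrt (2 * N') = 2 * Real.sqrt (t * N') := by
        rw [← Real.sqrt_mul (by positivity), show 2 * t * (2 * N') = 2 ^ 2 * (t * N') by ring,
          Real.sqrt_mul (by positivity), Real.sqrt_sq (by norm_num)]
      have hcp := conv_piece hC0 hR0 hN'0 ht0 ℓ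
      rw [← hXdef] at hcp
      have hst : Real.sqrt t ≤ Real.sqrt lam * Real.sqrt M := by
        rw [← Real.sqrt_mul (by linarith)]; exact Real.sqrt_le_sqrt htlam
      have hcc := convConst_nonneg ℓ
      calc Real.sqrt u * X⁻¹ * (Lreg X t N' R + Lexc X t N' R) * Real.sqrt (2 * N')
          ≤ Real.sqrt (2 * t) * X⁻¹ * (Lreg X t N' R + Lexc X t N' R) * Real.sqrt (2 * N') := by gcongr
        _ = (Real.sqrt (2 * t) * Real.sqrt (2 * N')) * (X⁻¹ * (Lreg X t N' R + Lexc X t N' R)) := by ring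
        _ = 2 * (Real.sqrt (t * N') * X⁻¹ * (Lreg X t N' R + Lexc X t N' R)) := by
            rw [h22]; ring
        _ ≤ 2 * (convConst ℓ * (Real.sqrt (KregSq C t N' R) + Real.sqrt (KexcSq C N' R)) * Real.sqrt t) :=
            mul_le_mul_of_nonneg_left hcp (by norm_num)
        _ ≤ 2 * (convConst ℓ * ((Real.sqrt 32 * lam + 3) * Real.sqrt (diLSq C M N R)) *
              (Real.sqrt lam * Real.sqrt M)) := by gcongr
        _ = _ := by ring
    -- combine
    have hL0 : 0 ≤ Lreg X t N' R + Lexc X t N' R := add_nonneg (Lreg_nonneg hX0.le) (Lexc_nonneg hX0.le)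
    have hA0 : 0 ≤ Real.sqrt u * X⁻¹ * (Lreg X t N' R + Lexc X t N' R) * Real.sqrt (2 * N') := by positivity
    have hE0 : 0 ≤ ((X + X⁻¹) * R * t * N') ^ ε₁ := by positivity
    calc Real.sqrt u * X⁻¹ * K * ((X + X⁻¹) * R * t * N') ^ ε₁ * (Lreg X t N' R + Lexc X t N' R) *
          (Real.sqrt (2 * N') * nb)
        = K * ((X + X⁻¹) * R * t * N') ^ ε₁ *
            (Real.sqrt u * X⁻¹ * (Lreg X t N' R + Lexc X t N' R) * Real.sqrt (2 * N')) * nb := by ring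
      _ ≤ K * (cE lam μ₂ ^ ε₁ * (C * M * N * R) ^ (2 * ε₁)) *
            (2 * convConst ℓ * (Real.sqrt 32 * lam + 3) * Real.sqrt (diLSq C M N R) * (Real.sqrt lam * Real.sqrt M)) *
            nbF := by
          have hcc := convConst_nonneg ℓ
          have hce := cE_nonneg (by linarith : 0 ≤ lam) hμ₂.le
          have h2 : 0 ≤ K * (cE lam μ₂ ^ ε₁ * (C * M * N * R) ^ (2 * ε₁)) *
              (2 * convConst ℓ * (Real.sqrt 32 * lam + 3) * Real.sqrt (diLSq C M N R) *
                (Real.sqrt lam * Real.sqrt M)) := by positivity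
          exact mul_le_mul (mul_le_mul (mul_le_mul_of_nonneg_left hE hK0) hconv hA0 (by positivity)) hnb hnb0 h2
      _ = _ := by ring
  calc ∑ ℓ ∈ Finset.range 5, Real.sqrt u * (19 / 20 * ((9 / 5) ^ ℓ * Xa C R N' t))⁻¹ * K *
        (((19 / 20 * ((9 / 5) ^ ℓ * Xa C R N' t)) + (19 / 20 * ((9 / 5) ^ ℓ * Xa C R N' t))⁻¹) * R * t * N') ^ ε₁ *
        (Lreg (19 / 20 * ((9 / 5) ^ ℓ * Xa C R N' t)) t N' R + Lexc (19 / 20 * ((9 / 5) ^ ℓ * Xa C R N' t)) t N' R) *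
        (Real.sqrt (2 * N') * nb)
      ≤ ∑ ℓ ∈ Finset.range 5, K * (cE lam μ₂ ^ ε₁ * (C * M * N * R) ^ (2 * ε₁)) * (2 * convConst ℓ) *
          (Real.sqrt 32 * lam + 3) * Real.sqrt lam * (Real.sqrt (diLSq C M N R) * Real.sqrt M * nbF) :=
        Finset.sum_le_sum hterm
    _ = _ := by
        rw [convSum, Finset.mul_sum, Finset.mul_sum, Finset.sum_mul, Finset.sum_mul, Finset.sum_mul]



/-- `𝒯 = 0` when `C < 1/2` (no `c`). [folklore] -/
theorem diSum_eq_zero_of_C_lt (g₀ : ℝ × ℝ → ℝ) {C : ℝ} (hC : C < 1 / 2) (M : ℝ) (N₀ : ℕ) (R : ℝ) (m₁ m₂ : ℕ)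
    (sgn : ℤ) (b : ℕ → ℕ → ℂ) : diSum g₀ C M N₀ R m₁ m₂ sgn b = 0 := by
  unfold diSum
  have h0 : ⌊2 * C⌋₊ = 0 := Nat.floor_eq_zero.2 (by linarith)
  have he : Finset.Icc 1 0 = (∅ : Finset ℕ) := Finset.Icc_eq_empty_of_lt zero_lt_one
  refine Finset.sum_eq_zero fun r _ => Finset.sum_eq_zero fun n _ => ?_
  rw [h0, he, Finset.filter_empty]
  simp

/-- `𝒯 = 0` when `μ₂ M < 1` (no `m` in the support). [folklore] -/
theorem diSum_eq_zero_of_M_lt {g₀ : ℝ × ℝ → ℝ} {μ₁ μ₂ : ℝ}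
    (hys : ∀ x y : ℝ, g₀ (x, y) ≠ 0 → (1 ≤ x ∧ x ≤ 2) ∧ (μ₁ ≤ y ∧ y ≤ μ₂))
    (C : ℝ) {M : ℝ} (hM : 0 < M) (hμM : μ₂ * M < 1) (N₀ : ℕ) (R : ℝ) {m₁ : ℕ} (hm₁ : 1 ≤ m₁) (m₂ : ℕ)
    (sgn : ℤ) (b : ℕ → ℕ → ℂ) : diSum g₀ C M N₀ R m₁ m₂ sgn b = 0 := by
  unfold diSum
  refine Finset.sum_eq_zero fun r _ => Finset.sum_eq_zero fun n _ => ?_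
  rw [Finset.sum_eq_zero fun m hm => ?_, mul_zero]
  refine Finset.sum_eq_zero fun c _ => ?_
  have hm1 : (1 : ℝ) ≤ m := by exact_mod_cast hm₁.trans (Finset.mem_Icc.1 hm).1
  have hg : g₀ ((c : ℝ) / C, (m : ℝ) / M) = 0 := by
    by_contra hne
    have h := (hys _ _ hne).2.2
    rw [div_le_iff₀ hM] at h
    nlinarith
  rw [hg, Complex.ofReal_zero, zero_mul]

/-- `diL = √(diL²)`. [folklore] -/
theorem diL_eq_sqrt (C M N R : ℝ) : diL C M N R = Real.sqrt (diLSq C M N R) := rfl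

set_option maxHeartbeats 1600000 in
/-- **Deshouillers–Iwaniec's Theorem 11 at `s = 1` for dilation weights, from the Kuznetsov-shaped
bound of their §9.1.**  Given `H91At ε` for every `ε > 0` (the bound (9.4) + (9.7) for the sums
`∑_{(c,r)=1} (c√r)⁻¹ φ(4π√(mn)/(c√r)) 𝓢_c`, i.e. Kuznetsov for `Γ₀(r)` at the cusps `∞, 0` + the
spectral large sieve + the exceptional-spectrum theorems of Deshouillers–Iwaniec), the bound `DI11For g₀`
of their Theorem 11 at `s = 1` holds for every smooth `g₀` with compact support in `[1,2] × (0,∞)`: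
this is the step their §9.1 leaves to the reader (p. 278): separation of variables in
`g(c, m) = g₀(c/C, m/M)` (here by a two-dimensional Fourier
integral in `(log c, m)`, a smooth partition of the range of `x = 4π√(mn)/(c√r)` into pieces of ratio
`< 2`, Abel summation in `m`, and the conversion `√(MN) X⁻¹ (L_reg + L_exc) ≪ (K_reg + K_exc) √M`).
[cite: DeshouillersIwaniec1982, Theorem 11 p. 237 and §9.1 p. 278 ("general forms … section 7"); Drappeau2017, Prop. 4.13 and its proof §4.3.2] -/
theorem di11For_of_H91 (h91 : ∀ ε : ℝ, 0 < ε → H91At ε) {g₀ : ℝ × ℝ → ℝ} (hg : ContDiff ℝ ∞ g₀)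
    (hc : HasCompactSupport g₀) (hsupp : tsupport g₀ ⊆ Set.Icc (1 : ℝ) 2 ×ˢ Set.Ioi (0 : ℝ)) :
    DI11For g₀ := by
  intro ε hε
  obtain ⟨μ₁, μ₂, hμ₁, hμ₁₂, hys⟩ := exists_ySupport hc hsupp
  have hμ₂ : 0 < μ₂ := lt_of_lt_of_le hμ₁ hμ₁₂
  set ε₁ : ℝ := ε / 4 with hε₁
  set δ : ℝ := ε / 2 with hδ
  have hε₁0 : 0 < ε₁ := by positivity
  have hδ0 : 0 < δ := by positivity
  obtain ⟨K₀, hK₀⟩ := h91 ε₁ hε₁0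
  set K : ℝ := max K₀ 0 with hKdef
  have hK0 : 0 ≤ K := le_max_right _ _
  have hK : ∀ X : ℝ, 0 < X → ∀ φ : ℝ → ℂ, ContDiff ℝ ∞ φ →
      (∀ x, φ x ≠ 0 → x ∈ Set.Icc X (2 * X)) → (∀ j ≤ 4, ∀ x, ‖iteratedDeriv j φ x‖ ≤ X ^ (-(j : ℝ))) →
      ∀ M N R : ℝ, 1 / 2 ≤ M → 1 / 2 ≤ N → 1 / 2 ≤ R → ∀ θ : ℝ, ∀ β : ℕ → ℕ → ℂ, ∀ a u : ℕ,
        M < a + 1 → (u : ℝ) ≤ 2 * M → ∀ sgn : ℤ, (sgn = 1 ∨ sgn = -1) → ∀ cM : ℕ,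
        8 * π * Real.sqrt (M * N) / (X * Real.sqrt R) ≤ cM →
          ‖kuzSum φ θ R N a u sgn cM β‖ ≤
            K * ((X + X⁻¹) * R * M * N) ^ ε₁ * (Lreg X M N R + Lexc X M N R) *
              Real.sqrt (∑ r ∈ dyadic R, ∑ n ∈ dyadic N, ‖β n r‖ ^ 2) := by
    intro X hX φ h1 h2 h3 M N R hM hN hR θ β a u ha hu sgn hsgn cM hcM
    refine (hK₀ X hX φ h1 h2 h3 M N R hM hN hR θ β a u ha hu sgn hsgn cM hcM).trans ?_
    have hL : 0 ≤ Lreg X M N R + Lexc X M N R := add_nonneg (Lreg_nonneg hX.le) (Lexc_nonneg hX.le)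
    have hM0 : 0 < M := by linarith
    have hN0 : 0 < N := by linarith
    have hR0 : 0 < R := by linarith
    have : 0 ≤ ((X + X⁻¹) * R * M * N) ^ ε₁ * (Lreg X M N R + Lexc X M N R) *
        Real.sqrt (∑ r ∈ dyadic R, ∑ n ∈ dyadic N, ‖β n r‖ ^ 2) := by positivity
    calc K₀ * ((X + X⁻¹) * R * M * N) ^ ε₁ * (Lreg X M N R + Lexc X M N R) *
          Real.sqrt (∑ r ∈ dyadic R, ∑ n ∈ dyadic N, ‖β n r‖ ^ 2)
        = K₀ * (((X + X⁻¹) * R * M * N) ^ ε₁ * (Lreg X M N R + Lexc X M N R) *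
          Real.sqrt (∑ r ∈ dyadic R, ∑ n ∈ dyadic N, ‖β n r‖ ^ 2)) := by ring
      _ ≤ K * (((X + X⁻¹) * R * M * N) ^ ε₁ * (Lreg X M N R + Lexc X M N R) *
          Real.sqrt (∑ r ∈ dyadic R, ∑ n ∈ dyadic N, ‖β n r‖ ^ 2)) :=
          mul_le_mul_of_nonneg_right (le_max_left _ _) this
      _ = _ := by ring
  -- the number of `m`-pieces and the scale `λ`
  set nP : ℕ := ⌈2 * μ₂ / μ₁⌉₊ + 1 with hnPdef
  have hnP : 2 * μ₂ / μ₁ ≤ (2 : ℝ) ^ nP := by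
    have h1 : 2 * μ₂ / μ₁ ≤ ⌈2 * μ₂ / μ₁⌉₊ := Nat.le_ceil _
    have h2 : ((⌈2 * μ₂ / μ₁⌉₊ + 1 : ℕ) : ℝ) ≤ (2 : ℝ) ^ nP := by
      rw [hnPdef]; exact_mod_cast (Nat.lt_two_pow_self).le
    push_cast at h2
    linarith
  set lam : ℝ := (2 : ℝ) ^ nP * max 1 μ₁ with hlamdef
  have h2nP : (1 : ℝ) ≤ (2 : ℝ) ^ nP := one_le_pow₀ (by norm_num)
  have hlam : 1 ≤ lam := by
    rw [hlamdef]; nlinarith [le_max_left (1:ℝ) μ₁]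
  have hlam' : (2 : ℝ) ^ nP * (μ₁ / 2) ≤ lam := by
    rw [hlamdef]
    refine mul_le_mul_of_nonneg_left ?_ (by positivity)
    linarith [le_max_right (1:ℝ) μ₁]
  -- the constant
  set I5 : ℝ := ∫ w : E2, ‖FT hg hc hsupp w‖ * (1 + ‖w‖) ^ 5 with hI5def
  have hI5 : 0 ≤ I5 := integral_nonneg fun w => by positivity
  set A : ℝ := I5 * coreConst * (K * cE lam μ₂ ^ ε₁ * (2 * convSum) * (Real.sqrt 32 * lam + 3) * Real.sqrt lam)
    with hAdef
  have hA0 : 0 ≤ A := by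
    have := coreConst_pos.le; have := convSum_nonneg
    have := cE_nonneg (by linarith : 0 ≤ lam) hμ₂.le
    positivity
  set cδ : ℝ := 1 / (δ * Real.log 2) + 1 with hcδ
  have hcδ0 : 0 ≤ cδ := by
    have := Real.log_pos (by norm_num : (1:ℝ) < 2); positivity
  refine ⟨cδ * (4 * μ₂) ^ δ * nP * A, fun C M N R hC hM hN hR b m₁ m₂ hm₁ sgn hsgn => ?_⟩
  have hRHS0 : 0 ≤ cδ * (4 * μ₂) ^ δ * nP * A * (C * M * N * R) ^ ε * diL C M N R * Real.sqrt M *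
      Real.sqrt (∑ r ∈ dyadic R, ∑ n ∈ Finset.Icc 1 ⌊N⌋₊, ‖b n r‖ ^ 2) := by
    have := diL_nonneg C M N R; positivity
  -- trivial cases
  by_cases hC12 : C < 1 / 2
  · rw [diSum_eq_zero_of_C_lt g₀ hC12, norm_zero]; exact hRHS0
  by_cases hμM : μ₂ * M < 1
  · rw [diSum_eq_zero_of_M_lt hys C hM hμM ⌊N⌋₊ R hm₁ m₂ sgn b, norm_zero]; exact hRHS0
  push Not at hC12 hμM
  -- main case
  have hR0 : 0 < R := by linarith
  have hN0 : 0 < N := by linarith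
  have hP0 : 0 < C * M * N * R := by positivity
  have hnP' : μ₂ * M ≤ (2 : ℝ) ^ nP * (μ₁ * M / 2) := by
    rw [div_le_iff₀ hμ₁] at hnP
    nlinarith
  rw [diSum_eq_sum_pieces hμ₁ hys C hM ⌊N⌋₊ R hm₁ sgn b hnP']
  -- per-piece bound
  set nbF : ℝ := Real.sqrt (∑ r ∈ dyadic R, ∑ n ∈ Finset.Icc 1 ⌊N⌋₊, ‖b n r‖ ^ 2) with hnbF
  set PB : ℝ := A * (C * M * N * R) ^ (2 * ε₁) * (Real.sqrt (diLSq C M N R) * Real.sqrt M * nbF) with hPB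
  have hpiece : ∀ j ∈ Finset.range (Nat.log 2 ⌊N⌋₊ + 1), ∀ i ∈ Finset.range nP,
      ‖pieceSum g₀ C M R (block ⌊N⌋₊ j) (max (Tthr (μ₁ * M / 2) i) (m₁ - 1))
        (min (Tthr (μ₁ * M / 2) (i + 1)) m₂) sgn ⌊2 * C⌋₊ b‖ ≤ PB := by
    intro j hj i hi
    have hj' : j ≤ Nat.log 2 ⌊N⌋₊ := Nat.lt_succ_iff.1 (Finset.mem_range.1 hj)
    have hi' : i < nP := Finset.mem_range.1 hi
    refine (norm_piece_final hg hc hsupp hμ₁ hμ₂ hys hε₁0.le hK0 hK hC12 hM hN hR hμM hj' hi' hlam hlam'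
      m₁ m₂ hsgn b).trans (le_of_eq ?_)
    rw [hPB, hAdef]; ring
  have hsum : ‖∑ j ∈ Finset.range (Nat.log 2 ⌊N⌋₊ + 1), ∑ i ∈ Finset.range nP,
      pieceSum g₀ C M R (block ⌊N⌋₊ j) (max (Tthr (μ₁ * M / 2) i) (m₁ - 1))
        (min (Tthr (μ₁ * M / 2) (i + 1)) m₂) sgn ⌊2 * C⌋₊ b‖ ≤ ((Nat.log 2 ⌊N⌋₊ + 1 : ℕ) : ℝ) * (nP * PB) := by
    refine (norm_sum_le _ _).trans ?_
    refine (Finset.sum_le_sum fun j hj => (norm_sum_le _ _).trans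
      (Finset.sum_le_sum fun i hi => hpiece j hj i hi)).trans ?_
    rw [Finset.sum_const, Finset.card_range, nsmul_eq_mul]
    refine le_of_eq ?_
    rw [Finset.sum_const, Finset.card_range, nsmul_eq_mul]
  refine hsum.trans ?_
  -- count the blocks and collect the powers of `P`
  have hlog : ((Nat.log 2 ⌊N⌋₊ + 1 : ℕ) : ℝ) ≤ cδ * N ^ δ := by
    have h := natLog_two_add_one_le (n := ⌊N⌋₊) hδ0 hN (Nat.floor_le hN0.le)
    push_cast at h ⊢
    exact h
  have hNP : N ≤ 4 * μ₂ * (C * M * N * R) := by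
    -- `C ≥ 1/2`, `R ≥ 1/2`, `μ₂ M ≥ 1`
    have h1 : N = (1 / 2) * 1 * N * (1 / 2) * 4 := by ring
    have : (1 / 2) * 1 * N * (1 / 2) ≤ C * (μ₂ * M) * N * R := by
      refine mul_le_mul (mul_le_mul (mul_le_mul hC12 hμM (by norm_num) (by linarith)) le_rfl hN0.le
        (by positivity)) hR (by norm_num) (by positivity)
    nlinarith
  have hNδ : N ^ δ ≤ (4 * μ₂) ^ δ * (C * M * N * R) ^ δ := by
    rw [← Real.mul_rpow (by positivity) hP0.le]
    exact Real.rpow_le_rpow hN0.le hNP hδ0.le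
  have hPB0 : 0 ≤ PB := by rw [hPB]; positivity
  have hPpow : (C * M * N * R) ^ δ * (C * M * N * R) ^ (2 * ε₁) = (C * M * N * R) ^ ε := by
    rw [← Real.rpow_add hP0]; congr 1; rw [hδ, hε₁]; ring
  rw [diL_eq_sqrt]
  calc ((Nat.log 2 ⌊N⌋₊ + 1 : ℕ) : ℝ) * (nP * PB) ≤ cδ * N ^ δ * (nP * PB) :=
        mul_le_mul_of_nonneg_right hlog (by positivity)
    _ ≤ cδ * ((4 * μ₂) ^ δ * (C * M * N * R) ^ δ) * (nP * PB) := by gcongr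
    _ = cδ * (4 * μ₂) ^ δ * nP * A * ((C * M * N * R) ^ δ * (C * M * N * R) ^ (2 * ε₁)) *
          Real.sqrt (diLSq C M N R) * Real.sqrt M * nbF := by rw [hPB]; ring
    _ = _ := by rw [hPpow]

end L1

end BFI

open BFI

section Consequences

/-- **Deshouillers–Iwaniec's Theorem 11 at `s = 1` (dilation weights) from `H91At`.**
[cite: DeshouillersIwaniec1982, §1.4 Theorem 11 p. 237, §9.1 pp. 278–280] -/
theorem BFI.L1.di11For_all_of_H91 (h91 : ∀ ε : ℝ, 0 < ε → BFI.L1.H91At ε) :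
    ∀ g₀ : ℝ × ℝ → ℝ, ContDiff ℝ ∞ g₀ → HasCompactSupport g₀ →
      tsupport g₀ ⊆ Set.Icc (1 : ℝ) 2 ×ˢ Set.Ioi (0 : ℝ) → BFI.L1.DI11For g₀ :=
  fun _ hg hc hsupp => BFI.L1.di11For_of_H91 h91 hg hc hsupp

/-- **BFI 1986, Theorem 5 (§12, p. 237) from the Kuznetsov-shaped bound `H91At`.**
[cite: BombieriFriedlanderIwaniecActa1986, §12 Theorem 5 p. 237; DeshouillersIwaniec1982, §9.1 pp. 278–280] -/
theorem BombieriFriedlanderIwaniecTheorem5_of_H91 (h91 : ∀ ε : ℝ, 0 < ε → BFI.L1.H91At ε) :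
    BombieriFriedlanderIwaniecTheorem5 :=
  BombieriFriedlanderIwaniecTheorem5_of_di11 (BFI.L1.di11For_all_of_H91 h91)

/-- **BFI 1986, Theorem 1 (§8, p. 225) from `H91At`.**
[cite: BombieriFriedlanderIwaniecActa1986, §8 Theorem 1 p. 225; DeshouillersIwaniec1982, §9.1 pp. 278–280] -/
theorem BombieriFriedlanderIwaniecTheorem1_of_H91 (h91 : ∀ ε : ℝ, 0 < ε → BFI.L1.H91At ε) :
    BombieriFriedlanderIwaniecTheorem1 :=
  BombieriFriedlanderIwaniecTheorem1_of_di11 (BFI.L1.di11For_all_of_H91 h91)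

/-- **BFI 1986, Theorem 10 (p. 209) from `H91At`.**
[cite: BombieriFriedlanderIwaniecActa1986, Theorem 10 p. 209; DeshouillersIwaniec1982, §9.1 pp. 278–280] -/
theorem BombieriFriedlanderIwaniecTheorem10_of_H91 (h91 : ∀ ε : ℝ, 0 < ε → BFI.L1.H91At ε) :
    BombieriFriedlanderIwaniecTheorem10 :=
  BombieriFriedlanderIwaniecTheorem10_of_di11 (BFI.L1.di11For_all_of_H91 h91)

/-- **The level-`4/7` fact `bfi_wellFactorable_level` from `H91At`.**
[cite: BombieriFriedlanderIwaniecActa1986, Theorem 10 p. 209] -/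
theorem bfi_wellFactorable_level_of_H91 (h91 : ∀ ε : ℝ, 0 < ε → BFI.L1.H91At ε) :
    bfi_wellFactorable_level :=
  bfi_wellFactorable_level_of_di11 (BFI.L1.di11For_all_of_H91 h91)

/-- **The twin-prime sieve bound `twinSieve_bfi` from `H91At`.**
[cite: BombieriFriedlanderIwaniecActa1986, Theorem 10 p. 209] -/
theorem twinSieve_bfi_of_H91 (h91 : ∀ ε : ℝ, 0 < ε → BFI.L1.H91At ε) :
    twinSieve_bfi :=
  twinSieve_bfi_of_di11 (BFI.L1.di11For_all_of_H91 h91)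

end Consequences

end Literature.NumberTheory.Sieve
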